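import Literature.Topology.FourManifolds.MMSWRasmussenFacts
import Literature.Topology.FourManifolds.MMSWFibreRotation
import Literature.Topology.FourManifolds.DehnSurgery
import Literature.Topology.FourManifolds.KirbyMoves
import Literature.Topology.FourManifolds.SPC4Wave0Proofs
import Summits.SmoothPoincare4.SmoothPoincare4.Theses.DottedCircleRasmussen
import Summits.SmoothPoincare4.SmoothPoincare4.Theorems.DottedCircleRasmussenDcrEngineGlue
import Summits.SmoothPoincare4.SmoothPoincare4.Theorems.DottedCircleRasmussenDcrGapStubSectorBlind
import Summits.SmoothPoincare4.SmoothPoincare4.Theorems.DottedCircleRasmussenDcrGapStubFriendsH2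
import Summits.SmoothPoincare4.SmoothPoincare4.Theorems.DottedCircleRasmussenDcrGapStubSectorBlindPerHandle
import Summits.SmoothPoincare4.SmoothPoincare4.Theorems.DottedCircleRasmussenDcrGapStubFriendsPi1
import Summits.SmoothPoincare4.SmoothPoincare4.Theorems.DottedCircleRasmussenDcrGapStubFriendsCarrierReduction
import Summits.SmoothPoincare4.SmoothPoincare4.Theorems.DottedCircleRasmussenDcrGapStubHandlebodyChartReduction
import Summits.SmoothPoincare4.SmoothPoincare4.Theorems.DottedCircleRasmussenDcrGfgmw
import Summits.SmoothPoincare4.SmoothPoincare4.Theorems.DottedCircleRasmussenDcrGapHelperFriendsCarrierTk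
import Summits.SmoothPoincare4.SmoothPoincare4.Theorems.DottedCircleRasmussenDcrGapHelperHandlebodyChartModelHandlesOfData
import Summits.SmoothPoincare4.SmoothPoincare4.Theorems.DcrGap.Negative.NoDiscNormalForm
import Summits.SmoothPoincare4.SmoothPoincare4.Theorems.DcrGap.Negative.KZeroIsFgmw
import Summits.SmoothPoincare4.SmoothPoincare4.Theorems.DcrGap.Negative.NoEmbedding
import Summits.SmoothPoincare4.SmoothPoincare4.Theorems.DottedCircleRasmussenDcrGapHelperFriendsCarrierVkTransport
import Summits.SmoothPoincare4.SmoothPoincare4.Theorems.DottedCircleRasmussenDcrGapHelperFriendsCarrierVkRescale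
import Summits.SmoothPoincare4.SmoothPoincare4.Theorems.DottedCircleRasmussenDcrGapHelperFriendsCarrierVkAdaptedFieldNeat
import Summits.SmoothPoincare4.SmoothPoincare4.Theorems.DottedCircleRasmussenDcrGapHelperFriendsCarrierVkClockFlow
import Summits.SmoothPoincare4.SmoothPoincare4.Theorems.DottedCircleRasmussenDcrGapHelperFriendsCarrierVkDiscBand
import Summits.SmoothPoincare4.SmoothPoincare4.Theorems.DottedCircleRasmussenDcrGapHelperFriendsCarrierVkDiscTube
import Summits.SmoothPoincare4.SmoothPoincare4.Theorems.DottedCircleRasmussenDcrGapHelperFriendsCarrierVkFlowTube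
import Summits.SmoothPoincare4.SmoothPoincare4.Theorems.DottedCircleRasmussenDcrGapHelperFriendsCarrierVkCollarChart
import Summits.SmoothPoincare4.SmoothPoincare4.Theorems.DottedCircleRasmussenDcrGapHelperHandlebodyChartModelHandlesPhase
import Literature.Topology.FourManifolds.MMSWPictureSurgeryProofs
import Literature.Topology.FourManifolds.OneHandleUniquenessProofs

/-!
# Crux `DottedCircleRasmussen.DcrGap` (stmt-SmoothPoincare4-16128) — line `mk-friends`, skeleton v8

v8 (lead c3, cycle 2, after wave 1, 2026-08-17T13:4xZ).  Both provable v7 stubs came back `stub-misstated: SPLIT`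
with pieces LANDED: V_k ↦ parts A (framing theorem), B (flow-conical normal form), C (collar of the uninverted
exterior) assembled SORRY-FREE by `helper_friendsCarrier_Vk_of_parts` over the landed
`helper_friendsCarrier_Vk_transport` (p162445) and `helper_friendsCarrier_Vk_rescale` (p162552); Data ↦ parts 1
(explicit charts + lifts + cover), 2 (equivariant squeeze) and 3 (phase from lifts — LANDED
`helper_handlebodyChart_modelHandles_phaseOfLifts`, p162660; also landed p162321 ballBranch, p162954 squeezeComp,
p163187 fibreSqueeze) assembled SORRY-FREE by `helper_handlebodyChart_modelHandles_data_of_parts`.  REGISTERED STUBS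
(v8, 7 = stubs_max): `helper_friendsCarrier_Vk_partA/B/C`, `helper_handlebodyChart_modelHandles_data_part1/2`,
`stub_mmsw819`, `stub_friendsDatum`; V_k and Data are now DERIVED theorems of this file.

(v7 notes follow.)

# (v7) Crux `DottedCircleRasmussen.DcrGap` (stmt-SmoothPoincare4-16128) — line `mk-friends`, skeleton v7

v7 (lead c3, cycle 2, 2026-08-17).  RE-TYPED after the TTRL audit flagged the two registered stubs
`stub_friendsCarrier` (A) and `stub_friendsDatum` (G) as "self-implied": their registered signatures had
been TRUNCATED at the 3900-character registration cap (A: 7431 chars, G: 5486 chars fully qualified), and the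
truncated telescope parsed as `… → H → … → H`.  Neither stub was closed by anybody (the operator's
`intros; assumption` proposals p145861/p145877 BOUNCED); the statements themselves were never self-implied.
The fix, at the skeleton level (no new mathematics is claimed):

* A (`stub_friendsCarrier`) is NO LONGER A STUB: it is DERIVED (`friendsCarrier_of_parts`, sorry-free given the
  stubs) from the landed gluing reduction `Theorems.DcrGap.MkFriends.stub_friendsCarrier_of_collars` (p143881) fed
  with the DISCHARGED picture-surgery fact `pictureSurgeryPresentation_holds` (Kirby I §2 Lemma 2.1 in the MMSW
  picture — proved in `Literature/Topology/FourManifolds/MMSWPictureSurgeryProofs.lean`), the LANDED collar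
  `helper_friendsCarrier_Tk` (p156628) and the registered stub `helper_friendsCarrier_Vk` (Y-collared end of the
  inverted model disc exterior; 3814 chars, namespace-opened, complete; 12 preparatory pieces landed).
* D (`stub_handlebodyChart`) is NO LONGER A STUB: it is DERIVED (`handlebodyChart_of_parts`) from the landed
  reduction `helper_handlebodyChart_of_facts2` (p144219) fed with the DISCHARGED facts
  `oneHandle_ambientIsotopic_upToTwist_holds` (M1) and `arcs_ambientIsotopic_rel_of_homotopicRel_holds` (M2)
  (`Literature/Topology/FourManifolds/OneHandleUniquenessProofs.lean`) and the landed
  `helper_handlebodyChart_modelHandles_of_data` (p149320) applied to the registered stub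
  `helper_handlebodyChart_modelHandles_data` (explicit handle data of `D_k`; 3767 chars, complete).
* F (`stub_gfgmwWindow`) is NO LONGER A STUB: it is `Theorems.DcrGfgmw_of_mmsw819 stub_mmsw819` where the stub
  `stub_mmsw819` is LITERALLY the named Literature fact `MMSW.sMinus_nonpos_of_isModelSliceDisc` (MMSW Lemma 8.19;
  in the tree it is further reduced to the tower fact `MMSW.sMinus_nonpos_of_isTowerSliceInComplement` by
  `sMinus_nonpos_of_isModelSliceDisc_of_isTowerSliceInComplement`).
* G (`stub_friendsDatum`) is RESTATED namespace-opened (3686 chars < cap; the same proposition — the composition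
  `dcrRasmussenWitness_of_parts` consumes it at its fully qualified type unchanged).
* B, C landed (p144908, p138969); E dropped (v5).

REGISTERED STUBS (v7, 4): `helper_friendsCarrier_Vk` (V_k, provable differential topology, XL),
`helper_handlebodyChart_modelHandles_data` (model handle data, provable, L), `stub_mmsw819` (Literature debt
L8.19, Khovanov–Lee homology of `#ʳ(S¹×S²)`), `stub_friendsDatum` (THE APEX: an `M_k`-friends datum with a
sector-saturated certificate = an exotic-`S⁴` supply; by `closes` it carries the summit-negation content).
`DcrGap_of` concludes the crux BY NAME; `dcrRasmussenWitness_of_debts : V_k → Data → G → DcrRasmussenWitness`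
records that the ENGINE item 16151 follows from the two provable stubs and the apex alone (L8.19 enters only
through the window F).  To match a registered stub verbatim elaborate under this file's `open` lines.

(History v1–v6 follows.)
-/

/-!
# Crux `DottedCircleRasmussen.DcrGap` (stmt-SmoothPoincare4-16128) — line `mk-friends`, skeleton v1

Idea `mk-friends` (crux-ideate r1 k1; triage r1: pass ×2 after sharpening): **friends one level up** —
the Manolescu–Piccirillo disc-exterior swap lifted from `S³ = ∂B⁴` to `M_k = #ᵏ(S¹ × S²) = ∂D_k`.
If two model knots `K₀, K₁ ⊂ ∂D_k` have the same `0`-surgery `Y` (two framed-link presentations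
`U⁰ ⊔ J₀`, `U⁰ ⊔ J₁` of ONE `3`-manifold `Y`, `U` the dotted unlink picture, `J_i = D(0⃗)(K_i)` the
standard pictures), `K₁` bounds a smooth proper disc `Δ₁ = f₁(𝔻²)` in the model filling
`ℝ⁴ ∖ D_k° ⊂ ♮ᵏ(B² × S²)` (`MMSW.IsModelSliceDisc`, ANY depth), and the KERNEL CONDITION (KC) holds —
the dual knot `μ₁` of `J₁` dies wherever the dual knot `μ₀` of `J₀` dies — then the closed smooth
`4`-manifold `X := (D_k ∪ h²_{K₀}) ∪_Y (W₀ ∖ νΔ₁)` is a homotopy `4`-sphere in which (a sector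
reparametrisation of) `K₀` bounds the core disc off `D_k`; a certificate `s₋(K₀) > 0 ∨ s₊(K₀) < 0`
then makes it a `DcrRasmussenWitness`, and the route's GFGMW window gives `DcrGap`.

TRIAGE SHARPENINGS HONOURED.  (MC) ("the dotted solid tori of the two presentations coincide") is
DROPPED — with it the construction collapses to `k = 0` (triager 2).  Its price is that the model
handlebody `D_k ⊂ X` is only a GERM chart; `stub_handlebodyChart` shows that in a simply connected
`4`-manifold every germ chart of `D_k` extends to a global chart `ℝ⁴ ↪ X` after precomposition with a
product of PER-HANDLE SPHERE TWISTS `τ^ε : (z, w) ↦ (z, w · Π_j ((z - c_j)/|z - c_j|)^{ε_j})`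
(`MMSW.fibreRot`; germ embeddings of `D_k = ♮ᵏ(S¹ × B³)` are classified up to isotopy by orientation and
the `1`-handle framings `π₁(SO(3))ᵏ = (ℤ/2)ᵏ`), so the only certificate transport needed is PER-HANDLE
SECTOR BLINDNESS `stub_sectorBlindPerHandle` (MMSW Thm. 2.8 for the generators `σ_j`; the diagonal case
`ε = (j, …, j)` is the LANDED `stub_sectorBlind`, p130670, re-derived below as a consistency check).
The friends lemma itself is cut along the seams of the tree's PROVED `k = 0` template
(`Knot.ManolescuPiccirillo2023_lemma33_sphere_holds`: construction / `π₁` / `H₂` in complement form):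
`stub_friendsCarrier` (the glued carrier `X` with germ chart `i`, core disc `f₀`, exterior embedding
`j` of the model disc exterior `E° = ℝ⁴ ∖ (D_k ∪ Δ₁)` onto `X ∖ (i(D_k) ∪ f₀(𝔻²) ∪ {q})`, collar map
`c : Y → X`), `stub_friendsPi1` (van Kampen: `X` is simply connected as soon as the pushed meridian of
`Δ₁` is null-homotopic — which the COMPOSITION gets from (KC), applied to `Z := X`, `g := c`),
`stub_friendsH2` (`H₂(X; ℤ) = 0` by Mayer–Vietoris + Poincaré duality); recognition of homotopy
`4`-spheres is the tree's PROVED `nonempty_homotopyEquiv_sphere_four_iff_holds`.  The apex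
`stub_friendsDatum` is the NAMED SEARCH TARGET: an `M_k`-friends datum (`k ≥ 1`) with (KC), a W-slice
disc for `K₁` and a certificate for `K₀` — every clause but the certificate is a statement about
`3`-manifolds, link diagrams and one disc in `ℝ⁴`.  The window `stub_gfgmwWindow` is the body of the
route's support item `DcrGfgmw` (item 16153; = MMSW Lemma 8.19 + Palais, `DcrGfgmw_of_mmsw819` landed).

DISPROOF USED (`Cruxes/DcrGap/Disproof.lean` v2): the composition reaches the no-disc clause only
through the landed `DcrEngineGlue_proof`/`DcrTransport_proof`, i.e. through `Nonempty (N ≃ₘ S⁴)` —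
it honours `dcrGap_false_without_diffeo`; `stub_friendsDatum` has `k ≥ 1`, so it is not an instance of
the `k = 0` pin `Negative.KZeroIsFgmw` (p130570), and it asserts no embedding into `S⁴`
(`Negative.NoEmbedding`, p130705, constrains witnesses only).

`sorry` lives ONLY in `stub_*`; `DcrGap_of` concludes the crux BY NAME.

SKELETON v2/v3 (lead a1, cycle 1, 2026-08-17 — after waves 1–2; v3 = A's last clause weakened, see stub A).  LANDED: stub C `stub_friendsH2`
(p138969, `Theorems/DottedCircleRasmussenDcrGapStubFriendsH2*.lean`, Euler-characteristic count —
neither null-homology hypothesis is used); conditional reductions `stub_sectorBlindPerHandle_of_multiIndex`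
(p135840, E from the new named fact `Literature.Topology.FourManifolds.eventually_approxHasRasmussen_multiIndex`,
p135839) and `DcrGfgmw_of_mmsw819` (F from `MMSW.sMinus_nonpos_of_isModelSliceDisc`); helpers
`helper_handlebodyChart_zero` (p135641, D at k = 0), `helper_friendsCarrier_{exterior,meridianChart,
guardInactive,inversion}` (p135830 p136084 p136134 p136412).  RESHAPED on the workers' findings:
(1) the friends datum G now supplies, with the model slice disc `f₁`, its NEATNESS (radial derivative of
`levelFun ∘ f₁` negative on the boundary circle, as for `g₀`) and a TRIVIALISED TUBE
`T : D̊² × B(0,2) ↪ ℝ⁴ ∖ D_k` of the open disc (`T(x,0) = f₁ x`; the k = 0 tree carries the same datum as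
`ConicalDiscTube.G`), threaded as hypotheses into A and B — this removes the tubular-neighbourhood
theorem from the line and lets B port the tree's Kervaire lemma `homotopic_refl_map_of_meridian`
(van Kampen for `ℝ⁴ ∖ D_k = E° ∪ T(dom)`); accordingly the meridian is now the explicit tube meridian
`m v = T(0, v/2)` (A's old output clause (4), a one-point straightening chart, is dropped — it is the
landed `helper_friendsCarrier_meridianChart` anyway); (2) `Y` carries `[T2Space] [SecondCountableTopology]
[IsManifold (𝓡 3) ∞]` (G supplies, A consumes: the landed surgery-uniqueness theorem needs a manifold);
(3) stub D carries `[CompactSpace X]` (A supplies it; every isotopy-extension theorem in the tree needs a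
compact target).  Stub C is untouched (landed signature).  v4 (after wave 2): stub B LANDED (p144908, via
registered sub-goals G1/G2/G3 and the assembly `helper_friendsPi1_of_G123`); A and D reduced sorry-free to
explicit debts (landed reductions p143881, p144219); the theorem `dcrRasmussenWitness_of_debts` at the end of this
file derives `DcrGap` SORRY-FREE from exactly: P_k, T_k, V_k (A), M1, M2, M3 (D), MMSW Lemma 8.19 (F)
and the friends datum (G).  v6 (after wave 3): T_k LANDED (p156628 + 16 aux) and M3 reduced to its explicit
DATA (`helper_handlebodyChart_modelHandles_of_data`, p149320), so `dcrRasmussenWitness_of_debts` now takes: P_k, V_k,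
M1, M2, modelHandles-DATA, L8.19, G.  v5 (planner route-choice directive 2026-08-17T04:18Z, variant V1): stub E is
DROPPED — the multi-index fact is cited, never promoted — and stub G's certificate is SECTOR-SATURATED
(`∀ ε, ∃ w : MMSWRasmussen k (τ^ε ∘ K₀), 0 < s₋ ∨ s₊ < 0`), read by the composition in the sector that
stub D produces (`witness_of_chart_and_saturatedCertificate` shape); zero new Literature debt.  Open-after-v2 list kept for the record: A (blocked: picture
re-presentation P_k, collars T_k/V_k — `work/stubs/FriendsCarrier.blocked.md`), B (blocked: G1 `ℝ⁴ ∖ D_k`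
simply connected, G2 Kervaire port, G3 loops off `i(D_k) ∪ f₀(𝔻²)`), D (blocked: 1-handle uniqueness
M1–M3, `work/stubs/HandlebodyChart.blocked.md`), E, F (named facts), G (open apex).
-/

noncomputable section

set_option linter.dupNamespace false
set_option linter.style.longLine false

open scoped Manifold ContDiff Topology
open Function Set
open Literature.Topology.FourManifolds Literature.Topology.FourManifolds.MMSW
open Literature.AlgebraicTopology.Homotopy.HopfFibration (zC wC ofZW zC_ofZW wC_ofZW ofZW_zC_wC)
open Metric TopologicalSpace

namespace Summit.SmoothPoincare4.SmoothPoincare4.Cruxes.DcrGap.MkFriends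

open Summit.SmoothPoincare4.SmoothPoincare4.Theses

/-- Local notation: `𝔼 n` is the model Euclidean space `EuclideanSpace ℝ (Fin n)`. -/
local notation "𝔼 " n:arg => EuclideanSpace ℝ (Fin n)

/-- Local notation: `𝕊 n` is the unit sphere in `EuclideanSpace ℝ (Fin (n + 1))`. -/
local notation "𝕊 " n:arg => (Metric.sphere (0 : EuclideanSpace ℝ (Fin (n + 1))) 1)


/-! ## Registered stubs (v8) -/

/-- **Part A of the split of `helper_friendsCarrier_Vk` — the framing theorem.**  For a null-homologous model
knot `K₁ ⊂ M_k` off the cores with a neat model slice disc `f₁` and a tube `νK : 𝕊¹ × ℝ² → M_k` of `K₁`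
whose picture (`MMSW.draw`, placed in `S³` by `toSphereThree`) is, on the unit disc bundle, a `0`-framed
tubular neighbourhood `ν'` of the picture knot `J` (`ν'.HasFraming 0`), the fibre derivatives
`∂_{w₀}|₀ νK(u, ·)`, `∂_{w₁}|₀ νK(u, ·)` along `K₁` extend to a `C^∞` TRANSVERSAL FRAMING `(n₀, n₁)` of `f₁`
over the closed unit disc (`df₁ₓ v + a n₀ x + b n₁ x = 0` only trivially).  At the circle the prescribed
pair is transversal by neatness (`dνK(u, 0)` spans `T M_k` together with `K₁'`, and the radial derivative of
`f₁` leaves `T M_k` since `d/dρ G_k(f₁(ρ u)) < 0`); the extension over the disc exists iff the class in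
`π₁(GL₂ℝ) ≅ ℤ` of the boundary loop of frames, read in a trivialisation of the (trivial) normal bundle of the
disc, vanishes, i.e. iff `νK` induces on `K₁ = ∂Δ₁` the framing of the normal bundle of `Δ₁`.  WHY TRUE:
(1) that disc framing is the Seifert framing of `K₁` in `M_k`: for a Seifert surface `S ⊂ M_k` of `K₁`
(`[K₁] = 0`) pushed into `D_k°`, the closed surface `Σ = Δ₁ ∪ S` EMBEDS IN `ℝ⁴`, so its normal bundle is
trivial (`e = Σ·Σ = 0`), and comparing the trivialisations coming from the two halves across the corner
`K₁` identifies the disc framing with the push-off into `S`; (2) the Seifert framing is the one whose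
longitude is null-homologous in `M_k ∖ K₁`, and the `νK`-longitude is: its picture is the longitude of `ν'`,
trivial in `H₁(S³ ∖ J)`; in `H₁(S³ ∖ (J ∪ axis ∪ dotted circles U_j)) = ℤ^{k+2}` its coefficients are
`lk(J, U_j) = wind(z ∘ K₁, c_j) = 0` (`IsNullHomologous`) and `lk(·, axis)`, and the axis torus is refilled in
`M_k` by the tubular neighbourhood of the outer core circle `{w = 0}` with the SAME meridian (the `w`-circles,
drawn as circles of revolution), so the axis meridian dies in `H₁(M_k ∖ K₁)` (Kirby's picture
`M_k ∖ cores ≅ S³ ∖ (A ∪ ⋃ T_j)`, `M_k = S³_0(U)`).  The `k = 0` case is the tree's `SliceDiscZeroFraming.lean` /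
`SliceDiscConicalFramingExistence.lean` read backwards.  Consumed by Part B only through its conclusion.
[cite: Kirby1989, Ch. I §2] [cite: GompfStipsicz1999, §4.5] -/

theorem helper_friendsCarrier_Vk_partA : ∀ (k : ℕ) (K₁ : (sphere (0 : EuclideanSpace ℝ (Fin 2)) 1) → EuclideanSpace ℝ (Fin 4)) (f₁ : EuclideanSpace ℝ (Fin 2) → EuclideanSpace ℝ (Fin 4)) (νK : (sphere (0 : EuclideanSpace ℝ (Fin 2)) 1) × EuclideanSpace ℝ (Fin 2) → EuclideanSpace ℝ (Fin 4)), IsModelKnot k K₁ → IsModelSliceDisc k K₁ f₁ → (∀ t : (sphere (0 : EuclideanSpace ℝ (Fin 2)) 1), deriv (fun ρ : ℝ => levelFun k (f₁ (ρ • (t : EuclideanSpace ℝ (Fin 2))))) 1 < 0) → ContMDiff ((𝓡 1).prod 𝓘(ℝ, EuclideanSpace ℝ (Fin 2))) 𝓘(ℝ, EuclideanSpace ℝ (Fin 4)) ∞ νK → Injective νK → (∀ p, Injective (mfderiv ((𝓡 1).prod 𝓘(ℝ, EuclideanSpace ℝ (Fin 2))) 𝓘(ℝ, EuclideanSpace ℝ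 (Fin 4)) νK p)) → (∀ p, νK p ∈ modelBoundary k) → (∀ u : (sphere (0 : EuclideanSpace ℝ (Fin 2)) 1), νK (u, 0) = K₁ u) → IsNullHomologous k K₁ → (∀ t, wC (K₁ t) ≠ 0) → ∀ (J : Knot) (ν' : Knot.TubularNbhd J) (r : ℝ), (∀ p, wC (νK p) ≠ 0) → ν'.HasFraming 0 → 0 < r → (∀ (u : (sphere (0 : EuclideanSpace ℝ (Fin 2)) 1)) (w : EuclideanSpace ℝ (Fin 2)), ‖w‖ < 1 → toSphereThree (draw k (νK (u, w))).1 (draw k (νK (u, w))).2 = ν' (u, r • w)) → ∃ n₀ n₁ : EuclideanSpace ℝ (Fin 2) → EuclideanSpace ℝ (Fin 4), ContDiff ℝ ∞ n₀ ∧ ContDiff ℝ ∞ n₁ ∧ (∀ x ∈ closedBall (0 : EuclideanSpace ℝ (Fin 2)) 1, ∀ (v : EuclideanSpace ℝ (Fin 2)) (a b : ℝ), fderiv ℝ f₁ x v + a • n₀ x + b • n₁ x = 0 → v = 0 ∧ a = 0 ∧ b = 0) ∧ (∀ u : (sphere (0 : EuclideanSpace ℝ (Fin 2)) 1), n₀ u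 = fderiv ℝ (fun w : EuclideanSpace ℝ (Fin 2) => νK (u, w)) 0 (EuclideanSpace.single 0 1) ∧ n₁ u = fderiv ℝ (fun w : EuclideanSpace ℝ (Fin 2) => νK (u, w)) 0 (EuclideanSpace.single 1 1)) := by
  sorry

/-- **Part B of the split of `helper_friendsCarrier_Vk` — the flow-conical normal form with its framed tube.**
For a neat model slice disc `f₁` of the model knot `K₁`, a tube `νK : 𝕊¹ × ℝ² → M_k` of `K₁` and a transversal
framing `(n₀, n₁)` of `f₁` over the closed disc equal along the circle to the fibre derivatives of `νK`
(the output of Part A), there are: a `C^∞` complete flow `Φ` of `ℝ⁴` with the clock `G_k(Φ(s, x)) = 1 + s`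
(`x ∈ M_k`, `|s| ≤ 2ε`, `0 < ε ≤ 1/4`) and the band clause — the flow of the disc-adapted field, LANDED
`…VkAdaptedFieldNeat` + `…VkClockFlow` (`ε = 1/200`); a model slice disc `g` of `K₁` WITH THE SAME IMAGE
`g(𝔻²) = f₁(𝔻²)` which on the band `1 - s₁ ≤ t ≤ 1` is the flow line `g(t u) = Φ(1 - t, K₁ u)`; a scale
`0 < c ≤ 1`; and a trivialised tube `G` of the open disc (`C^∞` injective immersion of `D̊² × B(0,2)` off
`D_k`, `G(x, 0) = g x`) which over `1 - s₁ < t < 1` is the flow-out `G(t u, w) = Φ(1 - t, νK(u, c • w))` of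
the fibre-rescaled tube (LANDED `…VkFlowTube`: a `C^∞` injective immersion at levels `1 + (1 - t)`) and whose
deep part `‖x‖ ≤ 1 - s₀` misses the thin shell `Φ((0, s₀) × M_k)` (`0 < s₀ < s₁ < 2ε`).  CONSTRUCTION (pure
differential topology; two natural halves): (B1) the disc: by LANDED `…VkDiscFlowLinesNeat`/`…VkDiscBand` the
flow line from `K₁ u` IS the disc ray, `Φ(1 - t, K₁ u) = f₁(r̃(t, u) u)`, with
`r̃(t, u) = ‖(Finv (Φ(1 - t, K₁ u))).1‖` SMOOTH in `(t, u)` through the tube inverse `Finv` of LANDED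
`…VkDiscTube`, `r̃(1, u) = 1`, `∂_t r̃ = -1/∂_ρ(G_k ∘ f₁) > 0`; put `g = f₁ ∘ R`,
`R(x) = ‖x‖ λ(x)^{β(‖x‖)} x̂`, `λ(x) = r̃(‖x‖, x̂)/‖x‖`, with `β = 1` for `1 - ‖x‖ ≤ τ₀ e^{-1/C₀}` (`=: s₁`),
`β = 0` for `1 - ‖x‖ ≥ τ₀` (so `R = id` inside, in particular near `0`), and `β` a cutoff IN THE VARIABLE
`log (1 - ‖x‖)` so that `|β'(t) (1 - t)| ≤ C₀ sup β₀'`: then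
`∂_t (t λ^β) = λ^β [(1 - β) + β t ∂_t r̃ / r̃ + t β' log λ]` is POSITIVE because `|log λ| ≤ A (1 - t)` (`λ = 1`
on the circle) — a plain convex blend `β r̃ + (1 - β) t` is NOT monotone in general (`∂_t r̃(1, u)` is
arbitrary), whence the logarithmic cutoff; `R` is then a ray-preserving diffeomorphism of a neighbourhood of
`𝔻²` onto itself and `g` is a model slice disc with `g(𝔻²) = f₁(𝔻²)`, level-parametrised near the circle;
(B2) the tube: transport the framing to `g` (`nᵢ ∘ R`, same boundary values), blend it on a thin band into
the fibre derivative of the flow-out tube `C(x, w) = Φ(1 - ‖x‖, νK(x̂, w))` (they agree at the circle, so the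
convex blend stays transversal), and set `G(x, w) = G₀(x, c • w)`,
`G₀ = A + cut(‖x‖) • (C - A)`, `A(x, w) = g x + Σ wᵢ nᵢ'(x)` — the tree's `SliceDiscConicalTube.lean`
(`tube₀`, `hasFDerivAt_tube₀_zero`, `exists_injOn`, `exists_fderiv_mem_range`, `exists_norm_lt`) with the
cone `‖x‖ • ν(x̂, w)` replaced by the flow-out `C`; `s₀` by compactness of the deep tube off `D_k`.  TRUE.
[cite: Kosinski1993, Ch. III Thm (4.2)] [cite: Hirsch1976, Ch. 4 §5 Thm. 5.1] -/

theorem helper_friendsCarrier_Vk_partB : ∀ (k : ℕ) (K₁ : (sphere (0 : EuclideanSpace ℝ (Fin 2)) 1) → EuclideanSpace ℝ (Fin 4)) (f₁ : EuclideanSpace ℝ (Fin 2) → EuclideanSpace ℝ (Fin 4)) (νK : (sphere (0 : EuclideanSpace ℝ (Fin 2)) 1) × EuclideanSpace ℝ (Fin 2) → EuclideanSpace ℝ (Fin 4)), IsModelKnot k K₁ → IsModelSliceDisc k K₁ f₁ → (∀ t : (sphere (0 : EuclideanSpace ℝ (Fin 2)) 1), deriv (fun ρ : ℝ => levelFun k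 (f₁ (ρ • (t : EuclideanSpace ℝ (Fin 2))))) 1 < 0) → ContMDiff ((𝓡 1).prod 𝓘(ℝ, EuclideanSpace ℝ (Fin 2))) 𝓘(ℝ, EuclideanSpace ℝ (Fin 4)) ∞ νK → Injective νK → (∀ p, Injective (mfderiv ((𝓡 1).prod 𝓘(ℝ, EuclideanSpace ℝ (Fin 2))) 𝓘(ℝ, EuclideanSpace ℝ (Fin 4)) νK p)) → (∀ p, νK p ∈ modelBoundary k) → (∀ u : (sphere (0 : EuclideanSpace ℝ (Fin 2)) 1), νK (u, 0) = K₁ u) → ∀ (n₀ n₁ : EuclideanSpace ℝ (Fin 2) → EuclideanSpace ℝ (Fin 4)), ContDiff ℝ ∞ n₀ ∧ ContDiff ℝ ∞ n₁ ∧ (∀ x ∈ closedBall (0 : EuclideanSpace ℝ (Fin 2)) 1, ∀ (v : EuclideanSpace ℝ (Fin 2)) (a b : ℝ), fderiv ℝ f₁ x v + a • n₀ x + b • n₁ x = 0 → v = 0 ∧ a = 0 ∧ b = 0) ∧ (∀ u : (sphere (0 : EuclideanSpace ℝ (Fin 2)) 1), n₀ u = fderiv ℝ (fun w : EuclideanSpace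 ℝ (Fin 2) => νK (u, w)) 0 (EuclideanSpace.single 0 1) ∧ n₁ u = fderiv ℝ (fun w : EuclideanSpace ℝ (Fin 2) => νK (u, w)) 0 (EuclideanSpace.single 1 1)) → ∃ (Φ : ℝ × EuclideanSpace ℝ (Fin 4) → EuclideanSpace ℝ (Fin 4)) (ε s₁ s₀ c : ℝ) (g : EuclideanSpace ℝ (Fin 2) → EuclideanSpace ℝ (Fin 4)) (G : EuclideanSpace ℝ (Fin 2) × EuclideanSpace ℝ (Fin 2) → EuclideanSpace ℝ (Fin 4)), ContDiff ℝ ∞ Φ ∧ (∀ x, Φ (0, x) = x) ∧ (∀ s t x, Φ (s, Φ (t, x)) = Φ (s + t, x)) ∧ 0 < ε ∧ ε ≤ 1 / 4 ∧ (∀ x ∈ modelBoundary k, ∀ s : ℝ, |s| ≤ 2 * ε → (∀ j, (1 : ℝ) / 2 < holeTerm k j (Φ (s, x))) ∧ levelFun k (Φ (s, x)) = 1 + s) ∧ (∀ y, (∀ j, 0 < holeTerm k j y) → |levelFun k y - 1| < 2 * ε → Φ (1 - levelFun k y, y) ∈ modelBoundary k) ∧ 0 < s₀ ∧ s₀ <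 s₁ ∧ s₁ < 2 * ε ∧ 0 < c ∧ c ≤ 1 ∧ IsModelSliceDisc k K₁ g ∧ g '' closedBall 0 1 = f₁ '' closedBall 0 1 ∧ (∀ (u : (sphere (0 : EuclideanSpace ℝ (Fin 2)) 1)) (t : ℝ), 1 - s₁ ≤ t → t ≤ 1 → g (t • (u : EuclideanSpace ℝ (Fin 2))) = Φ (1 - t, K₁ u)) ∧ ContDiffOn ℝ ∞ G (ball 0 1 ×ˢ ball 0 2) ∧ InjOn G (ball 0 1 ×ˢ ball 0 2) ∧ (∀ q ∈ ball 0 1 ×ˢ ball 0 2, Injective (fderiv ℝ G q)) ∧ (∀ q ∈ ball 0 1 ×ˢ ball 0 2, G q ∉ modelHandlebody k) ∧ (∀ x ∈ ball 0 1, G (x, 0) = g x) ∧ (∀ (u : (sphere (0 : EuclideanSpace ℝ (Fin 2)) 1)) (t : ℝ) (w : EuclideanSpace ℝ (Fin 2)), 1 - s₁ < t → t < 1 → ‖w‖ < 2 → G (t • (u : EuclideanSpace ℝ (Fin 2)), w) = Φ (1 - t, νK (u, c • w))) ∧ (∀ (x w : EuclideanSpace ℝ (Fin 2)), ‖x‖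 ≤ 1 - s₀ → ‖w‖ < 2 → ∀ a ∈ modelBoundary k, ∀ s : ℝ, 0 < s → s < s₀ → G (x, w) ≠ Φ (s, a)) := by
  sorry

/-- **Part C of the split of `helper_friendsCarrier_Vk` — the collar of the uninverted disc exterior from the
normal form.**  Let `Φ` be a clocked complete flow of `ℝ⁴` along `M_k` (clock and band clauses, `0 < ε ≤ 1/4`),
`g` a model slice disc of the model knot `K₁` which is the flow line `g(t u) = Φ(1 - t, K₁ u)` on the band
`1 - s₁ ≤ t ≤ 1`, `ν : 𝕊¹ × ℝ² → M_k` a `C^∞` injective immersion with zero section `K₁`, and `G` a trivialised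
tube of the open disc off `D_k` which over the band is the flow-out `G(t u, w) = Φ(1 - t, ν(u, w))`
(`‖w‖ < 2`) and whose deep part `‖x‖ ≤ 1 - s₀` misses the shell `Φ((0, s₀) × M_k)` (`0 < s₀ < s₁ < 2ε`).  Let
the `3`-manifold `Y` be presented as `M_k` surgered along `K₁` through `ν` (the hypothesis block of
`helper_friendsCarrier_Vk`: solid torus `jB`, chart `jM` on `W` with inverse `ψ`, cover, gluing relation).
Then the exterior `E = ℝ⁴ ∖ (D_k ∪ g(𝔻²))` (as `Opens ℝ⁴`) has a collar `c : Y × ℝ ⇀ E` with source `Y × ℝ`,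
`C^∞` with `C^∞` inverse, whose sublevel images `c(Y × (-∞, a])` are closed in `E` (they accumulate only at
`D_k ∪ Δ`), whose sets `(c.target)ᶜ ∪ c(Y × [a, ∞))` are closed in `ℝ⁴`, whose image is bounded, and whose
core loop is the tube meridian: `c(jB(0, v), 0) = G(0, v/2)`.  This is the tree's `SliceDiscEndCollar.lean`
(`ConicalDiscTube.collar`: shell formula `Φ(ℓ, a)`, `ℓ = Einv s₀ e^{-σ}`, in place of `(1 - ℓ) • a`; tube
formula `G((1 - ℓ) u, r ŵ)`, `(ℓ, r) = Ψ⁻¹(‖w‖, σ)` with the profile `SliceCollar.Ψ` of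
`SliceCollarProfile.lean` verbatim; flat formula `G(4 p, Einv 1 e^{-σ} • v)`, so `c(jB(0, v), 0) = G(0, v/2)`
since `Einv 1 1 = 1/2`; inverse, smoothness, range and the end clauses through the size function
`E_{s₀}(ℓ) + E_1(r)`), over the `Y`-side API of the landed T_k port (`FriendsTk.EndDatum`,
`SmoothPresentation`, tube coordinates `helper_friendsCarrier_Tk_tubeChart` for the flow `Φ`).  TRUE.
[cite: ManolescuPiccirillo2023, §3.2, proof of Lemma 3.3] [cite: Kosinski1993, Ch. VI §5] -/

theorem helper_friendsCarrier_Vk_partC : ∀ (k : ℕ) (K₁ : (sphere (0 : EuclideanSpace ℝ (Fin 2)) 1) → EuclideanSpace ℝ (Fin 4)) (Φ : ℝ × EuclideanSpace ℝ (Fin 4) → EuclideanSpace ℝ (Fin 4)) (ε s₁ s₀ : ℝ) (g : EuclideanSpace ℝ (Fin 2) → EuclideanSpace ℝ (Fin 4)) (G : EuclideanSpace ℝ (Fin 2) × EuclideanSpace ℝ (Fin 2) → EuclideanSpace ℝ (Fin 4)) (ν : (sphere (0 : EuclideanSpace ℝ (Fin 2)) 1) × EuclideanSpace ℝ (Fin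 2) → EuclideanSpace ℝ (Fin 4)), IsModelKnot k K₁ → ContDiff ℝ ∞ Φ → (∀ x, Φ (0, x) = x) → (∀ s t x, Φ (s, Φ (t, x)) = Φ (s + t, x)) → 0 < ε → ε ≤ 1 / 4 → (∀ x ∈ modelBoundary k, ∀ s : ℝ, |s| ≤ 2 * ε → (∀ j, (1 : ℝ) / 2 < holeTerm k j (Φ (s, x))) ∧ levelFun k (Φ (s, x)) = 1 + s) → (∀ y, (∀ j, 0 < holeTerm k j y) → |levelFun k y - 1| < 2 * ε → Φ (1 - levelFun k y, y) ∈ modelBoundary k) → 0 < s₀ → s₀ < s₁ → s₁ < 2 * ε → IsModelSliceDisc k K₁ g → (∀ (u : (sphere (0 : EuclideanSpace ℝ (Fin 2)) 1)) (t : ℝ), 1 - s₁ ≤ t → t ≤ 1 → g (t • (u : EuclideanSpace ℝ (Fin 2))) = Φ (1 - t, K₁ u)) → (ContDiffOn ℝ ∞ G (ball 0 1 ×ˢ ball 0 2) ∧ InjOn G (ball 0 1 ×ˢ ball 0 2) ∧ (∀ q ∈ ball 0 1 ×ˢ ball 0 2, Injective (fderiv ℝ G q)) ∧ (∀ q ∈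 ball 0 1 ×ˢ ball 0 2, G q ∉ modelHandlebody k) ∧ (∀ x ∈ ball 0 1, G (x, 0) = g x)) → (∀ (u : (sphere (0 : EuclideanSpace ℝ (Fin 2)) 1)) (t : ℝ) (w : EuclideanSpace ℝ (Fin 2)), 1 - s₁ < t → t < 1 → ‖w‖ < 2 → G (t • (u : EuclideanSpace ℝ (Fin 2)), w) = Φ (1 - t, ν (u, w))) → (∀ (x w : EuclideanSpace ℝ (Fin 2)), ‖x‖ ≤ 1 - s₀ → ‖w‖ < 2 → ∀ a ∈ modelBoundary k, ∀ s : ℝ, 0 < s → s < s₀ → G (x, w) ≠ Φ (s, a)) → ∀ (Y : Type) [TopologicalSpace Y] [T2Space Y] [SecondCountableTopology Y] [ChartedSpace (EuclideanSpace ℝ (Fin 3)) Y] [IsManifold (𝓡 3) ∞ Y] (jB : solidTorus → Y) (jM : EuclideanSpace ℝ (Fin 4) → Y) (W : Set (EuclideanSpace ℝ (Fin 4))) (ψ : Y → EuclideanSpace ℝ (Fin 4)), (Manifold.IsSmoothEmbedding (𝓘(ℝ, EuclideanSpace ℝ (Fin 2)).prod (𝓡 1)) (𝓡 3) ∞ jB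 ∧ IsOpen (range jB) ∧ ContMDiff ((𝓡 1).prod 𝓘(ℝ, EuclideanSpace ℝ (Fin 2))) 𝓘(ℝ, EuclideanSpace ℝ (Fin 4)) ∞ ν ∧ Injective ν ∧ (∀ p, Injective (mfderiv ((𝓡 1).prod 𝓘(ℝ, EuclideanSpace ℝ (Fin 2))) 𝓘(ℝ, EuclideanSpace ℝ (Fin 4)) ν p)) ∧ (∀ p, ν p ∈ modelBoundary k) ∧ (∀ u : (sphere (0 : EuclideanSpace ℝ (Fin 2)) 1), ν (u, 0) = K₁ u) ∧ IsOpen W ∧ (∀ x ∈ modelBoundary k, x ∉ range K₁ → x ∈ W) ∧ ContMDiffOn 𝓘(ℝ, EuclideanSpace ℝ (Fin 4)) (𝓡 3) ∞ jM W ∧ IsOpen (jM '' {x : EuclideanSpace ℝ (Fin 4) | x ∈ modelBoundary k ∧ x ∉ range K₁}) ∧ ContMDiffOn (𝓡 3) 𝓘(ℝ, EuclideanSpace ℝ (Fin 4)) ∞ ψ (jM '' {x : EuclideanSpace ℝ (Fin 4) | x ∈ modelBoundary k ∧ x ∉ range K₁}) ∧ (∀ x ∈ modelBoundary k, x ∉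 range K₁ → ψ (jM x) = x) ∧ jM '' {x : EuclideanSpace ℝ (Fin 4) | x ∈ modelBoundary k ∧ x ∉ range K₁} ∪ range jB = univ ∧ (∀ x ∈ modelBoundary k, x ∉ range K₁ → ∀ b : solidTorus, jM x = jB b ↔ ∃ (u : (sphere (0 : EuclideanSpace ℝ (Fin 2)) 1)) (t : ℝ), t ∈ Ioo (0 : ℝ) 1 ∧ b.1.1 = t • (u : EuclideanSpace ℝ (Fin 2)) ∧ x = ν (u, t • (b.1.2 : EuclideanSpace ℝ (Fin 2))))) → ∀ E : Opens (EuclideanSpace ℝ (Fin 4)), (E : Set (EuclideanSpace ℝ (Fin 4))) = {x | x ∉ modelHandlebody k ∧ x ∉ g '' closedBall 0 1} → ∃ c : OpenPartialHomeomorph (Y × ℝ) E, c.source = univ ∧ ContMDiffOn ((𝓡 3).prod 𝓘(ℝ, ℝ)) (𝓡 4) ∞ c c.source ∧ ContMDiffOn (𝓡 4) ((𝓡 3).prod 𝓘(ℝ, ℝ)) ∞ c.symm c.target ∧ (∀ a : ℝ, IsClosed (c '' {q | q.2 ≤ a})) ∧ (∀ a : ℝ, IsClosed (((↑) : E → EuclideanSpace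 ℝ (Fin 4)) '' (c.targetᶜ ∪ c '' {q | a ≤ q.2}))) ∧ (∃ R : ℝ, ∀ q : Y × ℝ, ‖((c q : E) : EuclideanSpace ℝ (Fin 4))‖ ≤ R) ∧ ∀ (v : (sphere (0 : EuclideanSpace ℝ (Fin 2)) 1)) (b : solidTorus), b.1 = (0, v) → ((c (jB b, 0) : E) : EuclideanSpace ℝ (Fin 4)) = G (0, (1 / 2 : ℝ) • (v : EuclideanSpace ℝ (Fin 2))) := by
  sorry

/-- **Part 1 of the data stub (explicit handle charts of `D_k`)**: with `c = (-20k i, 0)`, `a = 2/15`,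
there are an open `W ⊇ T` and `k` charts `h j` with the static properties of the stub, equivariant under the
rotations of the `(p₂, p₃)`-plane, carrying explicit smooth invariant lifts of the angles about the holes with
the prescribed end values (winding `δ_{jl}`), and covering the explicit arches `A_j ⊆ h j (T)`. [folklore] -/
theorem helper_handlebodyChart_modelHandles_data_part1 : ∀ (k : ℕ), ∃ (c : EuclideanSpace ℝ (Fin 4)) (a : ℝ) (W : Set (EuclideanSpace ℝ (Fin 4))) (h : Fin k → EuclideanSpace ℝ (Fin 4) → EuclideanSpace ℝ (Fin 4)), c = Literature.AlgebraicTopology.Homotopy.HopfFibration.ofZW (Complex.mk 0 (-(20 * (k : ℝ)))) 0 ∧ a = 2 / 15 ∧ (0 < a ∧ Metric.closedBall c (3 * a / 2) ⊆ Literature.Topology.FourManifolds.MMSW.modelHandlebody k ∧ IsOpen W ∧ {p : EuclideanSpace ℝ (Fin 4) | |p 0| ≤ 1 ∧ (p 1) ^ 2 + (p 2) ^ 2 + (p 3) ^ 2 ≤ 1} ⊆ W ∧ (∀ j, ContDiffOn ℝ ((⊤ : ℕ∞) : WithTop ℕ∞) (h j) W ∧ Set.InjOn (h j) W ∧ (∀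 p ∈ W, Function.Injective (fderiv ℝ (h j) p)) ∧ Set.MapsTo (h j) W (Literature.Topology.FourManifolds.MMSW.modelHandlebody k)) ∧ (∀ j l, j ≠ l → ∀ p ∈ W, ∀ q ∈ W, h j p ≠ h l q) ∧ (∀ j, ∀ p ∈ W, 1 / 2 ≤ |p 0| → dist (h j p) c = a * (2 - |p 0|)) ∧ (∀ j, ∀ p ∈ W, |p 0| ≤ 1 / 2 → 3 * a / 2 ≤ dist (h j p) c)) ∧ (∀ j (β : ℝ), ∀ p ∈ W, h j (!₂[p 0, p 1, Real.cos β * p 2 - Real.sin β * p 3, Real.sin β * p 2 + Real.cos β * p 3]) = Literature.Topology.FourManifolds.MMSW.fibreRot (fun _ => Complex.exp ((β : ℂ) * Complex.I)) (h j p)) ∧ (∀ j l, ∃ Λ : EuclideanSpace ℝ (Fin 4) → ℝ, ContDiffOn ℝ ((⊤ : ℕ∞) : WithTop ℕ∞) Λ W ∧ (∀ p ∈ W, Complex.exp ((Λ p : ℂ) * Complex.I) = (Literature.AlgebraicTopology.Homotopy.HopfFibration.zC (h j p) - Literature.Topology.FourManifolds.MMSW.holeCentre k l) / (((‖Literature.AlgebraicTopology.Homotopy.HopfFibration.zC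 (h j p) - Literature.Topology.FourManifolds.MMSW.holeCentre k l‖ : ℝ)) : ℂ)) ∧ (∀ (β : ℝ), ∀ p ∈ W, !₂[p 0, p 1, Real.cos β * p 2 - Real.sin β * p 3, Real.sin β * p 2 + Real.cos β * p 3] ∈ W → Λ (!₂[p 0, p 1, Real.cos β * p 2 - Real.sin β * p 3, Real.sin β * p 2 + Real.cos β * p 3]) = Λ p) ∧ (∀ p ∈ W, 1 / 2 ≤ |p 0| → Λ p = Complex.arg ((Literature.AlgebraicTopology.Homotopy.HopfFibration.zC (h j p) - Literature.Topology.FourManifolds.MMSW.holeCentre k l) * (starRingEnd ℂ) (Literature.AlgebraicTopology.Homotopy.HopfFibration.zC c - Literature.Topology.FourManifolds.MMSW.holeCentre k l)) + Complex.arg (Literature.AlgebraicTopology.Homotopy.HopfFibration.zC c - Literature.Topology.FourManifolds.MMSW.holeCentre k l) + (if j = l ∧ 0 < p 0 then 2 * Real.pi else 0))) ∧ (∀ j (y : EuclideanSpace ℝ (Fin 4)) (q v : ℂ), q = Literature.AlgebraicTopology.Homotopy.HopfFibration.zC y - Complex.mk 0 (-(20 * (k : ℝ))) → v = Literature.Topology.FourManifolds.MMSW.holeCentre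 k j - Complex.mk 0 (-(20 * (k : ℝ))) → ‖Literature.AlgebraicTopology.Homotopy.HopfFibration.wC y‖ ≤ 1 / (2000 * ((k : ℝ) + 1)) ∧ ((8 / 5 ≤ ‖q - v‖ ∧ ‖q - v‖ ≤ 41 / 25 ∧ -(7 / 10) * ‖v‖ ≤ ((q - v) * (starRingEnd ℂ) v).re) ∨ (2 / 15 ≤ ‖q‖ ∧ ‖q‖ ≤ ‖v‖ + 1 / 2 ∧ 0 < (q * (starRingEnd ℂ) v).re ∧ 8 / 5 * ‖q‖ ≤ |(q * (starRingEnd ℂ) v).im| ∧ |(q * (starRingEnd ℂ) v).im| ≤ 41 / 25 * ‖q‖)) → ∃ p ∈ {p : EuclideanSpace ℝ (Fin 4) | |p 0| ≤ 1 ∧ (p 1) ^ 2 + (p 2) ^ 2 + (p 3) ^ 2 ≤ 1}, h j p = y) := by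
  sorry

/-- **Part 2 of the data stub (the equivariant squeeze of `D_k` into ball and arches)**: for every open
`U ⊇ D_k` and `2/15 < ρ < 1/5` a diffeomorphism of `ℝ⁴`, the identity off a compact subset of `U`, commuting
with the rotations of the `w`-plane, carrying `D_k` into `B̄((-20k i, 0), ρ) ∪ ⋃ⱼ A_j`, with smooth invariant
lifts near `D_k` of the angles swept about the hole centres. [folklore] -/
theorem helper_handlebodyChart_modelHandles_data_part2 : ∀ (k : ℕ) (U : Set (EuclideanSpace ℝ (Fin 4))) (ρ : ℝ), IsOpen U → Literature.Topology.FourManifolds.MMSW.modelHandlebody k ⊆ U → 2 / 15 < ρ → ρ < 1 / 5 → ∃ (κ : EuclideanSpace ℝ (Fin 4) ≃ₘ⟮𝓡 4, 𝓡 4⟯ EuclideanSpace ℝ (Fin 4)) (K N₀ : Set (EuclideanSpace ℝ (Fin 4))) (SW : Fin k → EuclideanSpace ℝ (Fin 4) → ℝ), IsCompact K ∧ K ⊆ U ∧ (∀ x, x ∉ K → κ x = x) ∧ (∀ v : ℂ, ‖v‖ = 1 → ∀ x, κ (Literature.Topology.FourManifolds.MMSW.fibreRot (fun _ => v) x) =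 Literature.Topology.FourManifolds.MMSW.fibreRot (fun _ => v) (κ x)) ∧ (∀ x ∈ Literature.Topology.FourManifolds.MMSW.modelHandlebody k, κ x ∈ Metric.closedBall (Literature.AlgebraicTopology.Homotopy.HopfFibration.ofZW (Complex.mk 0 (-(20 * (k : ℝ)))) 0) ρ ∨ ∃ j, ∀ (q v : ℂ), q = Literature.AlgebraicTopology.Homotopy.HopfFibration.zC (κ x) - Complex.mk 0 (-(20 * (k : ℝ))) → v = Literature.Topology.FourManifolds.MMSW.holeCentre k j - Complex.mk 0 (-(20 * (k : ℝ))) → ‖Literature.AlgebraicTopology.Homotopy.HopfFibration.wC (κ x)‖ ≤ 1 / (2000 * ((k : ℝ) + 1)) ∧ ((8 / 5 ≤ ‖q - v‖ ∧ ‖q - v‖ ≤ 41 / 25 ∧ -(7 / 10) * ‖v‖ ≤ ((q - v) * (starRingEnd ℂ) v).re) ∨ (2 / 15 ≤ ‖q‖ ∧ ‖q‖ ≤ ‖v‖ + 1 / 2 ∧ 0 < (q * (starRingEnd ℂ) v).re ∧ 8 / 5 * ‖q‖ ≤ |(q * (starRingEnd ℂ) v).im| ∧ |(q * (starRingEnd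 ℂ) v).im| ≤ 41 / 25 * ‖q‖))) ∧ IsOpen N₀ ∧ Literature.Topology.FourManifolds.MMSW.modelHandlebody k ⊆ N₀ ∧ (∀ l, ContDiffOn ℝ ((⊤ : ℕ∞) : WithTop ℕ∞) (SW l) N₀) ∧ (∀ l (v : ℂ), ‖v‖ = 1 → ∀ x, SW l (Literature.Topology.FourManifolds.MMSW.fibreRot (fun _ => v) x) = SW l x) ∧ ∀ l, ∀ x ∈ Literature.Topology.FourManifolds.MMSW.modelHandlebody k, (Literature.AlgebraicTopology.Homotopy.HopfFibration.zC (κ x) - Literature.Topology.FourManifolds.MMSW.holeCentre k l) / ((‖Literature.AlgebraicTopology.Homotopy.HopfFibration.zC (κ x) - Literature.Topology.FourManifolds.MMSW.holeCentre k l‖ : ℝ) : ℂ) = Complex.exp ((SW l x : ℂ) * Complex.I) * ((Literature.AlgebraicTopology.Homotopy.HopfFibration.zC x - Literature.Topology.FourManifolds.MMSW.holeCentre k l) / ((‖Literature.AlgebraicTopology.Homotopy.HopfFibration.zC x - Literature.Topology.FourManifolds.MMSW.holeCentre k l‖ : ℝ) : ℂ)) := by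
  sorry

/-! ## Landed part and the two sorry-free assemblies (from the wave-1 split files) -/

/-- **Part 3 of the data stub (phase data from lifts, abstract)**: for any base data and charts with the
static properties, equivariance, and smooth invariant lifts `Λ_l^j` of `arg(z ∘ h_j - c_l)` with the
prescribed end values, the phase clause of the stub holds with `ε = m` — LANDED as
`helper_handlebodyChart_modelHandles_phaseOfLifts` (p162660). [folklore] -/
theorem helper_handlebodyChart_modelHandles_data_part3 : ∀ (k : ℕ) (c : EuclideanSpace ℝ (Fin 4)) (a : ℝ) (W : Set (EuclideanSpace ℝ (Fin 4))) (h : Fin k → EuclideanSpace ℝ (Fin 4) → EuclideanSpace ℝ (Fin 4)), (0 < a ∧ Metric.closedBall c (3 * a / 2) ⊆ Literature.Topology.FourManifolds.MMSW.modelHandlebody k ∧ IsOpen W ∧ {p : EuclideanSpace ℝ (Fin 4) | |p 0| ≤ 1 ∧ (p 1) ^ 2 + (p 2) ^ 2 + (p 3) ^ 2 ≤ 1} ⊆ W ∧ (∀ j, ContDiffOn ℝ ((⊤ : ℕ∞) : WithTop ℕ∞) (h j) W ∧ Set.InjOn (h j) W ∧ (∀ p ∈ W, Function.Injective (fderiv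 ℝ (h j) p)) ∧ Set.MapsTo (h j) W (Literature.Topology.FourManifolds.MMSW.modelHandlebody k)) ∧ (∀ j l, j ≠ l → ∀ p ∈ W, ∀ q ∈ W, h j p ≠ h l q) ∧ (∀ j, ∀ p ∈ W, 1 / 2 ≤ |p 0| → dist (h j p) c = a * (2 - |p 0|)) ∧ (∀ j, ∀ p ∈ W, |p 0| ≤ 1 / 2 → 3 * a / 2 ≤ dist (h j p) c)) → (∀ j (β : ℝ), ∀ p ∈ W, h j (!₂[p 0, p 1, Real.cos β * p 2 - Real.sin β * p 3, Real.sin β * p 2 + Real.cos β * p 3]) = Literature.Topology.FourManifolds.MMSW.fibreRot (fun _ => Complex.exp ((β : ℂ) * Complex.I)) (h j p)) → (∀ j l, ∃ Λ : EuclideanSpace ℝ (Fin 4) → ℝ, ContDiffOn ℝ ((⊤ : ℕ∞) : WithTop ℕ∞) Λ W ∧ (∀ p ∈ W, Complex.exp ((Λ p : ℂ) * Complex.I) = (Literature.AlgebraicTopology.Homotopy.HopfFibration.zC (h j p) - Literature.Topology.FourManifolds.MMSW.holeCentre k l) / (((‖Literature.AlgebraicTopology.Homotopy.HopfFibration.zC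 (h j p) - Literature.Topology.FourManifolds.MMSW.holeCentre k l‖ : ℝ)) : ℂ)) ∧ (∀ (β : ℝ), ∀ p ∈ W, !₂[p 0, p 1, Real.cos β * p 2 - Real.sin β * p 3, Real.sin β * p 2 + Real.cos β * p 3] ∈ W → Λ (!₂[p 0, p 1, Real.cos β * p 2 - Real.sin β * p 3, Real.sin β * p 2 + Real.cos β * p 3]) = Λ p) ∧ (∀ p ∈ W, 1 / 2 ≤ |p 0| → Λ p = Complex.arg ((Literature.AlgebraicTopology.Homotopy.HopfFibration.zC (h j p) - Literature.Topology.FourManifolds.MMSW.holeCentre k l) * (starRingEnd ℂ) (Literature.AlgebraicTopology.Homotopy.HopfFibration.zC c - Literature.Topology.FourManifolds.MMSW.holeCentre k l)) + Complex.arg (Literature.AlgebraicTopology.Homotopy.HopfFibration.zC c - Literature.Topology.FourManifolds.MMSW.holeCentre k l) + (if j = l ∧ 0 < p 0 then 2 * Real.pi else 0))) → (∀ (m : Fin k → ℤ) (ρ : ℝ), ρ < 3 * a / 2 → ∃ (ε : Fin k → ℤ) (N' : Set (EuclideanSpace ℝ (Fin 4))) (Θ : EuclideanSpace ℝ (Fin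 4) → ℝ), IsOpen N' ∧ Metric.closedBall c ρ ⊆ N' ∧ (∀ j, h j '' {p : EuclideanSpace ℝ (Fin 4) | |p 0| ≤ 1 ∧ (p 1) ^ 2 + (p 2) ^ 2 + (p 3) ^ 2 ≤ 1} ⊆ N') ∧ ContDiffOn ℝ ((⊤ : ℕ∞) : WithTop ℕ∞) Θ N' ∧ (∀ v : ℂ, ‖v‖ = 1 → ∀ y ∈ N', Θ (Literature.Topology.FourManifolds.MMSW.fibreRot (fun _ => v) y) = Θ y) ∧ (∀ y ∈ N', dist y c ≤ ρ → Complex.exp ((Θ y : ℂ) * Complex.I) * ∏ l : Fin k, ((Literature.AlgebraicTopology.Homotopy.HopfFibration.zC y - Literature.Topology.FourManifolds.MMSW.holeCentre k l) / (((‖Literature.AlgebraicTopology.Homotopy.HopfFibration.zC y - Literature.Topology.FourManifolds.MMSW.holeCentre k l‖ : ℝ)) : ℂ)) ^ (ε l) = 1) ∧ (∀ j, ∀ p ∈ W, h j p ∈ N' → Complex.exp ((Θ (h j p) : ℂ) * Complex.I) * ∏ l : Fin k, ((Literature.AlgebraicTopology.Homotopy.HopfFibration.zC (h j p) - Literature.Topology.FourManifolds.MMSW.holeCentre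 k l) / (((‖Literature.AlgebraicTopology.Homotopy.HopfFibration.zC (h j p) - Literature.Topology.FourManifolds.MMSW.holeCentre k l‖ : ℝ)) : ℂ)) ^ (ε l) = Complex.exp (((2 * Real.pi * (m j : ℝ) * Real.smoothTransition (p 0 + 1 / 2) : ℝ) : ℂ) * Complex.I))) :=
  Summit.SmoothPoincare4.SmoothPoincare4.Theorems.DcrGap.MkFriends.helper_handlebodyChart_modelHandles_phaseOfLifts

/-- **The registered stub `helper_friendsCarrier_Vk` from the three parts** (sorry-free given A, B, C): A gives
the transversal framing extending `νK`; B the flow-conical normal form `(Φ, ε, s₁, s₀, c, g, G)` matching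
`νK(u, c • w)`; the landed `helper_friendsCarrier_Vk_rescale` re-presents `Y` through that rescaled tube with
the same dual knot `μ₁`; C gives the collar of the uninverted exterior (the same `Opens E`, since
`g(𝔻²) = f₁(𝔻²)`) with core loop `G(0, v/2)`; the landed `helper_friendsCarrier_Vk_transport` inverts it into
`F` with all clauses, the homotopy clause coming from Kervaire's lemma for the tube `G` of `g` (same exterior).
[cite: ManolescuPiccirillo2023, §3.2, proof of Lemma 3.3] -/

theorem helper_friendsCarrier_Vk_of_parts (hA : ∀ (k : ℕ) (K₁ : (sphere (0 : EuclideanSpace ℝ (Fin 2)) 1) → EuclideanSpace ℝ (Fin 4)) (f₁ : EuclideanSpace ℝ (Fin 2) → EuclideanSpace ℝ (Fin 4)) (νK : (sphere (0 : EuclideanSpace ℝ (Fin 2)) 1) × EuclideanSpace ℝ (Fin 2) → EuclideanSpace ℝ (Fin 4)), IsModelKnot k K₁ → IsModelSliceDisc k K₁ f₁ → (∀ t : (sphere (0 : EuclideanSpace ℝ (Fin 2)) 1), deriv (fun ρ : ℝ => levelFun k (f₁ (ρ • (t : EuclideanSpace ℝ (Fin 2))))) 1 < 0) → ContMDiff ((𝓡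 1).prod 𝓘(ℝ, EuclideanSpace ℝ (Fin 2))) 𝓘(ℝ, EuclideanSpace ℝ (Fin 4)) ∞ νK → Injective νK → (∀ p, Injective (mfderiv ((𝓡 1).prod 𝓘(ℝ, EuclideanSpace ℝ (Fin 2))) 𝓘(ℝ, EuclideanSpace ℝ (Fin 4)) νK p)) → (∀ p, νK p ∈ modelBoundary k) → (∀ u : (sphere (0 : EuclideanSpace ℝ (Fin 2)) 1), νK (u, 0) = K₁ u) → IsNullHomologous k K₁ → (∀ t, wC (K₁ t) ≠ 0) → ∀ (J : Knot) (ν' : Knot.TubularNbhd J) (r : ℝ), (∀ p, wC (νK p) ≠ 0) → ν'.HasFraming 0 → 0 < r → (∀ (u : (sphere (0 : EuclideanSpace ℝ (Fin 2)) 1)) (w : EuclideanSpace ℝ (Fin 2)), ‖w‖ < 1 → toSphereThree (draw k (νK (u, w))).1 (draw k (νK (u, w))).2 = ν' (u, r • w)) → ∃ n₀ n₁ : EuclideanSpace ℝ (Fin 2) → EuclideanSpace ℝ (Fin 4), ContDiff ℝ ∞ n₀ ∧ ContDiff ℝ ∞ n₁ ∧ (∀ x ∈ closedBall (0 : EuclideanSpace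 ℝ (Fin 2)) 1, ∀ (v : EuclideanSpace ℝ (Fin 2)) (a b : ℝ), fderiv ℝ f₁ x v + a • n₀ x + b • n₁ x = 0 → v = 0 ∧ a = 0 ∧ b = 0) ∧ (∀ u : (sphere (0 : EuclideanSpace ℝ (Fin 2)) 1), n₀ u = fderiv ℝ (fun w : EuclideanSpace ℝ (Fin 2) => νK (u, w)) 0 (EuclideanSpace.single 0 1) ∧ n₁ u = fderiv ℝ (fun w : EuclideanSpace ℝ (Fin 2) => νK (u, w)) 0 (EuclideanSpace.single 1 1))) (hB : ∀ (k : ℕ) (K₁ : (sphere (0 : EuclideanSpace ℝ (Fin 2)) 1) → EuclideanSpace ℝ (Fin 4)) (f₁ : EuclideanSpace ℝ (Fin 2) → EuclideanSpace ℝ (Fin 4)) (νK : (sphere (0 : EuclideanSpace ℝ (Fin 2)) 1) × EuclideanSpace ℝ (Fin 2) → EuclideanSpace ℝ (Fin 4)), IsModelKnot k K₁ → IsModelSliceDisc k K₁ f₁ → (∀ t : (sphere (0 : EuclideanSpace ℝ (Fin 2)) 1), deriv (fun ρ : ℝ => levelFun k (f₁ (ρ • (t : EuclideanSpace ℝ (Fin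 2))))) 1 < 0) → ContMDiff ((𝓡 1).prod 𝓘(ℝ, EuclideanSpace ℝ (Fin 2))) 𝓘(ℝ, EuclideanSpace ℝ (Fin 4)) ∞ νK → Injective νK → (∀ p, Injective (mfderiv ((𝓡 1).prod 𝓘(ℝ, EuclideanSpace ℝ (Fin 2))) 𝓘(ℝ, EuclideanSpace ℝ (Fin 4)) νK p)) → (∀ p, νK p ∈ modelBoundary k) → (∀ u : (sphere (0 : EuclideanSpace ℝ (Fin 2)) 1), νK (u, 0) = K₁ u) → ∀ (n₀ n₁ : EuclideanSpace ℝ (Fin 2) → EuclideanSpace ℝ (Fin 4)), ContDiff ℝ ∞ n₀ ∧ ContDiff ℝ ∞ n₁ ∧ (∀ x ∈ closedBall (0 : EuclideanSpace ℝ (Fin 2)) 1, ∀ (v : EuclideanSpace ℝ (Fin 2)) (a b : ℝ), fderiv ℝ f₁ x v + a • n₀ x + b • n₁ x = 0 → v = 0 ∧ a = 0 ∧ b = 0) ∧ (∀ u : (sphere (0 : EuclideanSpace ℝ (Fin 2)) 1), n₀ u = fderiv ℝ (fun w : EuclideanSpace ℝ (Fin 2) => νK (u, w)) 0 (EuclideanSpace.single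 0 1) ∧ n₁ u = fderiv ℝ (fun w : EuclideanSpace ℝ (Fin 2) => νK (u, w)) 0 (EuclideanSpace.single 1 1)) → ∃ (Φ : ℝ × EuclideanSpace ℝ (Fin 4) → EuclideanSpace ℝ (Fin 4)) (ε s₁ s₀ c : ℝ) (g : EuclideanSpace ℝ (Fin 2) → EuclideanSpace ℝ (Fin 4)) (G : EuclideanSpace ℝ (Fin 2) × EuclideanSpace ℝ (Fin 2) → EuclideanSpace ℝ (Fin 4)), ContDiff ℝ ∞ Φ ∧ (∀ x, Φ (0, x) = x) ∧ (∀ s t x, Φ (s, Φ (t, x)) = Φ (s + t, x)) ∧ 0 < ε ∧ ε ≤ 1 / 4 ∧ (∀ x ∈ modelBoundary k, ∀ s : ℝ, |s| ≤ 2 * ε → (∀ j, (1 : ℝ) / 2 < holeTerm k j (Φ (s, x))) ∧ levelFun k (Φ (s, x)) = 1 + s) ∧ (∀ y, (∀ j, 0 < holeTerm k j y) → |levelFun k y - 1| < 2 * ε → Φ (1 - levelFun k y, y) ∈ modelBoundary k) ∧ 0 < s₀ ∧ s₀ < s₁ ∧ s₁ < 2 * ε ∧ 0 < c ∧ c ≤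 1 ∧ IsModelSliceDisc k K₁ g ∧ g '' closedBall 0 1 = f₁ '' closedBall 0 1 ∧ (∀ (u : (sphere (0 : EuclideanSpace ℝ (Fin 2)) 1)) (t : ℝ), 1 - s₁ ≤ t → t ≤ 1 → g (t • (u : EuclideanSpace ℝ (Fin 2))) = Φ (1 - t, K₁ u)) ∧ ContDiffOn ℝ ∞ G (ball 0 1 ×ˢ ball 0 2) ∧ InjOn G (ball 0 1 ×ˢ ball 0 2) ∧ (∀ q ∈ ball 0 1 ×ˢ ball 0 2, Injective (fderiv ℝ G q)) ∧ (∀ q ∈ ball 0 1 ×ˢ ball 0 2, G q ∉ modelHandlebody k) ∧ (∀ x ∈ ball 0 1, G (x, 0) = g x) ∧ (∀ (u : (sphere (0 : EuclideanSpace ℝ (Fin 2)) 1)) (t : ℝ) (w : EuclideanSpace ℝ (Fin 2)), 1 - s₁ < t → t < 1 → ‖w‖ < 2 → G (t • (u : EuclideanSpace ℝ (Fin 2)), w) = Φ (1 - t, νK (u, c • w))) ∧ (∀ (x w : EuclideanSpace ℝ (Fin 2)), ‖x‖ ≤ 1 - s₀ → ‖w‖ < 2 → ∀ a ∈ modelBoundary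 k, ∀ s : ℝ, 0 < s → s < s₀ → G (x, w) ≠ Φ (s, a))) (hC : ∀ (k : ℕ) (K₁ : (sphere (0 : EuclideanSpace ℝ (Fin 2)) 1) → EuclideanSpace ℝ (Fin 4)) (Φ : ℝ × EuclideanSpace ℝ (Fin 4) → EuclideanSpace ℝ (Fin 4)) (ε s₁ s₀ : ℝ) (g : EuclideanSpace ℝ (Fin 2) → EuclideanSpace ℝ (Fin 4)) (G : EuclideanSpace ℝ (Fin 2) × EuclideanSpace ℝ (Fin 2) → EuclideanSpace ℝ (Fin 4)) (ν : (sphere (0 : EuclideanSpace ℝ (Fin 2)) 1) × EuclideanSpace ℝ (Fin 2) → EuclideanSpace ℝ (Fin 4)), IsModelKnot k K₁ → ContDiff ℝ ∞ Φ → (∀ x, Φ (0, x) = x) → (∀ s t x, Φ (s, Φ (t, x)) = Φ (s + t, x)) → 0 < ε → ε ≤ 1 / 4 → (∀ x ∈ modelBoundary k, ∀ s : ℝ, |s| ≤ 2 * ε → (∀ j, (1 : ℝ) / 2 < holeTerm k j (Φ (s, x))) ∧ levelFun k (Φ (s, x)) = 1 + s) → (∀ y, (∀ j, 0 < holeTerm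 k j y) → |levelFun k y - 1| < 2 * ε → Φ (1 - levelFun k y, y) ∈ modelBoundary k) → 0 < s₀ → s₀ < s₁ → s₁ < 2 * ε → IsModelSliceDisc k K₁ g → (∀ (u : (sphere (0 : EuclideanSpace ℝ (Fin 2)) 1)) (t : ℝ), 1 - s₁ ≤ t → t ≤ 1 → g (t • (u : EuclideanSpace ℝ (Fin 2))) = Φ (1 - t, K₁ u)) → (ContDiffOn ℝ ∞ G (ball 0 1 ×ˢ ball 0 2) ∧ InjOn G (ball 0 1 ×ˢ ball 0 2) ∧ (∀ q ∈ ball 0 1 ×ˢ ball 0 2, Injective (fderiv ℝ G q)) ∧ (∀ q ∈ ball 0 1 ×ˢ ball 0 2, G q ∉ modelHandlebody k) ∧ (∀ x ∈ ball 0 1, G (x, 0) = g x)) → (∀ (u : (sphere (0 : EuclideanSpace ℝ (Fin 2)) 1)) (t : ℝ) (w : EuclideanSpace ℝ (Fin 2)), 1 - s₁ < t → t < 1 → ‖w‖ < 2 → G (t • (u : EuclideanSpace ℝ (Fin 2)), w) = Φ (1 - t, ν (u, w))) → (∀ (x w : EuclideanSpace ℝ (Fin 2)), ‖x‖ ≤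 1 - s₀ → ‖w‖ < 2 → ∀ a ∈ modelBoundary k, ∀ s : ℝ, 0 < s → s < s₀ → G (x, w) ≠ Φ (s, a)) → ∀ (Y : Type) [TopologicalSpace Y] [T2Space Y] [SecondCountableTopology Y] [ChartedSpace (EuclideanSpace ℝ (Fin 3)) Y] [IsManifold (𝓡 3) ∞ Y] (jB : solidTorus → Y) (jM : EuclideanSpace ℝ (Fin 4) → Y) (W : Set (EuclideanSpace ℝ (Fin 4))) (ψ : Y → EuclideanSpace ℝ (Fin 4)), (Manifold.IsSmoothEmbedding (𝓘(ℝ, EuclideanSpace ℝ (Fin 2)).prod (𝓡 1)) (𝓡 3) ∞ jB ∧ IsOpen (range jB) ∧ ContMDiff ((𝓡 1).prod 𝓘(ℝ, EuclideanSpace ℝ (Fin 2))) 𝓘(ℝ, EuclideanSpace ℝ (Fin 4)) ∞ ν ∧ Injective ν ∧ (∀ p, Injective (mfderiv ((𝓡 1).prod 𝓘(ℝ, EuclideanSpace ℝ (Fin 2))) 𝓘(ℝ, EuclideanSpace ℝ (Fin 4)) ν p)) ∧ (∀ p, ν p ∈ modelBoundary k) ∧ (∀ u : (sphere (0 : EuclideanSpace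 ℝ (Fin 2)) 1), ν (u, 0) = K₁ u) ∧ IsOpen W ∧ (∀ x ∈ modelBoundary k, x ∉ range K₁ → x ∈ W) ∧ ContMDiffOn 𝓘(ℝ, EuclideanSpace ℝ (Fin 4)) (𝓡 3) ∞ jM W ∧ IsOpen (jM '' {x : EuclideanSpace ℝ (Fin 4) | x ∈ modelBoundary k ∧ x ∉ range K₁}) ∧ ContMDiffOn (𝓡 3) 𝓘(ℝ, EuclideanSpace ℝ (Fin 4)) ∞ ψ (jM '' {x : EuclideanSpace ℝ (Fin 4) | x ∈ modelBoundary k ∧ x ∉ range K₁}) ∧ (∀ x ∈ modelBoundary k, x ∉ range K₁ → ψ (jM x) = x) ∧ jM '' {x : EuclideanSpace ℝ (Fin 4) | x ∈ modelBoundary k ∧ x ∉ range K₁} ∪ range jB = univ ∧ (∀ x ∈ modelBoundary k, x ∉ range K₁ → ∀ b : solidTorus, jM x = jB b ↔ ∃ (u : (sphere (0 : EuclideanSpace ℝ (Fin 2)) 1)) (t : ℝ), t ∈ Ioo (0 : ℝ) 1 ∧ b.1.1 = t • (u : EuclideanSpace ℝ (Fin 2)) ∧ x = ν (u, t • (b.1.2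 : EuclideanSpace ℝ (Fin 2))))) → ∀ E : Opens (EuclideanSpace ℝ (Fin 4)), (E : Set (EuclideanSpace ℝ (Fin 4))) = {x | x ∉ modelHandlebody k ∧ x ∉ g '' closedBall 0 1} → ∃ c : OpenPartialHomeomorph (Y × ℝ) E, c.source = univ ∧ ContMDiffOn ((𝓡 3).prod 𝓘(ℝ, ℝ)) (𝓡 4) ∞ c c.source ∧ ContMDiffOn (𝓡 4) ((𝓡 3).prod 𝓘(ℝ, ℝ)) ∞ c.symm c.target ∧ (∀ a : ℝ, IsClosed (c '' {q | q.2 ≤ a})) ∧ (∀ a : ℝ, IsClosed (((↑) : E → EuclideanSpace ℝ (Fin 4)) '' (c.targetᶜ ∪ c '' {q | a ≤ q.2}))) ∧ (∃ R : ℝ, ∀ q : Y × ℝ, ‖((c q : E) : EuclideanSpace ℝ (Fin 4))‖ ≤ R) ∧ ∀ (v : (sphere (0 : EuclideanSpace ℝ (Fin 2)) 1)) (b : solidTorus), b.1 = (0, v) → ((c (jB b, 0) : E) : EuclideanSpace ℝ (Fin 4)) = G (0, (1 / 2 : ℝ) • (v : EuclideanSpace ℝ (Fin 2)))) : ∀ (k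 : ℕ) (K₁ : (sphere (0 : EuclideanSpace ℝ (Fin 2)) 1) → EuclideanSpace ℝ (Fin 4)) (f₁ : EuclideanSpace ℝ (Fin 2) → EuclideanSpace ℝ (Fin 4)) (T : EuclideanSpace ℝ (Fin 2) × EuclideanSpace ℝ (Fin 2) → EuclideanSpace ℝ (Fin 4)), IsModelKnot k K₁ → IsNullHomologous k K₁ → (∀ t, wC (K₁ t) ≠ 0) → IsModelSliceDisc k K₁ f₁ → (∀ t : (sphere (0 : EuclideanSpace ℝ (Fin 2)) 1), deriv (fun ρ : ℝ => levelFun k (f₁ (ρ • (t : EuclideanSpace ℝ (Fin 2))))) 1 < 0) → (ContDiffOn ℝ ∞ T (ball 0 1 ×ˢ ball 0 2) ∧ InjOn T (ball 0 1 ×ˢ ball 0 2) ∧ (∀ q ∈ ball 0 1 ×ˢ ball 0 2, Injective (fderiv ℝ T q)) ∧ (∀ q ∈ ball 0 1 ×ˢ ball 0 2, T q ∉ modelHandlebody k) ∧ (∀ x ∈ ball 0 1, T (x, 0) = f₁ x)) → ∀ (Y : Type) [TopologicalSpace Y] [T2Space Y] [SecondCountableTopology Y] [ChartedSpace (EuclideanSpace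 ℝ (Fin 3)) Y] [IsManifold (𝓡 3) ∞ Y] (jB : solidTorus → Y) (μ₁ : C((sphere (0 : EuclideanSpace ℝ (Fin 2)) 1), Y)) (νK : (sphere (0 : EuclideanSpace ℝ (Fin 2)) 1) × EuclideanSpace ℝ (Fin 2) → EuclideanSpace ℝ (Fin 4)) (jM : EuclideanSpace ℝ (Fin 4) → Y) (W : Set (EuclideanSpace ℝ (Fin 4))) (ψ : Y → EuclideanSpace ℝ (Fin 4)), (Manifold.IsSmoothEmbedding (𝓘(ℝ, EuclideanSpace ℝ (Fin 2)).prod (𝓡 1)) (𝓡 3) ∞ jB ∧ IsOpen (range jB) ∧ ContMDiff ((𝓡 1).prod 𝓘(ℝ, EuclideanSpace ℝ (Fin 2))) 𝓘(ℝ, EuclideanSpace ℝ (Fin 4)) ∞ νK ∧ Injective νK ∧ (∀ p, Injective (mfderiv ((𝓡 1).prod 𝓘(ℝ, EuclideanSpace ℝ (Fin 2))) 𝓘(ℝ, EuclideanSpace ℝ (Fin 4)) νK p)) ∧ (∀ p, νK p ∈ modelBoundary k) ∧ (∀ u : (sphere (0 : EuclideanSpace ℝ (Fin 2)) 1), νK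 (u, 0) = K₁ u) ∧ IsOpen W ∧ (∀ x ∈ modelBoundary k, x ∉ range K₁ → x ∈ W) ∧ ContMDiffOn 𝓘(ℝ, EuclideanSpace ℝ (Fin 4)) (𝓡 3) ∞ jM W ∧ IsOpen (jM '' {x : EuclideanSpace ℝ (Fin 4) | x ∈ modelBoundary k ∧ x ∉ range K₁}) ∧ ContMDiffOn (𝓡 3) 𝓘(ℝ, EuclideanSpace ℝ (Fin 4)) ∞ ψ (jM '' {x : EuclideanSpace ℝ (Fin 4) | x ∈ modelBoundary k ∧ x ∉ range K₁}) ∧ (∀ x ∈ modelBoundary k, x ∉ range K₁ → ψ (jM x) = x) ∧ jM '' {x : EuclideanSpace ℝ (Fin 4) | x ∈ modelBoundary k ∧ x ∉ range K₁} ∪ range jB = univ ∧ (∀ x ∈ modelBoundary k, x ∉ range K₁ → ∀ b : solidTorus, jM x = jB b ↔ ∃ (u : (sphere (0 : EuclideanSpace ℝ (Fin 2)) 1)) (t : ℝ), t ∈ Ioo (0 : ℝ) 1 ∧ b.1.1 = t • (u : EuclideanSpace ℝ (Fin 2)) ∧ x = νK (u, t • (b.1.2 : EuclideanSpace ℝ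 (Fin 2))))) → (∀ (v : (sphere (0 : EuclideanSpace ℝ (Fin 2)) 1)) (b : solidTorus), b.1 = (0, v) → μ₁ v = jB b) → ∀ (J : Knot) (ν' : Knot.TubularNbhd J) (r : ℝ), (∀ p, wC (νK p) ≠ 0) ∧ ν'.HasFraming 0 ∧ 0 < r ∧ (∀ (u : (sphere (0 : EuclideanSpace ℝ (Fin 2)) 1)) (w : EuclideanSpace ℝ (Fin 2)), ‖w‖ < 1 → toSphereThree (draw k (νK (u, w))).1 (draw k (νK (u, w))).2 = ν' (u, r • w)) → ∀ (E F : Opens (EuclideanSpace ℝ (Fin 4))), (E : Set (EuclideanSpace ℝ (Fin 4))) = {x | x ∉ modelHandlebody k ∧ x ∉ f₁ '' closedBall 0 1} → (F : Set (EuclideanSpace ℝ (Fin 4))) = {0} ∪ {y : EuclideanSpace ℝ (Fin 4) | y ≠ 0 ∧ (‖y‖ ^ 2)⁻¹ • y ∉ modelHandlebody k ∧ (‖y‖ ^ 2)⁻¹ • y ∉ f₁ '' closedBall 0 1} → ∃ c : OpenPartialHomeomorph (Y × ℝ) F, c.source = univ ∧ ContMDiffOn ((𝓡 3).prod 𝓘(ℝ,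 ℝ)) (𝓡 4) ∞ c c.source ∧ ContMDiffOn (𝓡 4) ((𝓡 3).prod 𝓘(ℝ, ℝ)) ∞ c.symm c.target ∧ (∀ a : ℝ, IsClosed (c '' {q | q.2 ≤ a})) ∧ (∀ a : ℝ, IsCompact (c.targetᶜ ∪ c '' {q | a ≤ q.2})) ∧ ∀ (L₁ L₂ : C((sphere (0 : EuclideanSpace ℝ (Fin 2)) 1), F)), (∀ v, L₁ v = c (μ₁ v, 0)) → (∀ v : (sphere (0 : EuclideanSpace ℝ (Fin 2)) 1), ((L₂ v : F) : EuclideanSpace ℝ (Fin 4)) = (‖T ((0 : EuclideanSpace ℝ (Fin 2)), (1 / 2 : ℝ) • (v : EuclideanSpace ℝ (Fin 2)))‖ ^ 2)⁻¹ • T ((0 : EuclideanSpace ℝ (Fin 2)), (1 / 2 : ℝ) • (v : EuclideanSpace ℝ (Fin 2)))) → ∀ (Z : Type) [TopologicalSpace Z] (g : C(F, Z)), (∃ z : Z, (g.comp L₁).Homotopic (ContinuousMap.const (sphere (0 : EuclideanSpace ℝ (Fin 2)) 1) z)) → ∃ z : Z, (g.comp L₂).Homotopic (ContinuousMap.const (sphere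 (0 : EuclideanSpace ℝ (Fin 2)) 1) z) := by
  intro k K₁ f₁ T hK hN hw hf hneat hT Y _ _ _ _ _ jB μ₁ νK jM W ψ hP hμ J ν' r hfr E F hE hF
  obtain ⟨h1, h2, h3, h4, h5, h6, h7, h8, h9, h10, h11, h12, h13, h14, h15⟩ := hP
  obtain ⟨hwν, hν0, hr, hpic⟩ := hfr
  -- (A) the framing of `K₁` given by `νK` extends over the disc
  obtain ⟨n₀, n₁, hn₀, hn₁, htr, hbd⟩ := hA k K₁ f₁ νK hK hf hneat h3 h4 h5 h6 h7 hN hw J ν' r hwν hν0 hr hpic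
  -- (B) the flow-conical normal form with its framed tube, matching `νK` at fibre scale `c`
  obtain ⟨Φ, ε, s₁, s₀, c, g, G, hΦ, hΦ0, hΦadd, hε, hε4, hclock, hband, hs₀, hs₀₁, hs₁ε, hc, hc1, hg, hgf,
    hgcone, hG1, hG2, hG3, hG4, hG5, hGcone, hdeep⟩ :=
    hB k K₁ f₁ νK hK hf hneat h3 h4 h5 h6 h7 n₀ n₁ ⟨hn₀, hn₁, htr, hbd⟩
  -- re-present `Y` through the rescaled tube `ν_c (u, w) = νK (u, c • w)`
  obtain ⟨jB', hP', hμ'⟩ := Summit.SmoothPoincare4.SmoothPoincare4.Theorems.DcrGap.MkFriends.helper_friendsCarrier_Vk_rescale k K₁ Y jB μ₁ νK jM W ψ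
    ⟨h1, h2, h3, h4, h5, h6, h7, h8, h9, h10, h11, h12, h13, h14, h15⟩ hμ c hc hc1
  -- (C) the collar of the uninverted exterior `E`
  have hE' : (E : Set (EuclideanSpace ℝ (Fin 4))) = {x | x ∉ modelHandlebody k ∧ x ∉ g '' closedBall 0 1} := by
    rw [hE, hgf]
  obtain ⟨cE, hsrc, hcs, hcs', hcl, hcl', ⟨R, hR⟩, hcore⟩ :=
    hC k K₁ Φ ε s₁ s₀ g G (fun q : (sphere (0 : EuclideanSpace ℝ (Fin 2)) 1) × EuclideanSpace ℝ (Fin 2) => νK (q.1, c • q.2))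
      hK hΦ hΦ0 hΦadd hε hε4 hclock hband hs₀ hs₀₁ hs₁ε hg hgcone ⟨hG1, hG2, hG3, hG4, hG5⟩ hGcone hdeep Y jB' jM W ψ hP' E hE'
  -- the core loop of the collar is the tube meridian of `G`
  have hcore' : ∀ v : (sphere (0 : EuclideanSpace ℝ (Fin 2)) 1),
      ((cE (μ₁ v, 0) : E) : EuclideanSpace ℝ (Fin 4)) = G (0, (1 / 2 : ℝ) • (v : EuclideanSpace ℝ (Fin 2))) := fun v => by
    have hb : ((⟨((0 : EuclideanSpace ℝ (Fin 2)), v), by simp [mem_solidTorus_iff]⟩ : ↥solidTorus) :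
        EuclideanSpace ℝ (Fin 2) × (sphere (0 : EuclideanSpace ℝ (Fin 2)) 1)) = (0, v) := rfl
    rw [hμ' v _ hb]
    exact hcore v _ hb
  -- transport through the chart at infinity (with Kervaire's lemma for the meridian of `G`)
  exact Summit.SmoothPoincare4.SmoothPoincare4.Theorems.DcrGap.MkFriends.helper_friendsCarrier_Vk_transport k K₁ f₁ T hK hf hT g G hg hgf ⟨hG1, hG2, hG3, hG4, hG5⟩ Y μ₁ E F hE hF cE R
    hsrc hcs hcs' hcl hcl' hR hcore'

/-- **Assembly of the data stub from its three parts** (sorry-free). [folklore] -/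
theorem helper_handlebodyChart_modelHandles_data_of_parts : (∀ (k : ℕ), ∃ (c : EuclideanSpace ℝ (Fin 4)) (a : ℝ) (W : Set (EuclideanSpace ℝ (Fin 4))) (h : Fin k → EuclideanSpace ℝ (Fin 4) → EuclideanSpace ℝ (Fin 4)), c = Literature.AlgebraicTopology.Homotopy.HopfFibration.ofZW (Complex.mk 0 (-(20 * (k : ℝ)))) 0 ∧ a = 2 / 15 ∧ (0 < a ∧ Metric.closedBall c (3 * a / 2) ⊆ Literature.Topology.FourManifolds.MMSW.modelHandlebody k ∧ IsOpen W ∧ {p : EuclideanSpace ℝ (Fin 4) | |p 0| ≤ 1 ∧ (p 1) ^ 2 + (p 2) ^ 2 + (p 3) ^ 2 ≤ 1} ⊆ W ∧ (∀ j, ContDiffOn ℝ ((⊤ : ℕ∞) : WithTop ℕ∞) (h j) W ∧ Set.InjOn (h j) W ∧ (∀ p ∈ W, Function.Injective (fderiv ℝ (h j) p)) ∧ Set.MapsTo (h j) W (Literature.Topology.FourManifolds.MMSW.modelHandlebody k)) ∧ (∀ j l, j ≠ l → ∀ p ∈ W, ∀ q ∈ W, h j p ≠ h l q) ∧ (∀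 j, ∀ p ∈ W, 1 / 2 ≤ |p 0| → dist (h j p) c = a * (2 - |p 0|)) ∧ (∀ j, ∀ p ∈ W, |p 0| ≤ 1 / 2 → 3 * a / 2 ≤ dist (h j p) c)) ∧ (∀ j (β : ℝ), ∀ p ∈ W, h j (!₂[p 0, p 1, Real.cos β * p 2 - Real.sin β * p 3, Real.sin β * p 2 + Real.cos β * p 3]) = Literature.Topology.FourManifolds.MMSW.fibreRot (fun _ => Complex.exp ((β : ℂ) * Complex.I)) (h j p)) ∧ (∀ j l, ∃ Λ : EuclideanSpace ℝ (Fin 4) → ℝ, ContDiffOn ℝ ((⊤ : ℕ∞) : WithTop ℕ∞) Λ W ∧ (∀ p ∈ W, Complex.exp ((Λ p : ℂ) * Complex.I) = (Literature.AlgebraicTopology.Homotopy.HopfFibration.zC (h j p) - Literature.Topology.FourManifolds.MMSW.holeCentre k l) / (((‖Literature.AlgebraicTopology.Homotopy.HopfFibration.zC (h j p) - Literature.Topology.FourManifolds.MMSW.holeCentre k l‖ : ℝ)) : ℂ)) ∧ (∀ (β : ℝ), ∀ p ∈ W, !₂[p 0, p 1, Real.cos β * p 2 - Real.sin β * p 3,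 Real.sin β * p 2 + Real.cos β * p 3] ∈ W → Λ (!₂[p 0, p 1, Real.cos β * p 2 - Real.sin β * p 3, Real.sin β * p 2 + Real.cos β * p 3]) = Λ p) ∧ (∀ p ∈ W, 1 / 2 ≤ |p 0| → Λ p = Complex.arg ((Literature.AlgebraicTopology.Homotopy.HopfFibration.zC (h j p) - Literature.Topology.FourManifolds.MMSW.holeCentre k l) * (starRingEnd ℂ) (Literature.AlgebraicTopology.Homotopy.HopfFibration.zC c - Literature.Topology.FourManifolds.MMSW.holeCentre k l)) + Complex.arg (Literature.AlgebraicTopology.Homotopy.HopfFibration.zC c - Literature.Topology.FourManifolds.MMSW.holeCentre k l) + (if j = l ∧ 0 < p 0 then 2 * Real.pi else 0))) ∧ (∀ j (y : EuclideanSpace ℝ (Fin 4)) (q v : ℂ), q = Literature.AlgebraicTopology.Homotopy.HopfFibration.zC y - Complex.mk 0 (-(20 * (k : ℝ))) → v = Literature.Topology.FourManifolds.MMSW.holeCentre k j - Complex.mk 0 (-(20 * (k : ℝ))) → ‖Literature.AlgebraicTopology.Homotopy.HopfFibration.wC y‖ ≤ 1 / (2000 * ((k : ℝ) + 1)) ∧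 ((8 / 5 ≤ ‖q - v‖ ∧ ‖q - v‖ ≤ 41 / 25 ∧ -(7 / 10) * ‖v‖ ≤ ((q - v) * (starRingEnd ℂ) v).re) ∨ (2 / 15 ≤ ‖q‖ ∧ ‖q‖ ≤ ‖v‖ + 1 / 2 ∧ 0 < (q * (starRingEnd ℂ) v).re ∧ 8 / 5 * ‖q‖ ≤ |(q * (starRingEnd ℂ) v).im| ∧ |(q * (starRingEnd ℂ) v).im| ≤ 41 / 25 * ‖q‖)) → ∃ p ∈ {p : EuclideanSpace ℝ (Fin 4) | |p 0| ≤ 1 ∧ (p 1) ^ 2 + (p 2) ^ 2 + (p 3) ^ 2 ≤ 1}, h j p = y)) → (∀ (k : ℕ) (U : Set (EuclideanSpace ℝ (Fin 4))) (ρ : ℝ), IsOpen U → Literature.Topology.FourManifolds.MMSW.modelHandlebody k ⊆ U → 2 / 15 < ρ → ρ < 1 / 5 → ∃ (κ : EuclideanSpace ℝ (Fin 4) ≃ₘ⟮𝓡 4, 𝓡 4⟯ EuclideanSpace ℝ (Fin 4)) (K N₀ : Set (EuclideanSpace ℝ (Fin 4))) (SW : Fin k → EuclideanSpace ℝ (Fin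 4) → ℝ), IsCompact K ∧ K ⊆ U ∧ (∀ x, x ∉ K → κ x = x) ∧ (∀ v : ℂ, ‖v‖ = 1 → ∀ x, κ (Literature.Topology.FourManifolds.MMSW.fibreRot (fun _ => v) x) = Literature.Topology.FourManifolds.MMSW.fibreRot (fun _ => v) (κ x)) ∧ (∀ x ∈ Literature.Topology.FourManifolds.MMSW.modelHandlebody k, κ x ∈ Metric.closedBall (Literature.AlgebraicTopology.Homotopy.HopfFibration.ofZW (Complex.mk 0 (-(20 * (k : ℝ)))) 0) ρ ∨ ∃ j, ∀ (q v : ℂ), q = Literature.AlgebraicTopology.Homotopy.HopfFibration.zC (κ x) - Complex.mk 0 (-(20 * (k : ℝ))) → v = Literature.Topology.FourManifolds.MMSW.holeCentre k j - Complex.mk 0 (-(20 * (k : ℝ))) → ‖Literature.AlgebraicTopology.Homotopy.HopfFibration.wC (κ x)‖ ≤ 1 / (2000 * ((k : ℝ) + 1)) ∧ ((8 / 5 ≤ ‖q - v‖ ∧ ‖q - v‖ ≤ 41 / 25 ∧ -(7 / 10) * ‖v‖ ≤ ((q - v) * (starRingEnd ℂ) v).re) ∨ (2 / 15 ≤ ‖q‖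 ∧ ‖q‖ ≤ ‖v‖ + 1 / 2 ∧ 0 < (q * (starRingEnd ℂ) v).re ∧ 8 / 5 * ‖q‖ ≤ |(q * (starRingEnd ℂ) v).im| ∧ |(q * (starRingEnd ℂ) v).im| ≤ 41 / 25 * ‖q‖))) ∧ IsOpen N₀ ∧ Literature.Topology.FourManifolds.MMSW.modelHandlebody k ⊆ N₀ ∧ (∀ l, ContDiffOn ℝ ((⊤ : ℕ∞) : WithTop ℕ∞) (SW l) N₀) ∧ (∀ l (v : ℂ), ‖v‖ = 1 → ∀ x, SW l (Literature.Topology.FourManifolds.MMSW.fibreRot (fun _ => v) x) = SW l x) ∧ ∀ l, ∀ x ∈ Literature.Topology.FourManifolds.MMSW.modelHandlebody k, (Literature.AlgebraicTopology.Homotopy.HopfFibration.zC (κ x) - Literature.Topology.FourManifolds.MMSW.holeCentre k l) / ((‖Literature.AlgebraicTopology.Homotopy.HopfFibration.zC (κ x) - Literature.Topology.FourManifolds.MMSW.holeCentre k l‖ : ℝ) : ℂ) = Complex.exp ((SW l x : ℂ) * Complex.I) * ((Literature.AlgebraicTopology.Homotopy.HopfFibration.zC x - Literature.Topology.FourManifolds.MMSW.holeCentre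 k l) / ((‖Literature.AlgebraicTopology.Homotopy.HopfFibration.zC x - Literature.Topology.FourManifolds.MMSW.holeCentre k l‖ : ℝ) : ℂ))) → (∀ (k : ℕ) (c : EuclideanSpace ℝ (Fin 4)) (a : ℝ) (W : Set (EuclideanSpace ℝ (Fin 4))) (h : Fin k → EuclideanSpace ℝ (Fin 4) → EuclideanSpace ℝ (Fin 4)), (0 < a ∧ Metric.closedBall c (3 * a / 2) ⊆ Literature.Topology.FourManifolds.MMSW.modelHandlebody k ∧ IsOpen W ∧ {p : EuclideanSpace ℝ (Fin 4) | |p 0| ≤ 1 ∧ (p 1) ^ 2 + (p 2) ^ 2 + (p 3) ^ 2 ≤ 1} ⊆ W ∧ (∀ j, ContDiffOn ℝ ((⊤ : ℕ∞) : WithTop ℕ∞) (h j) W ∧ Set.InjOn (h j) W ∧ (∀ p ∈ W, Function.Injective (fderiv ℝ (h j) p)) ∧ Set.MapsTo (h j) W (Literature.Topology.FourManifolds.MMSW.modelHandlebody k)) ∧ (∀ j l, j ≠ l → ∀ p ∈ W, ∀ q ∈ W, h j p ≠ h l q) ∧ (∀ j, ∀ p ∈ W, 1 / 2 ≤ |p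 0| → dist (h j p) c = a * (2 - |p 0|)) ∧ (∀ j, ∀ p ∈ W, |p 0| ≤ 1 / 2 → 3 * a / 2 ≤ dist (h j p) c)) → (∀ j (β : ℝ), ∀ p ∈ W, h j (!₂[p 0, p 1, Real.cos β * p 2 - Real.sin β * p 3, Real.sin β * p 2 + Real.cos β * p 3]) = Literature.Topology.FourManifolds.MMSW.fibreRot (fun _ => Complex.exp ((β : ℂ) * Complex.I)) (h j p)) → (∀ j l, ∃ Λ : EuclideanSpace ℝ (Fin 4) → ℝ, ContDiffOn ℝ ((⊤ : ℕ∞) : WithTop ℕ∞) Λ W ∧ (∀ p ∈ W, Complex.exp ((Λ p : ℂ) * Complex.I) = (Literature.AlgebraicTopology.Homotopy.HopfFibration.zC (h j p) - Literature.Topology.FourManifolds.MMSW.holeCentre k l) / (((‖Literature.AlgebraicTopology.Homotopy.HopfFibration.zC (h j p) - Literature.Topology.FourManifolds.MMSW.holeCentre k l‖ : ℝ)) : ℂ)) ∧ (∀ (β : ℝ), ∀ p ∈ W, !₂[p 0, p 1, Real.cos β * p 2 - Real.sin β * p 3, Real.sin β * p 2 + Real.cos β * p 3] ∈ W → Λ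 (!₂[p 0, p 1, Real.cos β * p 2 - Real.sin β * p 3, Real.sin β * p 2 + Real.cos β * p 3]) = Λ p) ∧ (∀ p ∈ W, 1 / 2 ≤ |p 0| → Λ p = Complex.arg ((Literature.AlgebraicTopology.Homotopy.HopfFibration.zC (h j p) - Literature.Topology.FourManifolds.MMSW.holeCentre k l) * (starRingEnd ℂ) (Literature.AlgebraicTopology.Homotopy.HopfFibration.zC c - Literature.Topology.FourManifolds.MMSW.holeCentre k l)) + Complex.arg (Literature.AlgebraicTopology.Homotopy.HopfFibration.zC c - Literature.Topology.FourManifolds.MMSW.holeCentre k l) + (if j = l ∧ 0 < p 0 then 2 * Real.pi else 0))) → (∀ (m : Fin k → ℤ) (ρ : ℝ), ρ < 3 * a / 2 → ∃ (ε : Fin k → ℤ) (N' : Set (EuclideanSpace ℝ (Fin 4))) (Θ : EuclideanSpace ℝ (Fin 4) → ℝ), IsOpen N' ∧ Metric.closedBall c ρ ⊆ N' ∧ (∀ j, h j '' {p : EuclideanSpace ℝ (Fin 4) | |p 0| ≤ 1 ∧ (p 1) ^ 2 + (p 2) ^ 2 + (p 3) ^ 2 ≤ 1} ⊆ N') ∧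 ContDiffOn ℝ ((⊤ : ℕ∞) : WithTop ℕ∞) Θ N' ∧ (∀ v : ℂ, ‖v‖ = 1 → ∀ y ∈ N', Θ (Literature.Topology.FourManifolds.MMSW.fibreRot (fun _ => v) y) = Θ y) ∧ (∀ y ∈ N', dist y c ≤ ρ → Complex.exp ((Θ y : ℂ) * Complex.I) * ∏ l : Fin k, ((Literature.AlgebraicTopology.Homotopy.HopfFibration.zC y - Literature.Topology.FourManifolds.MMSW.holeCentre k l) / (((‖Literature.AlgebraicTopology.Homotopy.HopfFibration.zC y - Literature.Topology.FourManifolds.MMSW.holeCentre k l‖ : ℝ)) : ℂ)) ^ (ε l) = 1) ∧ (∀ j, ∀ p ∈ W, h j p ∈ N' → Complex.exp ((Θ (h j p) : ℂ) * Complex.I) * ∏ l : Fin k, ((Literature.AlgebraicTopology.Homotopy.HopfFibration.zC (h j p) - Literature.Topology.FourManifolds.MMSW.holeCentre k l) / (((‖Literature.AlgebraicTopology.Homotopy.HopfFibration.zC (h j p) - Literature.Topology.FourManifolds.MMSW.holeCentre k l‖ : ℝ)) : ℂ)) ^ (ε l) = Complex.exp (((2 * Real.pi * (m j : ℝ) *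 Real.smoothTransition (p 0 + 1 / 2) : ℝ) : ℂ) * Complex.I)))) → ∀ (k : ℕ), ∃ (c : EuclideanSpace ℝ (Fin 4)) (a : ℝ) (W : Set (EuclideanSpace ℝ (Fin 4))) (h : Fin k → EuclideanSpace ℝ (Fin 4) → EuclideanSpace ℝ (Fin 4)), (0 < a ∧ Metric.closedBall c (3 * a / 2) ⊆ Literature.Topology.FourManifolds.MMSW.modelHandlebody k ∧ IsOpen W ∧ {p : EuclideanSpace ℝ (Fin 4) | |p 0| ≤ 1 ∧ (p 1) ^ 2 + (p 2) ^ 2 + (p 3) ^ 2 ≤ 1} ⊆ W ∧ (∀ j, ContDiffOn ℝ ((⊤ : ℕ∞) : WithTop ℕ∞) (h j) W ∧ Set.InjOn (h j) W ∧ (∀ p ∈ W, Function.Injective (fderiv ℝ (h j) p)) ∧ Set.MapsTo (h j) W (Literature.Topology.FourManifolds.MMSW.modelHandlebody k)) ∧ (∀ j l, j ≠ l → ∀ p ∈ W, ∀ q ∈ W, h j p ≠ h l q) ∧ (∀ j, ∀ p ∈ W, 1 / 2 ≤ |p 0| → dist (h j p) c = a * (2 - |p 0|)) ∧ (∀ j,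 ∀ p ∈ W, |p 0| ≤ 1 / 2 → 3 * a / 2 ≤ dist (h j p) c)) ∧ (∀ j (β : ℝ), ∀ p ∈ W, h j (!₂[p 0, p 1, Real.cos β * p 2 - Real.sin β * p 3, Real.sin β * p 2 + Real.cos β * p 3]) = Literature.Topology.FourManifolds.MMSW.fibreRot (fun _ => Complex.exp ((β : ℂ) * Complex.I)) (h j p)) ∧ (∀ (m : Fin k → ℤ) (ρ : ℝ), ρ < 3 * a / 2 → ∃ (ε : Fin k → ℤ) (N' : Set (EuclideanSpace ℝ (Fin 4))) (Θ : EuclideanSpace ℝ (Fin 4) → ℝ), IsOpen N' ∧ Metric.closedBall c ρ ⊆ N' ∧ (∀ j, h j '' {p : EuclideanSpace ℝ (Fin 4) | |p 0| ≤ 1 ∧ (p 1) ^ 2 + (p 2) ^ 2 + (p 3) ^ 2 ≤ 1} ⊆ N') ∧ ContDiffOn ℝ ((⊤ : ℕ∞) : WithTop ℕ∞) Θ N' ∧ (∀ v : ℂ, ‖v‖ = 1 → ∀ y ∈ N', Θ (Literature.Topology.FourManifolds.MMSW.fibreRot (fun _ => v) y) = Θ y) ∧ (∀ y ∈ N', dist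 y c ≤ ρ → Complex.exp ((Θ y : ℂ) * Complex.I) * ∏ l : Fin k, ((Literature.AlgebraicTopology.Homotopy.HopfFibration.zC y - Literature.Topology.FourManifolds.MMSW.holeCentre k l) / (((‖Literature.AlgebraicTopology.Homotopy.HopfFibration.zC y - Literature.Topology.FourManifolds.MMSW.holeCentre k l‖ : ℝ)) : ℂ)) ^ (ε l) = 1) ∧ (∀ j, ∀ p ∈ W, h j p ∈ N' → Complex.exp ((Θ (h j p) : ℂ) * Complex.I) * ∏ l : Fin k, ((Literature.AlgebraicTopology.Homotopy.HopfFibration.zC (h j p) - Literature.Topology.FourManifolds.MMSW.holeCentre k l) / (((‖Literature.AlgebraicTopology.Homotopy.HopfFibration.zC (h j p) - Literature.Topology.FourManifolds.MMSW.holeCentre k l‖ : ℝ)) : ℂ)) ^ (ε l) = Complex.exp (((2 * Real.pi * (m j : ℝ) * Real.smoothTransition (p 0 + 1 / 2) : ℝ) : ℂ) * Complex.I))) ∧ (∀ (U : Set (EuclideanSpace ℝ (Fin 4))) (ρ : ℝ), IsOpen U → Literature.Topology.FourManifolds.MMSW.modelHandlebody k ⊆ U → a < ρ → ρ < 3 *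 a / 2 → ∃ (κ : EuclideanSpace ℝ (Fin 4) ≃ₘ⟮𝓡 4, 𝓡 4⟯ EuclideanSpace ℝ (Fin 4)) (K N₀ : Set (EuclideanSpace ℝ (Fin 4))) (SW : Fin k → EuclideanSpace ℝ (Fin 4) → ℝ), IsCompact K ∧ K ⊆ U ∧ (∀ x, x ∉ K → κ x = x) ∧ (∀ v : ℂ, ‖v‖ = 1 → ∀ x, κ (Literature.Topology.FourManifolds.MMSW.fibreRot (fun _ => v) x) = Literature.Topology.FourManifolds.MMSW.fibreRot (fun _ => v) (κ x)) ∧ (∀ x ∈ Literature.Topology.FourManifolds.MMSW.modelHandlebody k, κ x ∈ Metric.closedBall c ρ ∨ ∃ j, ∃ p ∈ {p : EuclideanSpace ℝ (Fin 4) | |p 0| ≤ 1 ∧ (p 1) ^ 2 + (p 2) ^ 2 + (p 3) ^ 2 ≤ 1}, κ x = h j p) ∧ IsOpen N₀ ∧ Literature.Topology.FourManifolds.MMSW.modelHandlebody k ⊆ N₀ ∧ (∀ l, ContDiffOn ℝ ((⊤ : ℕ∞) : WithTop ℕ∞) (SW l) N₀) ∧ (∀ l (v : ℂ), ‖v‖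 = 1 → ∀ x, SW l (Literature.Topology.FourManifolds.MMSW.fibreRot (fun _ => v) x) = SW l x) ∧ ∀ l, ∀ x ∈ Literature.Topology.FourManifolds.MMSW.modelHandlebody k, (Literature.AlgebraicTopology.Homotopy.HopfFibration.zC (κ x) - Literature.Topology.FourManifolds.MMSW.holeCentre k l) / ((‖Literature.AlgebraicTopology.Homotopy.HopfFibration.zC (κ x) - Literature.Topology.FourManifolds.MMSW.holeCentre k l‖ : ℝ) : ℂ) = Complex.exp ((SW l x : ℂ) * Complex.I) * ((Literature.AlgebraicTopology.Homotopy.HopfFibration.zC x - Literature.Topology.FourManifolds.MMSW.holeCentre k l) / ((‖Literature.AlgebraicTopology.Homotopy.HopfFibration.zC x - Literature.Topology.FourManifolds.MMSW.holeCentre k l‖ : ℝ) : ℂ))) := by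
  intro h1 h2 h3 k
  obtain ⟨c, a, W, h, hc, ha, hstatic, hequiv, hlift, hcover⟩ := h1 k
  refine ⟨c, a, W, h, hstatic, hequiv, h3 k c a W h hstatic hequiv hlift, ?_⟩
  intro U ρ hUo hDU haρ hρ
  subst hc ha
  obtain ⟨κ, K, N₀, SW, hKc, hKU, hκK, hκrot, himg, hrest⟩ :=
    h2 k U ρ hUo hDU (by linarith) (by linarith)
  refine ⟨κ, K, N₀, SW, hKc, hKU, hκK, hκrot, fun x hx => ?_, hrest⟩
  rcases himg x hx with hb | ⟨j, hj⟩
  · exact Or.inl hb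
  · obtain ⟨p, hp, hpy⟩ := hcover j (κ x) _ _ rfl rfl (hj _ _ rfl rfl)
    exact Or.inr ⟨j, p, hp, hpy.symm⟩

/-! ## V_k and Data, derived -/

/-- V_k (v8: DERIVED from parts A, B, C) — THE `Y`-COLLARED END OF THE INVERTED MODEL DISC EXTERIOR (the remaining piece of the carrier A;
`k ≥ 1` analogue of the tree's PROVED `Knot.IsSliceDisc.exists_endCollar_of_isIntegralSurgery_zero`,
`Literature/Topology/FourManifolds/SliceDiscEndCollar.lean`).  Given a null-homologous model knot `K₁ ⊂ ∂D_k`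
off the cores, a NEAT model slice disc `f₁` with a trivialised tube `T` of its interior off `D_k`, a
`3`-manifold `Y` glued from `∂D_k ∖ K₁` (chart `jM` on an open `W ⊇ ∂D_k ∖ K₁`, inverse `ψ`) and a solid
torus `jB` along the tube `νK` of `K₁` in `∂D_k` (gluing relation = `0`-framed surgery, the framing read in
the picture `draw k` through a `0`-framed tube `ν'` of the picture knot `J`), with dual knot `μ₁ = jB(0, ·)`:
the inverted exterior `F = {0} ∪ ι(ℝ⁴ ∖ (D_k ∪ Δ₁))` (`ι` = inversion in the unit sphere, so that the end at
`D_k ∪ Δ₁` is the only end) has a collar `c : Y × ℝ ≅ F ∖ (compact)`, smooth with smooth inverse, proper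
towards the end, under which the collar loop `c(μ₁, 0)` CONTROLS the inverted tube meridian of `Δ₁`
(null-homotopy of the image of the first under any map `g : F → Z` gives that of the second).
Registered 2026-08-17T05:25Z (a1) namespace-opened (3814 chars); 12 preparatory pieces LANDED
(`Theorems/DottedCircleRasmussenDcrGapHelperFriendsCarrierVk{LevelField, ClockFlow, CollarChart, DiscTube,
FlowTube, DiscBand, BandDisc, AdaptedField, AdaptedFieldNeat, DiscFlowLines, DiscFlowLinesNeat,
HomotopyClause}.lean`).  Consumed by `Theorems.DcrGap.MkFriends.stub_friendsCarrier_of_collars` as its `hV`.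
[cite: ManolescuPiccirillo2023, §3.2, proof of Lemma 3.3] [cite: Kosinski1993, Ch. III Thm (4.2)] -/
theorem helper_friendsCarrier_Vk : ∀ (k : ℕ) (K₁ : (sphere (0 : EuclideanSpace ℝ (Fin 2)) 1) → EuclideanSpace ℝ (Fin 4)) (f₁ : EuclideanSpace ℝ (Fin 2) → EuclideanSpace ℝ (Fin 4)) (T : EuclideanSpace ℝ (Fin 2) × EuclideanSpace ℝ (Fin 2) → EuclideanSpace ℝ (Fin 4)), IsModelKnot k K₁ → IsNullHomologous k K₁ → (∀ t, wC (K₁ t) ≠ 0) → IsModelSliceDisc k K₁ f₁ → (∀ t : (sphere (0 : EuclideanSpace ℝ (Fin 2)) 1), deriv (fun ρ : ℝ => levelFun k (f₁ (ρ • (t : EuclideanSpace ℝ (Fin 2))))) 1 < 0) → (ContDiffOn ℝ ∞ T (ball 0 1 ×ˢ ball 0 2) ∧ InjOn T (ball 0 1 ×ˢ ball 0 2) ∧ (∀ q ∈ ball 0 1 ×ˢ ball 0 2, Injective (fderiv ℝ T q)) ∧ (∀ q ∈ ball 0 1 ×ˢ ball 0 2, T q ∉ modelHandlebody k) ∧ (∀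 x ∈ ball 0 1, T (x, 0) = f₁ x)) → ∀ (Y : Type) [TopologicalSpace Y] [T2Space Y] [SecondCountableTopology Y] [ChartedSpace (EuclideanSpace ℝ (Fin 3)) Y] [IsManifold (𝓡 3) ∞ Y] (jB : solidTorus → Y) (μ₁ : C((sphere (0 : EuclideanSpace ℝ (Fin 2)) 1), Y)) (νK : (sphere (0 : EuclideanSpace ℝ (Fin 2)) 1) × EuclideanSpace ℝ (Fin 2) → EuclideanSpace ℝ (Fin 4)) (jM : EuclideanSpace ℝ (Fin 4) → Y) (W : Set (EuclideanSpace ℝ (Fin 4))) (ψ : Y → EuclideanSpace ℝ (Fin 4)), (Manifold.IsSmoothEmbedding (𝓘(ℝ, EuclideanSpace ℝ (Fin 2)).prod (𝓡 1)) (𝓡 3) ∞ jB ∧ IsOpen (range jB) ∧ ContMDiff ((𝓡 1).prod 𝓘(ℝ, EuclideanSpace ℝ (Fin 2))) 𝓘(ℝ, EuclideanSpace ℝ (Fin 4)) ∞ νK ∧ Injective νK ∧ (∀ p, Injective (mfderiv ((𝓡 1).prod 𝓘(ℝ, EuclideanSpace ℝ (Fin 2))) 𝓘(ℝ, EuclideanSpace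 ℝ (Fin 4)) νK p)) ∧ (∀ p, νK p ∈ modelBoundary k) ∧ (∀ u : (sphere (0 : EuclideanSpace ℝ (Fin 2)) 1), νK (u, 0) = K₁ u) ∧ IsOpen W ∧ (∀ x ∈ modelBoundary k, x ∉ range K₁ → x ∈ W) ∧ ContMDiffOn 𝓘(ℝ, EuclideanSpace ℝ (Fin 4)) (𝓡 3) ∞ jM W ∧ IsOpen (jM '' {x : EuclideanSpace ℝ (Fin 4) | x ∈ modelBoundary k ∧ x ∉ range K₁}) ∧ ContMDiffOn (𝓡 3) 𝓘(ℝ, EuclideanSpace ℝ (Fin 4)) ∞ ψ (jM '' {x : EuclideanSpace ℝ (Fin 4) | x ∈ modelBoundary k ∧ x ∉ range K₁}) ∧ (∀ x ∈ modelBoundary k, x ∉ range K₁ → ψ (jM x) = x) ∧ jM '' {x : EuclideanSpace ℝ (Fin 4) | x ∈ modelBoundary k ∧ x ∉ range K₁} ∪ range jB = univ ∧ (∀ x ∈ modelBoundary k, x ∉ range K₁ → ∀ b : solidTorus, jM x = jB b ↔ ∃ (u : (sphere (0 : EuclideanSpace ℝ (Fin 2)) 1)) (t : ℝ), t ∈ Ioo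 (0 : ℝ) 1 ∧ b.1.1 = t • (u : EuclideanSpace ℝ (Fin 2)) ∧ x = νK (u, t • (b.1.2 : EuclideanSpace ℝ (Fin 2))))) → (∀ (v : (sphere (0 : EuclideanSpace ℝ (Fin 2)) 1)) (b : solidTorus), b.1 = (0, v) → μ₁ v = jB b) → ∀ (J : Knot) (ν' : Knot.TubularNbhd J) (r : ℝ), (∀ p, wC (νK p) ≠ 0) ∧ ν'.HasFraming 0 ∧ 0 < r ∧ (∀ (u : (sphere (0 : EuclideanSpace ℝ (Fin 2)) 1)) (w : EuclideanSpace ℝ (Fin 2)), ‖w‖ < 1 → toSphereThree (draw k (νK (u, w))).1 (draw k (νK (u, w))).2 = ν' (u, r • w)) → ∀ (E F : Opens (EuclideanSpace ℝ (Fin 4))), (E : Set (EuclideanSpace ℝ (Fin 4))) = {x | x ∉ modelHandlebody k ∧ x ∉ f₁ '' closedBall 0 1} → (F : Set (EuclideanSpace ℝ (Fin 4))) = {0} ∪ {y : EuclideanSpace ℝ (Fin 4) | y ≠ 0 ∧ (‖y‖ ^ 2)⁻¹ • y ∉ modelHandlebody k ∧ (‖y‖ ^ 2)⁻¹ • y ∉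 f₁ '' closedBall 0 1} → ∃ c : OpenPartialHomeomorph (Y × ℝ) F, c.source = univ ∧ ContMDiffOn ((𝓡 3).prod 𝓘(ℝ, ℝ)) (𝓡 4) ∞ c c.source ∧ ContMDiffOn (𝓡 4) ((𝓡 3).prod 𝓘(ℝ, ℝ)) ∞ c.symm c.target ∧ (∀ a : ℝ, IsClosed (c '' {q | q.2 ≤ a})) ∧ (∀ a : ℝ, IsCompact (c.targetᶜ ∪ c '' {q | a ≤ q.2})) ∧ ∀ (L₁ L₂ : C((sphere (0 : EuclideanSpace ℝ (Fin 2)) 1), F)), (∀ v, L₁ v = c (μ₁ v, 0)) → (∀ v : (sphere (0 : EuclideanSpace ℝ (Fin 2)) 1), ((L₂ v : F) : EuclideanSpace ℝ (Fin 4)) = (‖T ((0 : EuclideanSpace ℝ (Fin 2)), (1 / 2 : ℝ) • (v : EuclideanSpace ℝ (Fin 2)))‖ ^ 2)⁻¹ • T ((0 : EuclideanSpace ℝ (Fin 2)), (1 / 2 : ℝ) • (v : EuclideanSpace ℝ (Fin 2)))) → ∀ (Z : Type) [TopologicalSpace Z] (g : C(F, Z)), (∃ z : Z, (g.comp L₁).Homotopic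 (ContinuousMap.const (sphere (0 : EuclideanSpace ℝ (Fin 2)) 1) z)) → ∃ z : Z, (g.comp L₂).Homotopic (ContinuousMap.const (sphere (0 : EuclideanSpace ℝ (Fin 2)) 1) z) :=
  helper_friendsCarrier_Vk_of_parts helper_friendsCarrier_Vk_partA helper_friendsCarrier_Vk_partB
    helper_friendsCarrier_Vk_partC

/-- Data (v8: DERIVED from parts 1, 2 and the LANDED part 3) — THE EXPLICIT HANDLE DATA OF THE MODEL `D_k` (the remaining piece of D; about OUR model
`MMSW.modelHandlebody k`, not citable): a base ball `B(c, 3a/2) ⊆ D_k`, `k` handle charts `h j` (smooth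
injective immersions of an open `W ⊇ D¹ × D³` into `D_k`, pairwise disjoint images, equivariant under the
fibre rotations `fibreRot`), entering the ball conically, and for every open `U ⊇ D_k` and radius
`a < ρ < 3a/2` a compactly supported (in `U`) equivariant squeeze `κ` of `ℝ⁴` taking `D_k` into
`B(c, ρ) ∪ ⋃_j h j (D¹ × D³)`, together with the swept-angle (phase) data of the squeeze along each hole.
M3 follows from it by the LANDED `helper_handlebodyChart_modelHandles_of_data` (p149320; aux p149654, p152054 …).
Registered 2026-08-17T08:28Z (a1), 3767 chars, complete. [cite: GompfStipsicz1999, §4.1 and §4.4] -/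
theorem helper_handlebodyChart_modelHandles_data : ∀ (k : ℕ), ∃ (c : EuclideanSpace ℝ (Fin 4)) (a : ℝ) (W : Set (EuclideanSpace ℝ (Fin 4))) (h : Fin k → EuclideanSpace ℝ (Fin 4) → EuclideanSpace ℝ (Fin 4)), (0 < a ∧ Metric.closedBall c (3 * a / 2) ⊆ Literature.Topology.FourManifolds.MMSW.modelHandlebody k ∧ IsOpen W ∧ {p : EuclideanSpace ℝ (Fin 4) | |p 0| ≤ 1 ∧ (p 1) ^ 2 + (p 2) ^ 2 + (p 3) ^ 2 ≤ 1} ⊆ W ∧ (∀ j, ContDiffOn ℝ ((⊤ : ℕ∞) : WithTop ℕ∞) (h j) W ∧ Set.InjOn (h j) W ∧ (∀ p ∈ W, Function.Injective (fderiv ℝ (h j) p)) ∧ Set.MapsTo (h j) W (Literature.Topology.FourManifolds.MMSW.modelHandlebody k)) ∧ (∀ j l, j ≠ l → ∀ p ∈ W, ∀ q ∈ W, h j p ≠ h l q) ∧ (∀ j, ∀ p ∈ W, 1 / 2 ≤ |p 0| → dist (h j p) c = a * (2 - |p 0|)) ∧ (∀ j, ∀ p ∈ W, |p 0| ≤ 1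 / 2 → 3 * a / 2 ≤ dist (h j p) c)) ∧ (∀ j (β : ℝ), ∀ p ∈ W, h j (!₂[p 0, p 1, Real.cos β * p 2 - Real.sin β * p 3, Real.sin β * p 2 + Real.cos β * p 3]) = Literature.Topology.FourManifolds.MMSW.fibreRot (fun _ => Complex.exp ((β : ℂ) * Complex.I)) (h j p)) ∧ (∀ (m : Fin k → ℤ) (ρ : ℝ), ρ < 3 * a / 2 → ∃ (ε : Fin k → ℤ) (N' : Set (EuclideanSpace ℝ (Fin 4))) (Θ : EuclideanSpace ℝ (Fin 4) → ℝ), IsOpen N' ∧ Metric.closedBall c ρ ⊆ N' ∧ (∀ j, h j '' {p : EuclideanSpace ℝ (Fin 4) | |p 0| ≤ 1 ∧ (p 1) ^ 2 + (p 2) ^ 2 + (p 3) ^ 2 ≤ 1} ⊆ N') ∧ ContDiffOn ℝ ((⊤ : ℕ∞) : WithTop ℕ∞) Θ N' ∧ (∀ v : ℂ, ‖v‖ = 1 → ∀ y ∈ N', Θ (Literature.Topology.FourManifolds.MMSW.fibreRot (fun _ => v) y) = Θ y) ∧ (∀ y ∈ N', dist y c ≤ ρ → Complex.exp ((Θ y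 : ℂ) * Complex.I) * ∏ l : Fin k, ((Literature.AlgebraicTopology.Homotopy.HopfFibration.zC y - Literature.Topology.FourManifolds.MMSW.holeCentre k l) / (((‖Literature.AlgebraicTopology.Homotopy.HopfFibration.zC y - Literature.Topology.FourManifolds.MMSW.holeCentre k l‖ : ℝ)) : ℂ)) ^ (ε l) = 1) ∧ (∀ j, ∀ p ∈ W, h j p ∈ N' → Complex.exp ((Θ (h j p) : ℂ) * Complex.I) * ∏ l : Fin k, ((Literature.AlgebraicTopology.Homotopy.HopfFibration.zC (h j p) - Literature.Topology.FourManifolds.MMSW.holeCentre k l) / (((‖Literature.AlgebraicTopology.Homotopy.HopfFibration.zC (h j p) - Literature.Topology.FourManifolds.MMSW.holeCentre k l‖ : ℝ)) : ℂ)) ^ (ε l) = Complex.exp (((2 * Real.pi * (m j : ℝ) * Real.smoothTransition (p 0 + 1 / 2) : ℝ) : ℂ) * Complex.I))) ∧ (∀ (U : Set (EuclideanSpace ℝ (Fin 4))) (ρ : ℝ), IsOpen U → Literature.Topology.FourManifolds.MMSW.modelHandlebody k ⊆ U → a < ρ → ρ < 3 * a / 2 → ∃ (κ : EuclideanSpace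 ℝ (Fin 4) ≃ₘ⟮𝓡 4, 𝓡 4⟯ EuclideanSpace ℝ (Fin 4)) (K N₀ : Set (EuclideanSpace ℝ (Fin 4))) (SW : Fin k → EuclideanSpace ℝ (Fin 4) → ℝ), IsCompact K ∧ K ⊆ U ∧ (∀ x, x ∉ K → κ x = x) ∧ (∀ v : ℂ, ‖v‖ = 1 → ∀ x, κ (Literature.Topology.FourManifolds.MMSW.fibreRot (fun _ => v) x) = Literature.Topology.FourManifolds.MMSW.fibreRot (fun _ => v) (κ x)) ∧ (∀ x ∈ Literature.Topology.FourManifolds.MMSW.modelHandlebody k, κ x ∈ Metric.closedBall c ρ ∨ ∃ j, ∃ p ∈ {p : EuclideanSpace ℝ (Fin 4) | |p 0| ≤ 1 ∧ (p 1) ^ 2 + (p 2) ^ 2 + (p 3) ^ 2 ≤ 1}, κ x = h j p) ∧ IsOpen N₀ ∧ Literature.Topology.FourManifolds.MMSW.modelHandlebody k ⊆ N₀ ∧ (∀ l, ContDiffOn ℝ ((⊤ : ℕ∞) : WithTop ℕ∞) (SW l) N₀) ∧ (∀ l (v : ℂ), ‖v‖ = 1 → ∀ x, SW l (Literature.Topology.FourManifolds.MMSW.fibreRot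 (fun _ => v) x) = SW l x) ∧ ∀ l, ∀ x ∈ Literature.Topology.FourManifolds.MMSW.modelHandlebody k, (Literature.AlgebraicTopology.Homotopy.HopfFibration.zC (κ x) - Literature.Topology.FourManifolds.MMSW.holeCentre k l) / ((‖Literature.AlgebraicTopology.Homotopy.HopfFibration.zC (κ x) - Literature.Topology.FourManifolds.MMSW.holeCentre k l‖ : ℝ) : ℂ) = Complex.exp ((SW l x : ℂ) * Complex.I) * ((Literature.AlgebraicTopology.Homotopy.HopfFibration.zC x - Literature.Topology.FourManifolds.MMSW.holeCentre k l) / ((‖Literature.AlgebraicTopology.Homotopy.HopfFibration.zC x - Literature.Topology.FourManifolds.MMSW.holeCentre k l‖ : ℝ) : ℂ))) :=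
  helper_handlebodyChart_modelHandles_data_of_parts helper_handlebodyChart_modelHandles_data_part1
    helper_handlebodyChart_modelHandles_data_part2 helper_handlebodyChart_modelHandles_data_part3

/-- Stub L8.19 — THE NAMED LITERATURE FACT behind the window F, taken LITERALLY: MMSW Lemma 8.19 (a
null-homologous model knot bounding a smooth proper disc in `ℝ⁴ ∖ D_r° ⊂ ♮ʳ(B² × S²)` has `s₋ ≤ 0`).  Literature
debt (Khovanov–Lee homology of `#ʳ(S¹ × S²)` with cobordism maps); in the tree it is reduced to the tower fact
`MMSW.sMinus_nonpos_of_isTowerSliceInComplement` (`MMSWRasmussenFactsProofs.lean`).  Its discharge is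
`theorem sMinus_nonpos_of_isModelSliceDisc_holds`. [cite: ManolescuMarengonSarkarWillis2023, Lemma 8.19] -/
theorem stub_mmsw819 : Literature.Topology.FourManifolds.MMSW.sMinus_nonpos_of_isModelSliceDisc := by
  sorry

/-- Stub G — THE APEX: AN `M_k`-FRIENDS DATUM WITH A CERTIFICATE (open; the named search target of
the line; by `closes` every proof of the crux exhibits an exotic `S⁴`, and this is where it lives).
There are `k ≥ 1`, model knots `K₀, K₁ ⊂ ∂D_k`, null-homologous and off the cores, a model slice disc
`f₁` for `K₁` (SEARCH REGIME: `Δ₁` DEEP — meeting the hole-filling discs — or a presentation pair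
that does not preserve the dotted sublink; the hole-avoiding `U`-preserving sub-case is the `k = 0`
Manolescu–Piccirillo programme = route `ZeroSurgeryExotic`, door 1 of the dead line `Sketch`), picture
links `L₀ = U⁰ ⊔ D(0⃗)(K₀)`, `L₁ = U⁰ ⊔ D(0⃗)(K₁)` presenting ONE `3`-manifold `Y` ("`K₀`, `K₁` are
friends in `#ᵏ(S¹ × S²)`"), whose dual knots satisfy the KERNEL CONDITION (KC): `μ₁` is null-homotopic
under every map `Y → Z` under which `μ₀` is (i.e. `μ₁ ∈ ⟪μ₀⟫` in `π₁(Y)`; necessary beyond friendship: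
the summand swap of `S¹×S² # S¹×S²` glues to `S¹ × S³ # S² × S²`), and MMSW invariants of `K₀` outside
the window, `s₋(K₀) > 0 ∨ s₊(K₀) < 0` (one Khovanov computation of `D(k⃗)(K₀)` above the threshold of
MMSW Thm. 1.4).  Every clause but the last is a finite certificate about `3`-manifolds, link diagrams
and one disc in `ℝ⁴`.  v2: the datum carries the disc's neatness and a trivialised tube of its
interior off `D_k` (every neat smooth disc has one — Kosinski Ch. III (4.2); asked of the witness so
that no tubular-neighbourhood theorem is owed by the line) and `Y` as a smooth `3`-manifold.  v5: the
certificate is SECTOR-SATURATED — for EVERY per-handle sphere twist `τ^ε`, `ε ∈ ℤᵏ`, the knot `τ^ε ∘ K₀`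
has `s₋ > 0 ∨ s₊ < 0` (in print this is ONE computation by MMSW Thm 2.8; the line cites that theorem and
asks the witness for the saturated family, so that no sector-blindness stub is owed).  v7: restated
namespace-opened (3686 chars, under the registration cap; the proposition is unchanged). [cite: ManolescuPiccirillo2023, Lemma 3.3] [cite: ManolescuMarengonSarkarWillis2023, §9.3, Question 9.11] -/
theorem stub_friendsDatum : ∃ k : ℕ, 1 ≤ k ∧ ∃ (K₀ K₁ : (sphere (0 : EuclideanSpace ℝ (Fin 2)) 1) → EuclideanSpace ℝ (Fin 4)) (f₁ : EuclideanSpace ℝ (Fin 2) → EuclideanSpace ℝ (Fin 4)) (T : EuclideanSpace ℝ (Fin 2) × EuclideanSpace ℝ (Fin 2) → EuclideanSpace ℝ (Fin 4)), IsModelKnot k K₀ ∧ IsNullHomologous k K₀ ∧ (∀ t, wC (K₀ t) ≠ 0) ∧ IsModelKnot k K₁ ∧ IsNullHomologous k K₁ ∧ (∀ t, wC (K₁ t) ≠ 0) ∧ IsModelSliceDisc k K₁ f₁ ∧ (∀ t : (sphere (0 : EuclideanSpace ℝ (Fin 2)) 1), deriv (fun ρ : ℝ => levelFun k (f₁ (ρ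 • (t : EuclideanSpace ℝ (Fin 2))))) 1 < 0) ∧ (ContDiffOn ℝ ∞ T (ball 0 1 ×ˢ ball 0 2) ∧ InjOn T (ball 0 1 ×ˢ ball 0 2) ∧ (∀ q ∈ ball 0 1 ×ˢ ball 0 2, Injective (fderiv ℝ T q)) ∧ (∀ q ∈ ball 0 1 ×ˢ ball 0 2, T q ∉ modelHandlebody k) ∧ (∀ x ∈ ball 0 1, T (x, 0) = f₁ x)) ∧ ∃ (L₀ L₁ : FramedLink (Fin (k + 1))), ((∀ j : Fin k, ⇑(L₀.component j.castSucc) = fun θ : (sphere (0 : EuclideanSpace ℝ (Fin 2)) 1) => toSphereThree ((4 * (((j : ℕ) : ℝ) + 1) + drawRadius k) * (θ : EuclideanSpace ℝ (Fin 2)) 0, (4 * (((j : ℕ) : ℝ) + 1) + drawRadius k) * (θ : EuclideanSpace ℝ (Fin 2)) 1) 0) ∧ ⇑(L₀.component (Fin.last k)) = finiteApprox k 0 K₀ ∧ (∀ i, L₀.framing i = 0)) ∧ ((∀ j : Fin k, ⇑(L₁.component j.castSucc) = fun θ : (sphere (0 : EuclideanSpace ℝ (Fin 2)) 1) => toSphereThree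 ((4 * (((j : ℕ) : ℝ) + 1) + drawRadius k) * (θ : EuclideanSpace ℝ (Fin 2)) 0, (4 * (((j : ℕ) : ℝ) + 1) + drawRadius k) * (θ : EuclideanSpace ℝ (Fin 2)) 1) 0) ∧ ⇑(L₁.component (Fin.last k)) = finiteApprox k 0 K₁ ∧ (∀ i, L₁.framing i = 0)) ∧ ∃ (Y : Type) (_ : TopologicalSpace Y) (_ : T2Space Y) (_ : SecondCountableTopology Y) (_ : ChartedSpace (EuclideanSpace ℝ (Fin 3)) Y) (_ : IsManifold (𝓡 3) ∞ Y) (jA₀ : L₀.toLink.complement → Y) (jB₀ : Fin (k + 1) → solidTorus → Y) (jA₁ : L₁.toLink.complement → Y) (jB₁ : Fin (k + 1) → solidTorus → Y) (μ₀ μ₁ : C((sphere (0 : EuclideanSpace ℝ (Fin 2)) 1), Y)), (∃ ν : ∀ i, Knot.TubularNbhd (L₀.component i), (∀ i, (ν i).HasFraming (L₀.framing i)) ∧ (Pairwise fun i i' => Disjoint (range (ν i)) (range (ν i'))) ∧ Manifold.IsSmoothEmbedding (𝓡 3) (𝓡 3) ∞ jA₀ ∧ IsOpen (range jA₀) ∧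 (∀ i, Manifold.IsSmoothEmbedding (𝓘(ℝ, EuclideanSpace ℝ (Fin 2)).prod (𝓡 1)) (𝓡 3) ∞ (jB₀ i) ∧ IsOpen (range (jB₀ i))) ∧ range jA₀ ∪ (⋃ i, range (jB₀ i)) = univ ∧ (Pairwise fun i i' => Disjoint (range (jB₀ i)) (range (jB₀ i'))) ∧ ∀ i a b, jA₀ a = jB₀ i b ↔ Link.surgeryRel ν i a b) ∧ (∃ ν : ∀ i, Knot.TubularNbhd (L₁.component i), (∀ i, (ν i).HasFraming (L₁.framing i)) ∧ (Pairwise fun i i' => Disjoint (range (ν i)) (range (ν i'))) ∧ Manifold.IsSmoothEmbedding (𝓡 3) (𝓡 3) ∞ jA₁ ∧ IsOpen (range jA₁) ∧ (∀ i, Manifold.IsSmoothEmbedding (𝓘(ℝ, EuclideanSpace ℝ (Fin 2)).prod (𝓡 1)) (𝓡 3) ∞ (jB₁ i) ∧ IsOpen (range (jB₁ i))) ∧ range jA₁ ∪ (⋃ i, range (jB₁ i)) = univ ∧ (Pairwise fun i i' => Disjoint (range (jB₁ i)) (range (jB₁ i'))) ∧ ∀ i a b, jA₁ a = jB₁ i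 b ↔ Link.surgeryRel ν i a b) ∧ (∀ (v : (sphere (0 : EuclideanSpace ℝ (Fin 2)) 1)) (b : solidTorus), (b : EuclideanSpace ℝ (Fin 2) × (sphere (0 : EuclideanSpace ℝ (Fin 2)) 1)) = ((0 : EuclideanSpace ℝ (Fin 2)), v) → μ₀ v = jB₀ (Fin.last k) b) ∧ (∀ (v : (sphere (0 : EuclideanSpace ℝ (Fin 2)) 1)) (b : solidTorus), (b : EuclideanSpace ℝ (Fin 2) × (sphere (0 : EuclideanSpace ℝ (Fin 2)) 1)) = ((0 : EuclideanSpace ℝ (Fin 2)), v) → μ₁ v = jB₁ (Fin.last k) b) ∧ (∀ (Z : Type) [TopologicalSpace Z] (g : C(Y, Z)), (∃ z : Z, (g.comp μ₀).Homotopic (ContinuousMap.const (sphere (0 : EuclideanSpace ℝ (Fin 2)) 1) z)) → ∃ z : Z, (g.comp μ₁).Homotopic (ContinuousMap.const (sphere (0 : EuclideanSpace ℝ (Fin 2)) 1) z)) ∧ ∀ ε : Fin k → ℤ, ∃ w : MMSWRasmussen k (fibreRot (fun z : ℂ => ∏ j : Fin k, ((z - holeCentre k j) / (((‖z - holeCentre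 k j‖ : ℝ)) : ℂ)) ^ (ε j)) ∘ K₀), 0 < w.sMinus ∨ w.sPlus < 0 := by
  sorry

/-! ## Derived parts A, B, C, D, F (sorry-free given the stubs) -/

/-- Part A — THE CARRIER (v7: DERIVED, no longer a stub) (construction; XL; the `k ≥ 1` analogue of the tree's PROVED
`Knot.ManolescuPiccirillo2023_lemma33_sphere_construction`).  Model knots `K₀, K₁ ⊂ ∂D_k` (`K₁`
null-homologous, both off the core circles), framed picture links `L_i = U⁰ ⊔ J_i` (dotted unlink
picture + standard picture `D(0⃗)(K_i)`, all framings `0`), ONE `3`-manifold `Y` presented by both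
(named complement / solid-torus embeddings, dual knots `μ₀, μ₁ : C(S¹, Y)`), and a model slice disc
`f₁` for `K₁` (any depth) give: a closed smooth `4`-manifold `X` — namely
`X = (D_k ∪ collar ∪ h²_{K₀}) ∪_Y (W₀ ∖ νΔ₁)`, `W₀ = (ℝ⁴ ∖ D_k°) ∪ {∞}` — with a GERM chart `i` of
`D_k` (smooth embedding of an open `U ⊇ D_k`), a smooth proper disc `f₀` for `i ∘ K₀` off `i(D_k)`
(collar annulus `K₀ × [0,1]` ∪ core of `h²`, leaving `∂D_k` transversally along a model collar `g₀`),
a smooth open embedding `j` of the model exterior `E° = ℝ⁴ ∖ (D_k ∪ Δ₁)` onto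
`X ∖ (i(D_k) ∪ f₀(𝔻²) ∪ {q})` tending to `q` (the image of `∞`) at infinity, the collar map
`c : Y → X`, under which `μ₀` bounds the cocore of `h²` (null-homotopic) and `μ₁` is freely homotopic
to the pushed meridian `ℓ = j ∘ m` of `Δ₁` (`m` a fibre circle of a straightening chart `φ` of `Δ₁`).
Ingredients: `∂D_k ≅ S³_0⃗(U)` carrying `K` to `D(0⃗)(K)` (Kirby 1989 Ch. I Lemma 2.1 in the model of
`MMSW.draw`); `∂(W₀ ∖ νΔ₁) = M_k(K₁; disc framing)` with disc framing `= 0` because `[K₁] = 0` and the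
intersection form of `♮ᵏ(B² × S²)` vanishes (MMSW Rem. 8.15); surgery uniqueness for the two
presentations of `Y`.  v2: the datum also hands over the neatness of `f₁` and a trivialised tube `T`
of `Δ₁°` off `D_k` (hypotheses), `Y` is a smooth Hausdorff second-countable `3`-manifold, and the
meridian handed to B is the tube meridian `m v = T(0, v/2)`.  v3: the last clause is weakened to
"`c ∘ μ₁` null-homotopic ⇒ `ℓ` null-homotopic" (what the gluing reduction from P_k/T_k/V_k proves:
the collar's meridian and the datum's tube meridian are compared through Kervaire, not by a free
homotopy).  v4 STATUS: closed MODULO {named fact `Literature.Topology.FourManifolds.pictureSurgeryPresentation`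
(P_k, Kirby I §2 Lemma 2.1 in the MMSW picture, filed p143880), registered helper stub
`helper_friendsCarrier_Vk` (Y-collared end of the inverted model disc exterior; 12 pieces landed, see NOTES)}
by the LANDED gluing reduction `Theorems.DcrGap.MkFriends.stub_friendsCarrier_of_collars hP hT hV` (p143881)
with `hT := helper_friendsCarrier_Tk` LANDED (p156628 + 16 aux files); see `dcrRasmussenWitness_of_debts`.
[cite: ManolescuPiccirillo2023, §3.2, proof of Lemma 3.3]
[cite: Kirby1989, Ch. I §2, Lemma 2.1] -/
theorem friendsCarrier_of_parts : ∀ (k : ℕ) (K₀ K₁ : (Metric.sphere (0 : EuclideanSpace ℝ (Fin 2)) 1) → EuclideanSpace ℝ (Fin 4)) (f₁ : EuclideanSpace ℝ (Fin 2) → EuclideanSpace ℝ (Fin 4)) (T : EuclideanSpace ℝ (Fin 2) × EuclideanSpace ℝ (Fin 2) → EuclideanSpace ℝ (Fin 4)), Literature.Topology.FourManifolds.MMSW.IsModelKnot k K₀ → (∀ t, Literature.AlgebraicTopology.Homotopy.HopfFibration.wC (K₀ t) ≠ 0) → Literature.Topology.FourManifolds.MMSW.IsModelKnot k K₁ → Literature.Topology.FourManifolds.MMSW.IsNullHomologous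 k K₁ → (∀ t, Literature.AlgebraicTopology.Homotopy.HopfFibration.wC (K₁ t) ≠ 0) → Literature.Topology.FourManifolds.MMSW.IsModelSliceDisc k K₁ f₁ → (∀ t : (Metric.sphere (0 : EuclideanSpace ℝ (Fin 2)) 1), deriv (fun ρ : ℝ => Literature.Topology.FourManifolds.MMSW.levelFun k (f₁ (ρ • (t : EuclideanSpace ℝ (Fin 2))))) 1 < 0) → (ContDiffOn ℝ ((⊤ : ℕ∞) : WithTop ℕ∞) T (Metric.ball (0 : EuclideanSpace ℝ (Fin 2)) 1 ×ˢ Metric.ball (0 : EuclideanSpace ℝ (Fin 2)) 2) ∧ Set.InjOn T (Metric.ball (0 : EuclideanSpace ℝ (Fin 2)) 1 ×ˢ Metric.ball (0 : EuclideanSpace ℝ (Fin 2)) 2) ∧ (∀ q ∈ Metric.ball (0 : EuclideanSpace ℝ (Fin 2)) 1 ×ˢ Metric.ball (0 : EuclideanSpace ℝ (Fin 2)) 2, Function.Injective (fderiv ℝ T q)) ∧ (∀ q ∈ Metric.ball (0 : EuclideanSpace ℝ (Fin 2)) 1 ×ˢ Metric.ball (0 : EuclideanSpace ℝ (Fin 2))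 2, T q ∉ Literature.Topology.FourManifolds.MMSW.modelHandlebody k) ∧ (∀ x ∈ Metric.ball (0 : EuclideanSpace ℝ (Fin 2)) 1, T (x, 0) = f₁ x)) → ∀ (L₀ L₁ : Literature.Topology.FourManifolds.FramedLink (Fin (k + 1))), ((∀ j : Fin k, ⇑(L₀.component j.castSucc) = fun θ : (Metric.sphere (0 : EuclideanSpace ℝ (Fin 2)) 1) => Literature.Topology.FourManifolds.MMSW.toSphereThree ((4 * (((j : ℕ) : ℝ) + 1) + Literature.Topology.FourManifolds.MMSW.drawRadius k) * (θ : EuclideanSpace ℝ (Fin 2)) 0, (4 * (((j : ℕ) : ℝ) + 1) + Literature.Topology.FourManifolds.MMSW.drawRadius k) * (θ : EuclideanSpace ℝ (Fin 2)) 1) 0) ∧ ⇑(L₀.component (Fin.last k)) = Literature.Topology.FourManifolds.MMSW.finiteApprox k 0 K₀ ∧ (∀ i, L₀.framing i = 0)) → ((∀ j : Fin k, ⇑(L₁.component j.castSucc) = fun θ : (Metric.sphere (0 : EuclideanSpace ℝ (Fin 2)) 1) => Literature.Topology.FourManifolds.MMSW.toSphereThree ((4 * (((j : ℕ) : ℝ)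 + 1) + Literature.Topology.FourManifolds.MMSW.drawRadius k) * (θ : EuclideanSpace ℝ (Fin 2)) 0, (4 * (((j : ℕ) : ℝ) + 1) + Literature.Topology.FourManifolds.MMSW.drawRadius k) * (θ : EuclideanSpace ℝ (Fin 2)) 1) 0) ∧ ⇑(L₁.component (Fin.last k)) = Literature.Topology.FourManifolds.MMSW.finiteApprox k 0 K₁ ∧ (∀ i, L₁.framing i = 0)) → ∀ (Y : Type) [TopologicalSpace Y] [T2Space Y] [SecondCountableTopology Y] [ChartedSpace (EuclideanSpace ℝ (Fin 3)) Y] [IsManifold (𝓡 3) ((⊤ : ℕ∞) : WithTop ℕ∞) Y] (jA₀ : L₀.toLink.complement → Y) (jB₀ : Fin (k + 1) → Literature.Topology.FourManifolds.solidTorus → Y) (jA₁ : L₁.toLink.complement → Y) (jB₁ : Fin (k + 1) → Literature.Topology.FourManifolds.solidTorus → Y) (μ₀ μ₁ : C((Metric.sphere (0 : EuclideanSpace ℝ (Fin 2)) 1), Y)), (∃ ν : ∀ i, Literature.Topology.FourManifolds.Knot.TubularNbhd (L₀.component i), (∀ i, (ν i).HasFraming (L₀.framing i)) ∧ (Pairwise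 fun i i' => Disjoint (Set.range (ν i)) (Set.range (ν i'))) ∧ Manifold.IsSmoothEmbedding (𝓡 3) (𝓡 3) ((⊤ : ℕ∞) : WithTop ℕ∞) jA₀ ∧ IsOpen (Set.range jA₀) ∧ (∀ i, Manifold.IsSmoothEmbedding (𝓘(ℝ, EuclideanSpace ℝ (Fin 2)).prod (𝓡 1)) (𝓡 3) ((⊤ : ℕ∞) : WithTop ℕ∞) (jB₀ i) ∧ IsOpen (Set.range (jB₀ i))) ∧ Set.range jA₀ ∪ (⋃ i, Set.range (jB₀ i)) = Set.univ ∧ (Pairwise fun i i' => Disjoint (Set.range (jB₀ i)) (Set.range (jB₀ i'))) ∧ ∀ i a b, jA₀ a = jB₀ i b ↔ Literature.Topology.FourManifolds.Link.surgeryRel ν i a b) → (∃ ν : ∀ i, Literature.Topology.FourManifolds.Knot.TubularNbhd (L₁.component i), (∀ i, (ν i).HasFraming (L₁.framing i)) ∧ (Pairwise fun i i' => Disjoint (Set.range (ν i)) (Set.range (ν i'))) ∧ Manifold.IsSmoothEmbedding (𝓡 3) (𝓡 3) ((⊤ : ℕ∞) : WithTop ℕ∞) jA₁ ∧ IsOpen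 (Set.range jA₁) ∧ (∀ i, Manifold.IsSmoothEmbedding (𝓘(ℝ, EuclideanSpace ℝ (Fin 2)).prod (𝓡 1)) (𝓡 3) ((⊤ : ℕ∞) : WithTop ℕ∞) (jB₁ i) ∧ IsOpen (Set.range (jB₁ i))) ∧ Set.range jA₁ ∪ (⋃ i, Set.range (jB₁ i)) = Set.univ ∧ (Pairwise fun i i' => Disjoint (Set.range (jB₁ i)) (Set.range (jB₁ i'))) ∧ ∀ i a b, jA₁ a = jB₁ i b ↔ Literature.Topology.FourManifolds.Link.surgeryRel ν i a b) → (∀ (v : (Metric.sphere (0 : EuclideanSpace ℝ (Fin 2)) 1)) (b : Literature.Topology.FourManifolds.solidTorus), (b : EuclideanSpace ℝ (Fin 2) × (Metric.sphere (0 : EuclideanSpace ℝ (Fin 2)) 1)) = ((0 : EuclideanSpace ℝ (Fin 2)), v) → μ₀ v = jB₀ (Fin.last k) b) → (∀ (v : (Metric.sphere (0 : EuclideanSpace ℝ (Fin 2)) 1)) (b : Literature.Topology.FourManifolds.solidTorus), (b : EuclideanSpace ℝ (Fin 2) × (Metric.sphere (0 : EuclideanSpace ℝ (Fin 2)) 1))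 = ((0 : EuclideanSpace ℝ (Fin 2)), v) → μ₁ v = jB₁ (Fin.last k) b) → ∃ (X : Type) (_ : TopologicalSpace X) (_ : T2Space X) (_ : SecondCountableTopology X) (_ : ChartedSpace (EuclideanSpace ℝ (Fin 4)) X) (_ : IsManifold (𝓡 4) ((⊤ : ℕ∞) : WithTop ℕ∞) X) (_ : CompactSpace X) (U : Set (EuclideanSpace ℝ (Fin 4))) (i : EuclideanSpace ℝ (Fin 4) → X) (f₀ : EuclideanSpace ℝ (Fin 2) → X) (g₀ : EuclideanSpace ℝ (Fin 2) → EuclideanSpace ℝ (Fin 4)) (E : TopologicalSpace.Opens (EuclideanSpace ℝ (Fin 4))) (j : E → X) (q : X) (c : C(Y, X)) (m : (Metric.sphere (0 : EuclideanSpace ℝ (Fin 2)) 1) → EuclideanSpace ℝ (Fin 4)) (ℓ : C((Metric.sphere (0 : EuclideanSpace ℝ (Fin 2)) 1), X)), (IsOpen U ∧ Literature.Topology.FourManifolds.MMSW.modelHandlebody k ⊆ U ∧ ContMDiffOn (𝓡 4) (𝓡 4) ((⊤ : ℕ∞) : WithTop ℕ∞) i U ∧ Set.InjOn i U ∧ (∀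 x ∈ U, Function.Injective (mfderiv (𝓡 4) (𝓡 4) i x))) ∧ (ContMDiff (𝓡 2) (𝓡 4) ((⊤ : ℕ∞) : WithTop ℕ∞) f₀ ∧ Set.InjOn f₀ (Metric.closedBall (0 : EuclideanSpace ℝ (Fin 2)) 1) ∧ (∀ x ∈ Metric.closedBall (0 : EuclideanSpace ℝ (Fin 2)) 1, Function.Injective (mfderiv (𝓡 2) (𝓡 4) f₀ x)) ∧ (∀ x : EuclideanSpace ℝ (Fin 2), ‖x‖ < 1 → f₀ x ∉ i '' Literature.Topology.FourManifolds.MMSW.modelHandlebody k) ∧ (∀ t : (Metric.sphere (0 : EuclideanSpace ℝ (Fin 2)) 1), f₀ t = i (K₀ t)) ∧ ContDiff ℝ ((⊤ : ℕ∞) : WithTop ℕ∞) g₀ ∧ (∃ η : ℝ, 0 < η ∧ (∀ x : EuclideanSpace ℝ (Fin 2), 1 - η < ‖x‖ → ‖x‖ ≤ 1 → g₀ x ∈ U ∧ f₀ x = i (g₀ x))) ∧ (∀ t : (Metric.sphere (0 : EuclideanSpace ℝ (Fin 2)) 1), deriv (fun ρ : ℝ => Literature.Topology.FourManifolds.MMSW.levelFun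 k (g₀ (ρ • (t : EuclideanSpace ℝ (Fin 2))))) 1 < 0)) ∧ (((E : Set (EuclideanSpace ℝ (Fin 4))) = {x | x ∉ Literature.Topology.FourManifolds.MMSW.modelHandlebody k ∧ x ∉ f₁ '' Metric.closedBall (0 : EuclideanSpace ℝ (Fin 2)) 1}) ∧ Manifold.IsSmoothEmbedding (𝓡 4) (𝓡 4) ((⊤ : ℕ∞) : WithTop ℕ∞) j ∧ IsOpen (Set.range j) ∧ Set.range j = (i '' Literature.Topology.FourManifolds.MMSW.modelHandlebody k ∪ f₀ '' Metric.closedBall (0 : EuclideanSpace ℝ (Fin 2)) 1 ∪ {q})ᶜ ∧ (∀ s ∈ nhds q, ∃ R : ℝ, ∀ a : E, R < ‖(a : EuclideanSpace ℝ (Fin 4))‖ → j a ∈ s)) ∧ (∀ v : (Metric.sphere (0 : EuclideanSpace ℝ (Fin 2)) 1), m v = T ((0 : EuclideanSpace ℝ (Fin 2)), (1 / 2 : ℝ) • (v : EuclideanSpace ℝ (Fin 2)))) ∧ (∀ (v : (Metric.sphere (0 : EuclideanSpace ℝ (Fin 2)) 1)) (a : E), (a : EuclideanSpace ℝ (Fin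 4)) = m v → ℓ v = j a) ∧ (∃ x₀ : X, (c.comp μ₀).Homotopic (ContinuousMap.const (Metric.sphere (0 : EuclideanSpace ℝ (Fin 2)) 1) x₀)) ∧ ((∃ x₀ : X, (c.comp μ₁).Homotopic (ContinuousMap.const (Metric.sphere (0 : EuclideanSpace ℝ (Fin 2)) 1) x₀)) → ∃ x₀ : X, ℓ.Homotopic (ContinuousMap.const (Metric.sphere (0 : EuclideanSpace ℝ (Fin 2)) 1) x₀)) :=
  Summit.SmoothPoincare4.SmoothPoincare4.Theorems.DcrGap.MkFriends.stub_friendsCarrier_of_collars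
    Literature.Topology.FourManifolds.pictureSurgeryPresentation_holds
    Summit.SmoothPoincare4.SmoothPoincare4.Theorems.DcrGap.MkFriends.helper_friendsCarrier_Tk
    helper_friendsCarrier_Vk

/-- Part B (LANDED) — FUNDAMENTAL GROUP (L; the `k ≥ 1` analogue of the tree's PROVED
`Knot.simplyConnectedSpace_of_isSliceDiscIn_of_range_eq`).  In the complement form of Stub A: if the
pushed meridian `ℓ = j ∘ m` of the exterior disc `Δ₁` is null-homotopic in `X`, then `X` is simply
connected.  Van Kampen for `X = N ∪ V`, `N` a thickening of `C = i(D_k) ∪ f₀(𝔻²)` (`≅ D_k ∪ h²`, so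
`π₁(N ∖ C) → π₁(N)` is onto) and `V = X ∖ C = j(E°) ∪ {q}`: `π₁(X)` is a quotient of
`π₁(E°) = π₁((ℝ⁴ ∖ D_k) ∖ Δ₁)`, which is normally generated by the meridian `m` because
`ℝ⁴ ∖ D_k ≃ ♮ᵏ(B² × S²) ∖ pt` is simply connected. (No kernel condition appears here: the composition
feeds the null-homotopy of `ℓ` from (KC).)  v2: the tube `T` of `Δ₁°` is a hypothesis and `m` is the
tube meridian `T(0, v/2)`, so the meridian step is the tree's Kervaire lemma
`homotopic_refl_map_of_meridian` ported from `B̊⁴` to `ℝ⁴ ∖ D_k` (sub-goals: G1 `ℝ⁴ ∖ D_k` simply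
connected, G2 that port, G3 loops of `X ∖ C` generate).  v4 STATUS: LANDED (p144908) =
`helper_friendsPi1_of_G123 helper_friendsPi1_G1 helper_friendsPi1_G2 helper_friendsPi1_G3` (G1 p140512, G2
p144192 + aux p143513, G3 p143687 + aux p142214 p143190 p143197, assembly p144112 p142245 p140307).
[cite: ManolescuPiccirillo2023, §3.2, proof of Lemma 3.3]
[cite: HatcherAT2002, Thm. 1.20 and Prop. 1.26] -/
theorem friendsPi1 : ∀ (k : ℕ) (K₀ K₁ : (Metric.sphere (0 : EuclideanSpace ℝ (Fin 2)) 1) → EuclideanSpace ℝ (Fin 4)) (f₁ : EuclideanSpace ℝ (Fin 2) → EuclideanSpace ℝ (Fin 4)) (T : EuclideanSpace ℝ (Fin 2) × EuclideanSpace ℝ (Fin 2) → EuclideanSpace ℝ (Fin 4)), Literature.Topology.FourManifolds.MMSW.IsModelKnot k K₀ → Literature.Topology.FourManifolds.MMSW.IsModelKnot k K₁ → Literature.Topology.FourManifolds.MMSW.IsModelSliceDisc k K₁ f₁ → (ContDiffOn ℝ ((⊤ : ℕ∞) : WithTop ℕ∞) T (Metric.ball (0 : EuclideanSpace ℝ (Fin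 2)) 1 ×ˢ Metric.ball (0 : EuclideanSpace ℝ (Fin 2)) 2) ∧ Set.InjOn T (Metric.ball (0 : EuclideanSpace ℝ (Fin 2)) 1 ×ˢ Metric.ball (0 : EuclideanSpace ℝ (Fin 2)) 2) ∧ (∀ q ∈ Metric.ball (0 : EuclideanSpace ℝ (Fin 2)) 1 ×ˢ Metric.ball (0 : EuclideanSpace ℝ (Fin 2)) 2, Function.Injective (fderiv ℝ T q)) ∧ (∀ q ∈ Metric.ball (0 : EuclideanSpace ℝ (Fin 2)) 1 ×ˢ Metric.ball (0 : EuclideanSpace ℝ (Fin 2)) 2, T q ∉ Literature.Topology.FourManifolds.MMSW.modelHandlebody k) ∧ (∀ x ∈ Metric.ball (0 : EuclideanSpace ℝ (Fin 2)) 1, T (x, 0) = f₁ x)) → ∀ (X : Type) [TopologicalSpace X] [T2Space X] [SecondCountableTopology X] [ChartedSpace (EuclideanSpace ℝ (Fin 4)) X] [IsManifold (𝓡 4) ((⊤ : ℕ∞) : WithTop ℕ∞) X] [CompactSpace X] (U : Set (EuclideanSpace ℝ (Fin 4))) (i : EuclideanSpace ℝ (Fin 4) → X) (f₀ : EuclideanSpace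 ℝ (Fin 2) → X) (g₀ : EuclideanSpace ℝ (Fin 2) → EuclideanSpace ℝ (Fin 4)) (E : TopologicalSpace.Opens (EuclideanSpace ℝ (Fin 4))) (j : E → X) (q : X) (m : (Metric.sphere (0 : EuclideanSpace ℝ (Fin 2)) 1) → EuclideanSpace ℝ (Fin 4)) (ℓ : C((Metric.sphere (0 : EuclideanSpace ℝ (Fin 2)) 1), X)), (IsOpen U ∧ Literature.Topology.FourManifolds.MMSW.modelHandlebody k ⊆ U ∧ ContMDiffOn (𝓡 4) (𝓡 4) ((⊤ : ℕ∞) : WithTop ℕ∞) i U ∧ Set.InjOn i U ∧ (∀ x ∈ U, Function.Injective (mfderiv (𝓡 4) (𝓡 4) i x))) → (ContMDiff (𝓡 2) (𝓡 4) ((⊤ : ℕ∞) : WithTop ℕ∞) f₀ ∧ Set.InjOn f₀ (Metric.closedBall (0 : EuclideanSpace ℝ (Fin 2)) 1) ∧ (∀ x ∈ Metric.closedBall (0 : EuclideanSpace ℝ (Fin 2)) 1, Function.Injective (mfderiv (𝓡 2) (𝓡 4) f₀ x)) ∧ (∀ x : EuclideanSpace ℝ (Fin 2), ‖x‖ < 1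 → f₀ x ∉ i '' Literature.Topology.FourManifolds.MMSW.modelHandlebody k) ∧ (∀ t : (Metric.sphere (0 : EuclideanSpace ℝ (Fin 2)) 1), f₀ t = i (K₀ t)) ∧ ContDiff ℝ ((⊤ : ℕ∞) : WithTop ℕ∞) g₀ ∧ (∃ η : ℝ, 0 < η ∧ (∀ x : EuclideanSpace ℝ (Fin 2), 1 - η < ‖x‖ → ‖x‖ ≤ 1 → g₀ x ∈ U ∧ f₀ x = i (g₀ x))) ∧ (∀ t : (Metric.sphere (0 : EuclideanSpace ℝ (Fin 2)) 1), deriv (fun ρ : ℝ => Literature.Topology.FourManifolds.MMSW.levelFun k (g₀ (ρ • (t : EuclideanSpace ℝ (Fin 2))))) 1 < 0)) → (((E : Set (EuclideanSpace ℝ (Fin 4))) = {x | x ∉ Literature.Topology.FourManifolds.MMSW.modelHandlebody k ∧ x ∉ f₁ '' Metric.closedBall (0 : EuclideanSpace ℝ (Fin 2)) 1}) ∧ Manifold.IsSmoothEmbedding (𝓡 4) (𝓡 4) ((⊤ : ℕ∞) : WithTop ℕ∞) j ∧ IsOpen (Set.range j) ∧ Set.range j = (i '' Literature.Topology.FourManifolds.MMSW.modelHandlebody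 k ∪ f₀ '' Metric.closedBall (0 : EuclideanSpace ℝ (Fin 2)) 1 ∪ {q})ᶜ ∧ (∀ s ∈ nhds q, ∃ R : ℝ, ∀ a : E, R < ‖(a : EuclideanSpace ℝ (Fin 4))‖ → j a ∈ s)) → (∀ v : (Metric.sphere (0 : EuclideanSpace ℝ (Fin 2)) 1), m v = T ((0 : EuclideanSpace ℝ (Fin 2)), (1 / 2 : ℝ) • (v : EuclideanSpace ℝ (Fin 2)))) → (∀ (v : (Metric.sphere (0 : EuclideanSpace ℝ (Fin 2)) 1)) (a : E), (a : EuclideanSpace ℝ (Fin 4)) = m v → ℓ v = j a) → (∃ x₀ : X, ℓ.Homotopic (ContinuousMap.const (Metric.sphere (0 : EuclideanSpace ℝ (Fin 2)) 1) x₀)) → SimplyConnectedSpace X :=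
  Summit.SmoothPoincare4.SmoothPoincare4.Theorems.DcrGap.MkFriends.stub_friendsPi1

/-- Part C (LANDED) — SECOND HOMOLOGY (L; the `k ≥ 1` analogue of the tree's PROVED
`Knot.isZero_singularHomologyZ_two_of_isSliceDiscIn_of_range_eq`).  In the complement form of Stub A,
with both knots null-homologous and `X` simply connected: `H₂(X; ℤ) = 0`.  Mayer–Vietoris for
`X = N ∪ V` as in Stub B: `H₂(N ∖ C) ≅ H₂(M_k(K₀;0)) ≅ ℤᵏ⁺¹ → H₂(N) ⊕ H₂(V) ≅ ℤ ⊕ ℤᵏ` is injective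
(`H₃(X) ≅ H¹(X) = 0`), so its cokernel is finite; `H₁(N ∖ C) ≅ ℤᵏ⁺¹ → H₁(N) ⊕ H₁(V) ≅ ℤᵏ ⊕ ℤ` is onto
(`H₁(X) = 0`) hence an isomorphism, so `H₂(X)` is that finite cokernel; and `H₂(X)` is free
(Poincaré duality + universal coefficients, `H₁ = 0`), hence zero.  (`H₂(V) ≅ H₂(W₀ ∖ νΔ₁) ≅ ℤᵏ` and
`H₁(V) ≅ ℤ` use `[K₁] = 0`: the core spheres meet `Δ₁` algebraically zero times, MMSW Rem. 8.15.)
v2 STATUS: LANDED (p138969) — by an Euler-characteristic count over ℚ (LES of `(X, j(E))`, relative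
Mayer–Vietoris in `X` and in `S⁴`; `b₂ = 0`, `H₂` free), using neither null-homology hypothesis.
[cite: ManolescuPiccirillo2023, §3.2, proof of Lemma 3.3] [cite: HatcherAT2002, Thm. 3.30] -/
theorem friendsH2 : ∀ (k : ℕ) (K₀ K₁ : (Metric.sphere (0 : EuclideanSpace ℝ (Fin 2)) 1) → EuclideanSpace ℝ (Fin 4)) (f₁ : EuclideanSpace ℝ (Fin 2) → EuclideanSpace ℝ (Fin 4)), Literature.Topology.FourManifolds.MMSW.IsModelKnot k K₀ → Literature.Topology.FourManifolds.MMSW.IsNullHomologous k K₀ → Literature.Topology.FourManifolds.MMSW.IsModelKnot k K₁ → Literature.Topology.FourManifolds.MMSW.IsNullHomologous k K₁ → Literature.Topology.FourManifolds.MMSW.IsModelSliceDisc k K₁ f₁ → ∀ (X : Type) [TopologicalSpace X] [T2Space X] [SecondCountableTopology X] [ChartedSpace (EuclideanSpace ℝ (Fin 4)) X] [IsManifold (𝓡 4) ((⊤ : ℕ∞) : WithTop ℕ∞) X] [CompactSpace X] (U : Set (EuclideanSpace ℝ (Fin 4))) (i : EuclideanSpace ℝ (Fin 4) → X) (f₀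 : EuclideanSpace ℝ (Fin 2) → X) (g₀ : EuclideanSpace ℝ (Fin 2) → EuclideanSpace ℝ (Fin 4)) (E : TopologicalSpace.Opens (EuclideanSpace ℝ (Fin 4))) (j : E → X) (q : X), (IsOpen U ∧ Literature.Topology.FourManifolds.MMSW.modelHandlebody k ⊆ U ∧ ContMDiffOn (𝓡 4) (𝓡 4) ((⊤ : ℕ∞) : WithTop ℕ∞) i U ∧ Set.InjOn i U ∧ (∀ x ∈ U, Function.Injective (mfderiv (𝓡 4) (𝓡 4) i x))) → (ContMDiff (𝓡 2) (𝓡 4) ((⊤ : ℕ∞) : WithTop ℕ∞) f₀ ∧ Set.InjOn f₀ (Metric.closedBall (0 : EuclideanSpace ℝ (Fin 2)) 1) ∧ (∀ x ∈ Metric.closedBall (0 : EuclideanSpace ℝ (Fin 2)) 1, Function.Injective (mfderiv (𝓡 2) (𝓡 4) f₀ x)) ∧ (∀ x : EuclideanSpace ℝ (Fin 2), ‖x‖ < 1 → f₀ x ∉ i '' Literature.Topology.FourManifolds.MMSW.modelHandlebody k) ∧ (∀ t : (Metric.sphere (0 : EuclideanSpace ℝ (Fin 2)) 1), f₀ t =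 i (K₀ t)) ∧ ContDiff ℝ ((⊤ : ℕ∞) : WithTop ℕ∞) g₀ ∧ (∃ η : ℝ, 0 < η ∧ (∀ x : EuclideanSpace ℝ (Fin 2), 1 - η < ‖x‖ → ‖x‖ ≤ 1 → g₀ x ∈ U ∧ f₀ x = i (g₀ x))) ∧ (∀ t : (Metric.sphere (0 : EuclideanSpace ℝ (Fin 2)) 1), deriv (fun ρ : ℝ => Literature.Topology.FourManifolds.MMSW.levelFun k (g₀ (ρ • (t : EuclideanSpace ℝ (Fin 2))))) 1 < 0)) → (((E : Set (EuclideanSpace ℝ (Fin 4))) = {x | x ∉ Literature.Topology.FourManifolds.MMSW.modelHandlebody k ∧ x ∉ f₁ '' Metric.closedBall (0 : EuclideanSpace ℝ (Fin 2)) 1}) ∧ Manifold.IsSmoothEmbedding (𝓡 4) (𝓡 4) ((⊤ : ℕ∞) : WithTop ℕ∞) j ∧ IsOpen (Set.range j) ∧ Set.range j = (i '' Literature.Topology.FourManifolds.MMSW.modelHandlebody k ∪ f₀ '' Metric.closedBall (0 : EuclideanSpace ℝ (Fin 2)) 1 ∪ {q})ᶜ ∧ (∀ s ∈ nhds q, ∃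 R : ℝ, ∀ a : E, R < ‖(a : EuclideanSpace ℝ (Fin 4))‖ → j a ∈ s)) → SimplyConnectedSpace X → CategoryTheory.Limits.IsZero (Literature.Topology.FourManifolds.singularHomologyZ X 2) :=
  Summit.SmoothPoincare4.SmoothPoincare4.Theorems.DcrGap.MkFriends.stub_friendsH2

/-- Part D (v7: DERIVED, no longer a stub) — HANDLEBODY GERM CHARTS ARE STANDARD UP TO SECTOR (L–XL; new; the price of dropping
(MC)).  In a simply connected smooth `4`-manifold `X`, every germ chart `i` of the model dotted
handlebody `D_k` (a smooth embedding of an open `U ⊇ D_k`) extends, after precomposition with a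
product of per-handle sphere twists `τ^ε = fibreRot (Π_j u_j^{ε_j})`, `u_j(z) = (z - c_j)/|z - c_j|`,
`ε ∈ ℤᵏ`, to a GLOBAL chart: a smooth embedding `e : ℝ⁴ → X` with `e ∘ τ^ε = i` on `D_k`.  Proof
sketch: embeddings of the spine `∨ᵏ S¹` into `X` are all isotopic (`π₁(X) = 1`, homotopy implies
isotopy for `1`-complexes in dimension `4`), `0`-handles are isotopic after fixing the orientation
(Palais–Cerf disc theorem; the model mirror `ρ` preserves `D_k`), and thickenings of an embedded arc
rel endpoints are classified by `π₁(SO(3)) = ℤ/2`, realised in the model by `τ_j` (one full turn of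
the `w`-plane along the `j`-th handle); compose with a reference chart `e₁ : ℝ⁴ ↪ X` and isotopy
extension.  Equivalently: the meridians `x_j` of the dotted circles bound disjoint framed discs in
`X ∖ i(D_k)°` exactly in the sectors `ε` (discs bounded by `x_j` in `B² × S²` have even
self-intersection).  v2: `[CompactSpace X]` added (supplied by A; the tree's isotopy extension needs
it); the `k = 0` instance is LANDED as `helper_handlebodyChart_zero` (p135641); missing for `k ≥ 1`:
uniqueness of `1`-handles up to the `ℤ/2` fibre twist, ambient isotopy of arcs rel ends, handle
structure of the model (`work/stubs/HandlebodyChart.blocked.md`).  v4 STATUS: closed MODULO {named facts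
`Literature.Topology.FourManifolds.oneHandle_ambientIsotopic_upToTwist` (M1),
`Literature.Topology.FourManifolds.arcs_ambientIsotopic_rel_of_homotopicRel` (M2) (both filed p143168,
`Literature/Topology/FourManifolds/OneHandleUniqueness.lean`), registered helper stub
`helper_handlebodyChart_modelHandles_data` (the explicit handle data of the model; M3 from it is LANDED:
`helper_handlebodyChart_modelHandles_of_data`, p149320 + 6 aux)} by the LANDED reduction
`Theorems.DcrGap.MkFriends.helper_handlebodyChart_of_facts2 hM1 hM2 hM3` (p144219); see `dcrRasmussenWitness_of_debts`.
[cite: Palais1960, Thm. B] [cite: GompfStipsicz1999, §4.4 and §5.4] -/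
theorem handlebodyChart_of_parts : ∀ (k : ℕ) (X : Type) [TopologicalSpace X] [T2Space X] [SecondCountableTopology X] [ChartedSpace (EuclideanSpace ℝ (Fin 4)) X] [IsManifold (𝓡 4) ((⊤ : ℕ∞) : WithTop ℕ∞) X] [CompactSpace X], SimplyConnectedSpace X → ∀ (U : Set (EuclideanSpace ℝ (Fin 4))) (i : EuclideanSpace ℝ (Fin 4) → X), (IsOpen U ∧ Literature.Topology.FourManifolds.MMSW.modelHandlebody k ⊆ U ∧ ContMDiffOn (𝓡 4) (𝓡 4) ((⊤ : ℕ∞) : WithTop ℕ∞) i U ∧ Set.InjOn i U ∧ (∀ x ∈ U, Function.Injective (mfderiv (𝓡 4) (𝓡 4) i x))) → ∃ (ε : Fin k → ℤ) (e : EuclideanSpace ℝ (Fin 4) → X), Manifold.IsSmoothEmbedding (𝓡 4) (𝓡 4) ((⊤ : ℕ∞) : WithTop ℕ∞) e ∧ ∀ x ∈ Literature.Topology.FourManifolds.MMSW.modelHandlebody k, e (Literature.Topology.FourManifolds.MMSW.fibreRot (fun z : ℂ => ∏ j : Fin k, ((z - Literature.Topology.FourManifolds.MMSW.holeCentre k j)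 / (((‖z - Literature.Topology.FourManifolds.MMSW.holeCentre k j‖ : ℝ)) : ℂ)) ^ (ε j)) x) = i x :=
  Summit.SmoothPoincare4.SmoothPoincare4.Theorems.DcrGap.MkFriends.helper_handlebodyChart_of_facts2
    Literature.Topology.FourManifolds.oneHandle_ambientIsotopic_upToTwist_holds
    Literature.Topology.FourManifolds.arcs_ambientIsotopic_rel_of_homotopicRel_holds
    (Summit.SmoothPoincare4.SmoothPoincare4.Theorems.DcrGap.MkFriends.helper_handlebodyChart_modelHandles_of_data
      helper_handlebodyChart_modelHandles_data)

/-! ### (Stub E — per-handle sector blindness — DROPPED in v5 per the planner's route-choice directive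
(2026-08-17T04:18Z): the multi-index fact `eventually_approxHasRasmussen_multiIndex` is cited, never
promoted; its role is absorbed by the SECTOR-SATURATED certificate of stub G.  The landed reduction
`Theorems.DcrGap.MkFriends.stub_sectorBlindPerHandle_of_multiIndex` (p135840) stays in the tree.) -/

/-- Part F (v7: DERIVED from the literal fact `stub_mmsw819`) — THE GFGMW WINDOW in the literal `S⁴` (the BODY of the route's support item `DcrGfgmw`,
stmt-SmoothPoincare4-16153, word for word; Literature debt = MMSW Lemma 8.19, via the LANDED
`Theorems.DcrGfgmw_of_mmsw819`): a model knot sliced in `S⁴ ∖ e'(D_k)` has `s₋ ≤ 0 ≤ s₊`.  Stated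
unfolded (not as the item's name) so that no sorried theorem carries an item's name as its type.
v2 STATUS: closed MODULO the named fact `MMSW.sMinus_nonpos_of_isModelSliceDisc` (Literature debt,
no claim; needs Khovanov–Lee homology of `#ʳ(S¹×S²)` with cobordism maps): the stub is
`fun k K e' f' h w => Theorems.DcrGfgmw_of_mmsw819 h19 k K e' f' h w`; `DcrGfgmw_iff_mmsw819` shows
nothing weaker suffices. [cite: ManolescuMarengonSarkarWillis2023, Lemma 8.19] [cite: Palais1960, Thm. B] -/
theorem gfgmwWindow_of_mmsw819 : ∀ (k : ℕ) (K : (Metric.sphere (0 : EuclideanSpace ℝ (Fin 2)) 1) → EuclideanSpace ℝ (Fin 4)) (e' : EuclideanSpace ℝ (Fin 4) → (Metric.sphere (0 : EuclideanSpace ℝ (Fin 5)) 1)) (f' : EuclideanSpace ℝ (Fin 2) → (Metric.sphere (0 : EuclideanSpace ℝ (Fin 5)) 1)), Literature.Topology.FourManifolds.MMSW.IsSliceDiscInComplement k K (Metric.sphere (0 : EuclideanSpace ℝ (Fin 5)) 1) e' f' → ∀ w : Literature.Topology.FourManifolds.MMSWRasmussen k K, w.sMinus ≤ 0 ∧ 0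 ≤ w.sPlus :=
  Summit.SmoothPoincare4.SmoothPoincare4.Theorems.DcrGfgmw_of_mmsw819 stub_mmsw819


/-! ## The per-handle twist `τ^ε` (helper lemmas for the composition; not registered) -/

/-- The per-handle unit multiplier `Π_j ((z - c_j)/|z - c_j|)^{ε_j}`. -/
def handleMult (k : ℕ) (ε : Fin k → ℤ) (z : ℂ) : ℂ :=
  ∏ j : Fin k, ((z - holeCentre k j) / (((‖z - holeCentre k j‖ : ℝ)) : ℂ)) ^ (ε j)

/-- The per-handle twist `τ^ε = fibreRot (handleMult k ε)`; literally the map in Stubs D, E. -/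
theorem fibreRot_handleMult_eq (k : ℕ) (ε : Fin k → ℤ) :
    fibreRot (handleMult k ε) =
      fibreRot (fun z : ℂ => ∏ j : Fin k, ((z - holeCentre k j) /
        (((‖z - holeCentre k j‖ : ℝ)) : ℂ)) ^ (ε j)) := rfl

/-- Each factor `(z - c_j)/|z - c_j|` is a unit complex number off the hole centre. [folklore] -/
theorem norm_unitFactor {k : ℕ} {z : ℂ} {j : Fin k} (hz : z ≠ holeCentre k j) :
    ‖(z - holeCentre k j) / (((‖z - holeCentre k j‖ : ℝ)) : ℂ)‖ = 1 := by
  have h : ‖z - holeCentre k j‖ ≠ 0 := norm_ne_zero_iff.2 (sub_ne_zero.2 hz)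
  rw [norm_div, Complex.norm_real, Real.norm_eq_abs, abs_of_nonneg (norm_nonneg _), div_self h]

/-- The multiplier is a unit complex number off the hole centres. [folklore] -/
theorem norm_handleMult {k : ℕ} (ε : Fin k → ℤ) {z : ℂ} (hz : ∀ j : Fin k, z ≠ holeCentre k j) :
    ‖handleMult k ε z‖ = 1 := by
  rw [handleMult, norm_prod]
  refine Finset.prod_eq_one fun j _ => ?_
  rw [norm_zpow, norm_unitFactor (hz j), one_zpow]

/-- The multiplier is nonzero off the hole centres. [folklore] -/
theorem handleMult_ne_zero {k : ℕ} (ε : Fin k → ℤ) {z : ℂ} (hz : ∀ j : Fin k, z ≠ holeCentre k j) :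
    handleMult k ε z ≠ 0 :=
  norm_ne_zero_iff.1 (by rw [norm_handleMult ε hz]; exact one_ne_zero)

/-- `τ^{-ε}` after `τ^{ε}` multiplies by `1`. [folklore] -/
theorem handleMult_mul_handleMult_neg {k : ℕ} (ε : Fin k → ℤ) {z : ℂ}
    (hz : ∀ j : Fin k, z ≠ holeCentre k j) :
    handleMult k ε z * handleMult k (fun j => -ε j) z = 1 := by
  rw [handleMult, handleMult, ← Finset.prod_mul_distrib]
  refine Finset.prod_eq_one fun j _ => ?_
  have hne : (z - holeCentre k j) / (((‖z - holeCentre k j‖ : ℝ)) : ℂ) ≠ 0 :=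
    norm_ne_zero_iff.1 (by rw [norm_unitFactor (hz j)]; exact one_ne_zero)
  rw [zpow_neg, mul_inv_cancel₀ (zpow_ne_zero _ hne)]

/-- The per-handle twist maps the model handlebody `D_k` into itself. [folklore] -/
theorem twist_mem_modelHandlebody {k : ℕ} (ε : Fin k → ℤ) {x : 𝔼 4} (hx : x ∈ modelHandlebody k) :
    fibreRot (handleMult k ε) x ∈ modelHandlebody k := by
  have hz := zC_ne_holeCentre hx.1
  refine ⟨fun j => ?_, ?_⟩
  · rw [holeTerm_fibreRot]; exact hx.1 j
  · rw [levelFun_fibreRot (norm_handleMult ε hz)]; exact hx.2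

/-- `τ^{-ε} ∘ τ^{ε} = id` on the model handlebody. [folklore] -/
theorem twist_neg_twist {k : ℕ} (ε : Fin k → ℤ) {x : 𝔼 4} (hx : x ∈ modelHandlebody k) :
    fibreRot (handleMult k (fun j => -ε j)) (fibreRot (handleMult k ε) x) = x := by
  rw [fibreRot_fibreRot]
  exact fibreRot_of_apply_eq_one (handleMult_mul_handleMult_neg ε (zC_ne_holeCentre hx.1))

/-- `τ^{ε} ∘ τ^{-ε} = id` on the model handlebody. [folklore] -/
theorem twist_twist_neg {k : ℕ} (ε : Fin k → ℤ) {x : 𝔼 4} (hx : x ∈ modelHandlebody k) :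
    fibreRot (handleMult k ε) (fibreRot (handleMult k (fun j => -ε j)) x) = x := by
  have h := twist_neg_twist (fun j => -ε j) hx
  simpa only [neg_neg] using h

/-- The per-handle twist maps `D_k` ONTO itself. [folklore] -/
theorem image_twist_modelHandlebody {k : ℕ} (ε : Fin k → ℤ) :
    fibreRot (handleMult k ε) '' modelHandlebody k = modelHandlebody k := by
  refine Subset.antisymm ?_ fun y hy => ?_
  · rintro _ ⟨x, hx, rfl⟩
    exact twist_mem_modelHandlebody ε hx
  · exact ⟨_, twist_mem_modelHandlebody (fun j => -ε j) hy, twist_twist_neg ε hy⟩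

/-- CONSISTENCY CHECK for Stub E: its diagonal case `ε = (c, …, c)` is the LANDED `stub_sectorBlind`
(p130670) — `Π_j u_j^c = u^c`, so `τ^{(c,…,c)} = σ^c`. [cite: ManolescuMarengonSarkarWillis2023, Thm. 2.8] -/
theorem sectorBlindPerHandle_diag (r : ℕ) (K : 𝕊 1 → 𝔼 4) (c s : ℤ)
    (hK : ∀ t, K t ∈ modelBoundary r) :
    (HasSMinus r (fibreRot (handleMult r (fun _ => c)) ∘ K) s ↔ HasSMinus r K s) ∧
    (HasSPlus r (fibreRot (handleMult r (fun _ => c)) ∘ K) s ↔ HasSPlus r K s) := by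
  have h : fibreRot (handleMult r (fun _ => c)) = sphereTwist r c := by
    rw [sphereTwist_eq_fibreRot]
    congr 1
    funext z
    rw [handleMult, Finset.prod_zpow]
    rfl
  rw [h]
  exact Summit.SmoothPoincare4.SmoothPoincare4.Theorems.DcrGap.Sketch.stub_sectorBlind r K c s hK

/-! ## The composition (sorry-free; concludes the crux BY NAME) -/

/-- **A Rasmussen witness from the parts** (sorry-free; stubs as hypotheses).  From the friends
datum (G): the carrier (A); the kernel condition applied to `Z := X`, `g := c` turns "μ₀ bounds the
cocore" into "the pushed meridian of `Δ₁` is null-homotopic", so `X` is simply connected (B), has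
`H₂ = 0` (C), hence is a homotopy `4`-sphere (tree: `nonempty_homotopyEquiv_sphere_four_iff_holds`,
PROVED); the germ chart becomes a global chart for the sector-twisted knot `τ^ε ∘ K₀` (D), and the
SECTOR-SATURATED certificate of (G) is read in that sector (v5; formerly stub E): a `DcrRasmussenWitness` — the route's ENGINE crux (item 16151) for
the knot `τ^ε ∘ K₀`. [cite: ManolescuPiccirillo2023, Lemma 3.3]
[cite: ManolescuMarengonSarkarWillis2023, Thm. 2.8] -/
theorem dcrRasmussenWitness_of_parts :
    (∀ (k : ℕ) (K₀ K₁ : (Metric.sphere (0 : EuclideanSpace ℝ (Fin 2)) 1) → EuclideanSpace ℝ (Fin 4)) (f₁ : EuclideanSpace ℝ (Fin 2) → EuclideanSpace ℝ (Fin 4)) (T : EuclideanSpace ℝ (Fin 2) × EuclideanSpace ℝ (Fin 2) → EuclideanSpace ℝ (Fin 4)), Literature.Topology.FourManifolds.MMSW.IsModelKnot k K₀ → (∀ t, Literature.AlgebraicTopology.Homotopy.HopfFibration.wC (K₀ t) ≠ 0) → Literature.Topology.FourManifolds.MMSW.IsModelKnot k K₁ → Literature.Topology.FourManifolds.MMSW.IsNullHomologous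 k K₁ → (∀ t, Literature.AlgebraicTopology.Homotopy.HopfFibration.wC (K₁ t) ≠ 0) → Literature.Topology.FourManifolds.MMSW.IsModelSliceDisc k K₁ f₁ → (∀ t : (Metric.sphere (0 : EuclideanSpace ℝ (Fin 2)) 1), deriv (fun ρ : ℝ => Literature.Topology.FourManifolds.MMSW.levelFun k (f₁ (ρ • (t : EuclideanSpace ℝ (Fin 2))))) 1 < 0) → (ContDiffOn ℝ ((⊤ : ℕ∞) : WithTop ℕ∞) T (Metric.ball (0 : EuclideanSpace ℝ (Fin 2)) 1 ×ˢ Metric.ball (0 : EuclideanSpace ℝ (Fin 2)) 2) ∧ Set.InjOn T (Metric.ball (0 : EuclideanSpace ℝ (Fin 2)) 1 ×ˢ Metric.ball (0 : EuclideanSpace ℝ (Fin 2)) 2) ∧ (∀ q ∈ Metric.ball (0 : EuclideanSpace ℝ (Fin 2)) 1 ×ˢ Metric.ball (0 : EuclideanSpace ℝ (Fin 2)) 2, Function.Injective (fderiv ℝ T q)) ∧ (∀ q ∈ Metric.ball (0 : EuclideanSpace ℝ (Fin 2)) 1 ×ˢ Metric.ball (0 : EuclideanSpace ℝ (Fin 2))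 2, T q ∉ Literature.Topology.FourManifolds.MMSW.modelHandlebody k) ∧ (∀ x ∈ Metric.ball (0 : EuclideanSpace ℝ (Fin 2)) 1, T (x, 0) = f₁ x)) → ∀ (L₀ L₁ : Literature.Topology.FourManifolds.FramedLink (Fin (k + 1))), ((∀ j : Fin k, ⇑(L₀.component j.castSucc) = fun θ : (Metric.sphere (0 : EuclideanSpace ℝ (Fin 2)) 1) => Literature.Topology.FourManifolds.MMSW.toSphereThree ((4 * (((j : ℕ) : ℝ) + 1) + Literature.Topology.FourManifolds.MMSW.drawRadius k) * (θ : EuclideanSpace ℝ (Fin 2)) 0, (4 * (((j : ℕ) : ℝ) + 1) + Literature.Topology.FourManifolds.MMSW.drawRadius k) * (θ : EuclideanSpace ℝ (Fin 2)) 1) 0) ∧ ⇑(L₀.component (Fin.last k)) = Literature.Topology.FourManifolds.MMSW.finiteApprox k 0 K₀ ∧ (∀ i, L₀.framing i = 0)) → ((∀ j : Fin k, ⇑(L₁.component j.castSucc) = fun θ : (Metric.sphere (0 : EuclideanSpace ℝ (Fin 2)) 1) => Literature.Topology.FourManifolds.MMSW.toSphereThree ((4 * (((j : ℕ) : ℝ)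 + 1) + Literature.Topology.FourManifolds.MMSW.drawRadius k) * (θ : EuclideanSpace ℝ (Fin 2)) 0, (4 * (((j : ℕ) : ℝ) + 1) + Literature.Topology.FourManifolds.MMSW.drawRadius k) * (θ : EuclideanSpace ℝ (Fin 2)) 1) 0) ∧ ⇑(L₁.component (Fin.last k)) = Literature.Topology.FourManifolds.MMSW.finiteApprox k 0 K₁ ∧ (∀ i, L₁.framing i = 0)) → ∀ (Y : Type) [TopologicalSpace Y] [T2Space Y] [SecondCountableTopology Y] [ChartedSpace (EuclideanSpace ℝ (Fin 3)) Y] [IsManifold (𝓡 3) ((⊤ : ℕ∞) : WithTop ℕ∞) Y] (jA₀ : L₀.toLink.complement → Y) (jB₀ : Fin (k + 1) → Literature.Topology.FourManifolds.solidTorus → Y) (jA₁ : L₁.toLink.complement → Y) (jB₁ : Fin (k + 1) → Literature.Topology.FourManifolds.solidTorus → Y) (μ₀ μ₁ : C((Metric.sphere (0 : EuclideanSpace ℝ (Fin 2)) 1), Y)), (∃ ν : ∀ i, Literature.Topology.FourManifolds.Knot.TubularNbhd (L₀.component i), (∀ i, (ν i).HasFraming (L₀.framing i)) ∧ (Pairwise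 fun i i' => Disjoint (Set.range (ν i)) (Set.range (ν i'))) ∧ Manifold.IsSmoothEmbedding (𝓡 3) (𝓡 3) ((⊤ : ℕ∞) : WithTop ℕ∞) jA₀ ∧ IsOpen (Set.range jA₀) ∧ (∀ i, Manifold.IsSmoothEmbedding (𝓘(ℝ, EuclideanSpace ℝ (Fin 2)).prod (𝓡 1)) (𝓡 3) ((⊤ : ℕ∞) : WithTop ℕ∞) (jB₀ i) ∧ IsOpen (Set.range (jB₀ i))) ∧ Set.range jA₀ ∪ (⋃ i, Set.range (jB₀ i)) = Set.univ ∧ (Pairwise fun i i' => Disjoint (Set.range (jB₀ i)) (Set.range (jB₀ i'))) ∧ ∀ i a b, jA₀ a = jB₀ i b ↔ Literature.Topology.FourManifolds.Link.surgeryRel ν i a b) → (∃ ν : ∀ i, Literature.Topology.FourManifolds.Knot.TubularNbhd (L₁.component i), (∀ i, (ν i).HasFraming (L₁.framing i)) ∧ (Pairwise fun i i' => Disjoint (Set.range (ν i)) (Set.range (ν i'))) ∧ Manifold.IsSmoothEmbedding (𝓡 3) (𝓡 3) ((⊤ : ℕ∞) : WithTop ℕ∞) jA₁ ∧ IsOpen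 (Set.range jA₁) ∧ (∀ i, Manifold.IsSmoothEmbedding (𝓘(ℝ, EuclideanSpace ℝ (Fin 2)).prod (𝓡 1)) (𝓡 3) ((⊤ : ℕ∞) : WithTop ℕ∞) (jB₁ i) ∧ IsOpen (Set.range (jB₁ i))) ∧ Set.range jA₁ ∪ (⋃ i, Set.range (jB₁ i)) = Set.univ ∧ (Pairwise fun i i' => Disjoint (Set.range (jB₁ i)) (Set.range (jB₁ i'))) ∧ ∀ i a b, jA₁ a = jB₁ i b ↔ Literature.Topology.FourManifolds.Link.surgeryRel ν i a b) → (∀ (v : (Metric.sphere (0 : EuclideanSpace ℝ (Fin 2)) 1)) (b : Literature.Topology.FourManifolds.solidTorus), (b : EuclideanSpace ℝ (Fin 2) × (Metric.sphere (0 : EuclideanSpace ℝ (Fin 2)) 1)) = ((0 : EuclideanSpace ℝ (Fin 2)), v) → μ₀ v = jB₀ (Fin.last k) b) → (∀ (v : (Metric.sphere (0 : EuclideanSpace ℝ (Fin 2)) 1)) (b : Literature.Topology.FourManifolds.solidTorus), (b : EuclideanSpace ℝ (Fin 2) × (Metric.sphere (0 : EuclideanSpace ℝ (Fin 2)) 1))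 = ((0 : EuclideanSpace ℝ (Fin 2)), v) → μ₁ v = jB₁ (Fin.last k) b) → ∃ (X : Type) (_ : TopologicalSpace X) (_ : T2Space X) (_ : SecondCountableTopology X) (_ : ChartedSpace (EuclideanSpace ℝ (Fin 4)) X) (_ : IsManifold (𝓡 4) ((⊤ : ℕ∞) : WithTop ℕ∞) X) (_ : CompactSpace X) (U : Set (EuclideanSpace ℝ (Fin 4))) (i : EuclideanSpace ℝ (Fin 4) → X) (f₀ : EuclideanSpace ℝ (Fin 2) → X) (g₀ : EuclideanSpace ℝ (Fin 2) → EuclideanSpace ℝ (Fin 4)) (E : TopologicalSpace.Opens (EuclideanSpace ℝ (Fin 4))) (j : E → X) (q : X) (c : C(Y, X)) (m : (Metric.sphere (0 : EuclideanSpace ℝ (Fin 2)) 1) → EuclideanSpace ℝ (Fin 4)) (ℓ : C((Metric.sphere (0 : EuclideanSpace ℝ (Fin 2)) 1), X)), (IsOpen U ∧ Literature.Topology.FourManifolds.MMSW.modelHandlebody k ⊆ U ∧ ContMDiffOn (𝓡 4) (𝓡 4) ((⊤ : ℕ∞) : WithTop ℕ∞) i U ∧ Set.InjOn i U ∧ (∀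 x ∈ U, Function.Injective (mfderiv (𝓡 4) (𝓡 4) i x))) ∧ (ContMDiff (𝓡 2) (𝓡 4) ((⊤ : ℕ∞) : WithTop ℕ∞) f₀ ∧ Set.InjOn f₀ (Metric.closedBall (0 : EuclideanSpace ℝ (Fin 2)) 1) ∧ (∀ x ∈ Metric.closedBall (0 : EuclideanSpace ℝ (Fin 2)) 1, Function.Injective (mfderiv (𝓡 2) (𝓡 4) f₀ x)) ∧ (∀ x : EuclideanSpace ℝ (Fin 2), ‖x‖ < 1 → f₀ x ∉ i '' Literature.Topology.FourManifolds.MMSW.modelHandlebody k) ∧ (∀ t : (Metric.sphere (0 : EuclideanSpace ℝ (Fin 2)) 1), f₀ t = i (K₀ t)) ∧ ContDiff ℝ ((⊤ : ℕ∞) : WithTop ℕ∞) g₀ ∧ (∃ η : ℝ, 0 < η ∧ (∀ x : EuclideanSpace ℝ (Fin 2), 1 - η < ‖x‖ → ‖x‖ ≤ 1 → g₀ x ∈ U ∧ f₀ x = i (g₀ x))) ∧ (∀ t : (Metric.sphere (0 : EuclideanSpace ℝ (Fin 2)) 1), deriv (fun ρ : ℝ => Literature.Topology.FourManifolds.MMSW.levelFun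 k (g₀ (ρ • (t : EuclideanSpace ℝ (Fin 2))))) 1 < 0)) ∧ (((E : Set (EuclideanSpace ℝ (Fin 4))) = {x | x ∉ Literature.Topology.FourManifolds.MMSW.modelHandlebody k ∧ x ∉ f₁ '' Metric.closedBall (0 : EuclideanSpace ℝ (Fin 2)) 1}) ∧ Manifold.IsSmoothEmbedding (𝓡 4) (𝓡 4) ((⊤ : ℕ∞) : WithTop ℕ∞) j ∧ IsOpen (Set.range j) ∧ Set.range j = (i '' Literature.Topology.FourManifolds.MMSW.modelHandlebody k ∪ f₀ '' Metric.closedBall (0 : EuclideanSpace ℝ (Fin 2)) 1 ∪ {q})ᶜ ∧ (∀ s ∈ nhds q, ∃ R : ℝ, ∀ a : E, R < ‖(a : EuclideanSpace ℝ (Fin 4))‖ → j a ∈ s)) ∧ (∀ v : (Metric.sphere (0 : EuclideanSpace ℝ (Fin 2)) 1), m v = T ((0 : EuclideanSpace ℝ (Fin 2)), (1 / 2 : ℝ) • (v : EuclideanSpace ℝ (Fin 2)))) ∧ (∀ (v : (Metric.sphere (0 : EuclideanSpace ℝ (Fin 2)) 1)) (a : E), (a : EuclideanSpace ℝ (Fin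 4)) = m v → ℓ v = j a) ∧ (∃ x₀ : X, (c.comp μ₀).Homotopic (ContinuousMap.const (Metric.sphere (0 : EuclideanSpace ℝ (Fin 2)) 1) x₀)) ∧ ((∃ x₀ : X, (c.comp μ₁).Homotopic (ContinuousMap.const (Metric.sphere (0 : EuclideanSpace ℝ (Fin 2)) 1) x₀)) → ∃ x₀ : X, ℓ.Homotopic (ContinuousMap.const (Metric.sphere (0 : EuclideanSpace ℝ (Fin 2)) 1) x₀))) →
    (∀ (k : ℕ) (K₀ K₁ : (Metric.sphere (0 : EuclideanSpace ℝ (Fin 2)) 1) → EuclideanSpace ℝ (Fin 4)) (f₁ : EuclideanSpace ℝ (Fin 2) → EuclideanSpace ℝ (Fin 4)) (T : EuclideanSpace ℝ (Fin 2) × EuclideanSpace ℝ (Fin 2) → EuclideanSpace ℝ (Fin 4)), Literature.Topology.FourManifolds.MMSW.IsModelKnot k K₀ → Literature.Topology.FourManifolds.MMSW.IsModelKnot k K₁ → Literature.Topology.FourManifolds.MMSW.IsModelSliceDisc k K₁ f₁ → (ContDiffOn ℝ ((⊤ : ℕ∞) : WithTop ℕ∞) T (Metric.ball (0 : EuclideanSpace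 ℝ (Fin 2)) 1 ×ˢ Metric.ball (0 : EuclideanSpace ℝ (Fin 2)) 2) ∧ Set.InjOn T (Metric.ball (0 : EuclideanSpace ℝ (Fin 2)) 1 ×ˢ Metric.ball (0 : EuclideanSpace ℝ (Fin 2)) 2) ∧ (∀ q ∈ Metric.ball (0 : EuclideanSpace ℝ (Fin 2)) 1 ×ˢ Metric.ball (0 : EuclideanSpace ℝ (Fin 2)) 2, Function.Injective (fderiv ℝ T q)) ∧ (∀ q ∈ Metric.ball (0 : EuclideanSpace ℝ (Fin 2)) 1 ×ˢ Metric.ball (0 : EuclideanSpace ℝ (Fin 2)) 2, T q ∉ Literature.Topology.FourManifolds.MMSW.modelHandlebody k) ∧ (∀ x ∈ Metric.ball (0 : EuclideanSpace ℝ (Fin 2)) 1, T (x, 0) = f₁ x)) → ∀ (X : Type) [TopologicalSpace X] [T2Space X] [SecondCountableTopology X] [ChartedSpace (EuclideanSpace ℝ (Fin 4)) X] [IsManifold (𝓡 4) ((⊤ : ℕ∞) : WithTop ℕ∞) X] [CompactSpace X] (U : Set (EuclideanSpace ℝ (Fin 4))) (i : EuclideanSpace ℝ (Fin 4) → X) (f₀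 : EuclideanSpace ℝ (Fin 2) → X) (g₀ : EuclideanSpace ℝ (Fin 2) → EuclideanSpace ℝ (Fin 4)) (E : TopologicalSpace.Opens (EuclideanSpace ℝ (Fin 4))) (j : E → X) (q : X) (m : (Metric.sphere (0 : EuclideanSpace ℝ (Fin 2)) 1) → EuclideanSpace ℝ (Fin 4)) (ℓ : C((Metric.sphere (0 : EuclideanSpace ℝ (Fin 2)) 1), X)), (IsOpen U ∧ Literature.Topology.FourManifolds.MMSW.modelHandlebody k ⊆ U ∧ ContMDiffOn (𝓡 4) (𝓡 4) ((⊤ : ℕ∞) : WithTop ℕ∞) i U ∧ Set.InjOn i U ∧ (∀ x ∈ U, Function.Injective (mfderiv (𝓡 4) (𝓡 4) i x))) → (ContMDiff (𝓡 2) (𝓡 4) ((⊤ : ℕ∞) : WithTop ℕ∞) f₀ ∧ Set.InjOn f₀ (Metric.closedBall (0 : EuclideanSpace ℝ (Fin 2)) 1) ∧ (∀ x ∈ Metric.closedBall (0 : EuclideanSpace ℝ (Fin 2)) 1, Function.Injective (mfderiv (𝓡 2) (𝓡 4) f₀ x)) ∧ (∀ x : EuclideanSpace ℝ (Fin 2),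 ‖x‖ < 1 → f₀ x ∉ i '' Literature.Topology.FourManifolds.MMSW.modelHandlebody k) ∧ (∀ t : (Metric.sphere (0 : EuclideanSpace ℝ (Fin 2)) 1), f₀ t = i (K₀ t)) ∧ ContDiff ℝ ((⊤ : ℕ∞) : WithTop ℕ∞) g₀ ∧ (∃ η : ℝ, 0 < η ∧ (∀ x : EuclideanSpace ℝ (Fin 2), 1 - η < ‖x‖ → ‖x‖ ≤ 1 → g₀ x ∈ U ∧ f₀ x = i (g₀ x))) ∧ (∀ t : (Metric.sphere (0 : EuclideanSpace ℝ (Fin 2)) 1), deriv (fun ρ : ℝ => Literature.Topology.FourManifolds.MMSW.levelFun k (g₀ (ρ • (t : EuclideanSpace ℝ (Fin 2))))) 1 < 0)) → (((E : Set (EuclideanSpace ℝ (Fin 4))) = {x | x ∉ Literature.Topology.FourManifolds.MMSW.modelHandlebody k ∧ x ∉ f₁ '' Metric.closedBall (0 : EuclideanSpace ℝ (Fin 2)) 1}) ∧ Manifold.IsSmoothEmbedding (𝓡 4) (𝓡 4) ((⊤ : ℕ∞) : WithTop ℕ∞) j ∧ IsOpen (Set.range j) ∧ Set.range j = (i ''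 Literature.Topology.FourManifolds.MMSW.modelHandlebody k ∪ f₀ '' Metric.closedBall (0 : EuclideanSpace ℝ (Fin 2)) 1 ∪ {q})ᶜ ∧ (∀ s ∈ nhds q, ∃ R : ℝ, ∀ a : E, R < ‖(a : EuclideanSpace ℝ (Fin 4))‖ → j a ∈ s)) → (∀ v : (Metric.sphere (0 : EuclideanSpace ℝ (Fin 2)) 1), m v = T ((0 : EuclideanSpace ℝ (Fin 2)), (1 / 2 : ℝ) • (v : EuclideanSpace ℝ (Fin 2)))) → (∀ (v : (Metric.sphere (0 : EuclideanSpace ℝ (Fin 2)) 1)) (a : E), (a : EuclideanSpace ℝ (Fin 4)) = m v → ℓ v = j a) → (∃ x₀ : X, ℓ.Homotopic (ContinuousMap.const (Metric.sphere (0 : EuclideanSpace ℝ (Fin 2)) 1) x₀)) → SimplyConnectedSpace X) →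
    (∀ (k : ℕ) (K₀ K₁ : (Metric.sphere (0 : EuclideanSpace ℝ (Fin 2)) 1) → EuclideanSpace ℝ (Fin 4)) (f₁ : EuclideanSpace ℝ (Fin 2) → EuclideanSpace ℝ (Fin 4)), Literature.Topology.FourManifolds.MMSW.IsModelKnot k K₀ → Literature.Topology.FourManifolds.MMSW.IsNullHomologous k K₀ → Literature.Topology.FourManifolds.MMSW.IsModelKnot k K₁ → Literature.Topology.FourManifolds.MMSW.IsNullHomologous k K₁ → Literature.Topology.FourManifolds.MMSW.IsModelSliceDisc k K₁ f₁ → ∀ (X : Type) [TopologicalSpace X] [T2Space X] [SecondCountableTopology X] [ChartedSpace (EuclideanSpace ℝ (Fin 4)) X] [IsManifold (𝓡 4) ((⊤ : ℕ∞) : WithTop ℕ∞) X] [CompactSpace X] (U : Set (EuclideanSpace ℝ (Fin 4))) (i : EuclideanSpace ℝ (Fin 4) → X) (f₀ : EuclideanSpace ℝ (Fin 2) → X) (g₀ : EuclideanSpace ℝ (Fin 2) → EuclideanSpace ℝ (Fin 4)) (E : TopologicalSpace.Opens (EuclideanSpace ℝ (Fin 4))) (j : E → X) (q : X), (IsOpen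 U ∧ Literature.Topology.FourManifolds.MMSW.modelHandlebody k ⊆ U ∧ ContMDiffOn (𝓡 4) (𝓡 4) ((⊤ : ℕ∞) : WithTop ℕ∞) i U ∧ Set.InjOn i U ∧ (∀ x ∈ U, Function.Injective (mfderiv (𝓡 4) (𝓡 4) i x))) → (ContMDiff (𝓡 2) (𝓡 4) ((⊤ : ℕ∞) : WithTop ℕ∞) f₀ ∧ Set.InjOn f₀ (Metric.closedBall (0 : EuclideanSpace ℝ (Fin 2)) 1) ∧ (∀ x ∈ Metric.closedBall (0 : EuclideanSpace ℝ (Fin 2)) 1, Function.Injective (mfderiv (𝓡 2) (𝓡 4) f₀ x)) ∧ (∀ x : EuclideanSpace ℝ (Fin 2), ‖x‖ < 1 → f₀ x ∉ i '' Literature.Topology.FourManifolds.MMSW.modelHandlebody k) ∧ (∀ t : (Metric.sphere (0 : EuclideanSpace ℝ (Fin 2)) 1), f₀ t = i (K₀ t)) ∧ ContDiff ℝ ((⊤ : ℕ∞) : WithTop ℕ∞) g₀ ∧ (∃ η : ℝ, 0 < η ∧ (∀ x : EuclideanSpace ℝ (Fin 2), 1 - η < ‖x‖ → ‖x‖ ≤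 1 → g₀ x ∈ U ∧ f₀ x = i (g₀ x))) ∧ (∀ t : (Metric.sphere (0 : EuclideanSpace ℝ (Fin 2)) 1), deriv (fun ρ : ℝ => Literature.Topology.FourManifolds.MMSW.levelFun k (g₀ (ρ • (t : EuclideanSpace ℝ (Fin 2))))) 1 < 0)) → (((E : Set (EuclideanSpace ℝ (Fin 4))) = {x | x ∉ Literature.Topology.FourManifolds.MMSW.modelHandlebody k ∧ x ∉ f₁ '' Metric.closedBall (0 : EuclideanSpace ℝ (Fin 2)) 1}) ∧ Manifold.IsSmoothEmbedding (𝓡 4) (𝓡 4) ((⊤ : ℕ∞) : WithTop ℕ∞) j ∧ IsOpen (Set.range j) ∧ Set.range j = (i '' Literature.Topology.FourManifolds.MMSW.modelHandlebody k ∪ f₀ '' Metric.closedBall (0 : EuclideanSpace ℝ (Fin 2)) 1 ∪ {q})ᶜ ∧ (∀ s ∈ nhds q, ∃ R : ℝ, ∀ a : E, R < ‖(a : EuclideanSpace ℝ (Fin 4))‖ → j a ∈ s)) → SimplyConnectedSpace X → CategoryTheory.Limits.IsZero (Literature.Topology.FourManifolds.singularHomologyZ X 2)) →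
    (∀ (k : ℕ) (X : Type) [TopologicalSpace X] [T2Space X] [SecondCountableTopology X] [ChartedSpace (EuclideanSpace ℝ (Fin 4)) X] [IsManifold (𝓡 4) ((⊤ : ℕ∞) : WithTop ℕ∞) X] [CompactSpace X], SimplyConnectedSpace X → ∀ (U : Set (EuclideanSpace ℝ (Fin 4))) (i : EuclideanSpace ℝ (Fin 4) → X), (IsOpen U ∧ Literature.Topology.FourManifolds.MMSW.modelHandlebody k ⊆ U ∧ ContMDiffOn (𝓡 4) (𝓡 4) ((⊤ : ℕ∞) : WithTop ℕ∞) i U ∧ Set.InjOn i U ∧ (∀ x ∈ U, Function.Injective (mfderiv (𝓡 4) (𝓡 4) i x))) → ∃ (ε : Fin k → ℤ) (e : EuclideanSpace ℝ (Fin 4) → X), Manifold.IsSmoothEmbedding (𝓡 4) (𝓡 4) ((⊤ : ℕ∞) : WithTop ℕ∞) e ∧ ∀ x ∈ Literature.Topology.FourManifolds.MMSW.modelHandlebody k, e (Literature.Topology.FourManifolds.MMSW.fibreRot (fun z : ℂ => ∏ j : Fin k, ((z - Literature.Topology.FourManifolds.MMSW.holeCentre k j) / (((‖z - Literature.Topology.FourManifolds.MMSW.holeCentre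 k j‖ : ℝ)) : ℂ)) ^ (ε j)) x) = i x) →
    (∃ k : ℕ, 1 ≤ k ∧ ∃ (K₀ K₁ : (Metric.sphere (0 : EuclideanSpace ℝ (Fin 2)) 1) → EuclideanSpace ℝ (Fin 4)) (f₁ : EuclideanSpace ℝ (Fin 2) → EuclideanSpace ℝ (Fin 4)) (T : EuclideanSpace ℝ (Fin 2) × EuclideanSpace ℝ (Fin 2) → EuclideanSpace ℝ (Fin 4)), Literature.Topology.FourManifolds.MMSW.IsModelKnot k K₀ ∧ Literature.Topology.FourManifolds.MMSW.IsNullHomologous k K₀ ∧ (∀ t, Literature.AlgebraicTopology.Homotopy.HopfFibration.wC (K₀ t) ≠ 0) ∧ Literature.Topology.FourManifolds.MMSW.IsModelKnot k K₁ ∧ Literature.Topology.FourManifolds.MMSW.IsNullHomologous k K₁ ∧ (∀ t, Literature.AlgebraicTopology.Homotopy.HopfFibration.wC (K₁ t) ≠ 0) ∧ Literature.Topology.FourManifolds.MMSW.IsModelSliceDisc k K₁ f₁ ∧ (∀ t : (Metric.sphere (0 : EuclideanSpace ℝ (Fin 2)) 1), deriv (fun ρ : ℝ => Literature.Topology.FourManifolds.MMSW.levelFun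 k (f₁ (ρ • (t : EuclideanSpace ℝ (Fin 2))))) 1 < 0) ∧ (ContDiffOn ℝ ((⊤ : ℕ∞) : WithTop ℕ∞) T (Metric.ball (0 : EuclideanSpace ℝ (Fin 2)) 1 ×ˢ Metric.ball (0 : EuclideanSpace ℝ (Fin 2)) 2) ∧ Set.InjOn T (Metric.ball (0 : EuclideanSpace ℝ (Fin 2)) 1 ×ˢ Metric.ball (0 : EuclideanSpace ℝ (Fin 2)) 2) ∧ (∀ q ∈ Metric.ball (0 : EuclideanSpace ℝ (Fin 2)) 1 ×ˢ Metric.ball (0 : EuclideanSpace ℝ (Fin 2)) 2, Function.Injective (fderiv ℝ T q)) ∧ (∀ q ∈ Metric.ball (0 : EuclideanSpace ℝ (Fin 2)) 1 ×ˢ Metric.ball (0 : EuclideanSpace ℝ (Fin 2)) 2, T q ∉ Literature.Topology.FourManifolds.MMSW.modelHandlebody k) ∧ (∀ x ∈ Metric.ball (0 : EuclideanSpace ℝ (Fin 2)) 1, T (x, 0) = f₁ x)) ∧ ∃ (L₀ L₁ : Literature.Topology.FourManifolds.FramedLink (Fin (k + 1))), ((∀ j : Fin k, ⇑(L₀.component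 j.castSucc) = fun θ : (Metric.sphere (0 : EuclideanSpace ℝ (Fin 2)) 1) => Literature.Topology.FourManifolds.MMSW.toSphereThree ((4 * (((j : ℕ) : ℝ) + 1) + Literature.Topology.FourManifolds.MMSW.drawRadius k) * (θ : EuclideanSpace ℝ (Fin 2)) 0, (4 * (((j : ℕ) : ℝ) + 1) + Literature.Topology.FourManifolds.MMSW.drawRadius k) * (θ : EuclideanSpace ℝ (Fin 2)) 1) 0) ∧ ⇑(L₀.component (Fin.last k)) = Literature.Topology.FourManifolds.MMSW.finiteApprox k 0 K₀ ∧ (∀ i, L₀.framing i = 0)) ∧ ((∀ j : Fin k, ⇑(L₁.component j.castSucc) = fun θ : (Metric.sphere (0 : EuclideanSpace ℝ (Fin 2)) 1) => Literature.Topology.FourManifolds.MMSW.toSphereThree ((4 * (((j : ℕ) : ℝ) + 1) + Literature.Topology.FourManifolds.MMSW.drawRadius k) * (θ : EuclideanSpace ℝ (Fin 2)) 0, (4 * (((j : ℕ) : ℝ) + 1) + Literature.Topology.FourManifolds.MMSW.drawRadius k) * (θ : EuclideanSpace ℝ (Fin 2)) 1) 0) ∧ ⇑(L₁.component (Fin.last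 k)) = Literature.Topology.FourManifolds.MMSW.finiteApprox k 0 K₁ ∧ (∀ i, L₁.framing i = 0)) ∧ ∃ (Y : Type) (_ : TopologicalSpace Y) (_ : T2Space Y) (_ : SecondCountableTopology Y) (_ : ChartedSpace (EuclideanSpace ℝ (Fin 3)) Y) (_ : IsManifold (𝓡 3) ((⊤ : ℕ∞) : WithTop ℕ∞) Y) (jA₀ : L₀.toLink.complement → Y) (jB₀ : Fin (k + 1) → Literature.Topology.FourManifolds.solidTorus → Y) (jA₁ : L₁.toLink.complement → Y) (jB₁ : Fin (k + 1) → Literature.Topology.FourManifolds.solidTorus → Y) (μ₀ μ₁ : C((Metric.sphere (0 : EuclideanSpace ℝ (Fin 2)) 1), Y)), (∃ ν : ∀ i, Literature.Topology.FourManifolds.Knot.TubularNbhd (L₀.component i), (∀ i, (ν i).HasFraming (L₀.framing i)) ∧ (Pairwise fun i i' => Disjoint (Set.range (ν i)) (Set.range (ν i'))) ∧ Manifold.IsSmoothEmbedding (𝓡 3) (𝓡 3) ((⊤ : ℕ∞) : WithTop ℕ∞) jA₀ ∧ IsOpen (Set.range jA₀) ∧ (∀ i, Manifold.IsSmoothEmbedding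 (𝓘(ℝ, EuclideanSpace ℝ (Fin 2)).prod (𝓡 1)) (𝓡 3) ((⊤ : ℕ∞) : WithTop ℕ∞) (jB₀ i) ∧ IsOpen (Set.range (jB₀ i))) ∧ Set.range jA₀ ∪ (⋃ i, Set.range (jB₀ i)) = Set.univ ∧ (Pairwise fun i i' => Disjoint (Set.range (jB₀ i)) (Set.range (jB₀ i'))) ∧ ∀ i a b, jA₀ a = jB₀ i b ↔ Literature.Topology.FourManifolds.Link.surgeryRel ν i a b) ∧ (∃ ν : ∀ i, Literature.Topology.FourManifolds.Knot.TubularNbhd (L₁.component i), (∀ i, (ν i).HasFraming (L₁.framing i)) ∧ (Pairwise fun i i' => Disjoint (Set.range (ν i)) (Set.range (ν i'))) ∧ Manifold.IsSmoothEmbedding (𝓡 3) (𝓡 3) ((⊤ : ℕ∞) : WithTop ℕ∞) jA₁ ∧ IsOpen (Set.range jA₁) ∧ (∀ i, Manifold.IsSmoothEmbedding (𝓘(ℝ, EuclideanSpace ℝ (Fin 2)).prod (𝓡 1)) (𝓡 3) ((⊤ : ℕ∞) : WithTop ℕ∞) (jB₁ i) ∧ IsOpen (Set.range (jB₁ i)))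 ∧ Set.range jA₁ ∪ (⋃ i, Set.range (jB₁ i)) = Set.univ ∧ (Pairwise fun i i' => Disjoint (Set.range (jB₁ i)) (Set.range (jB₁ i'))) ∧ ∀ i a b, jA₁ a = jB₁ i b ↔ Literature.Topology.FourManifolds.Link.surgeryRel ν i a b) ∧ (∀ (v : (Metric.sphere (0 : EuclideanSpace ℝ (Fin 2)) 1)) (b : Literature.Topology.FourManifolds.solidTorus), (b : EuclideanSpace ℝ (Fin 2) × (Metric.sphere (0 : EuclideanSpace ℝ (Fin 2)) 1)) = ((0 : EuclideanSpace ℝ (Fin 2)), v) → μ₀ v = jB₀ (Fin.last k) b) ∧ (∀ (v : (Metric.sphere (0 : EuclideanSpace ℝ (Fin 2)) 1)) (b : Literature.Topology.FourManifolds.solidTorus), (b : EuclideanSpace ℝ (Fin 2) × (Metric.sphere (0 : EuclideanSpace ℝ (Fin 2)) 1)) = ((0 : EuclideanSpace ℝ (Fin 2)), v) → μ₁ v = jB₁ (Fin.last k) b) ∧ (∀ (Z : Type) [TopologicalSpace Z] (g : C(Y, Z)), (∃ z : Z, (g.comp μ₀).Homotopic (ContinuousMap.const (Metric.sphere (0 :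 EuclideanSpace ℝ (Fin 2)) 1) z)) → ∃ z : Z, (g.comp μ₁).Homotopic (ContinuousMap.const (Metric.sphere (0 : EuclideanSpace ℝ (Fin 2)) 1) z)) ∧ ∀ ε : Fin k → ℤ, ∃ w : Literature.Topology.FourManifolds.MMSWRasmussen k (Literature.Topology.FourManifolds.MMSW.fibreRot (fun z : ℂ => ∏ j : Fin k, ((z - Literature.Topology.FourManifolds.MMSW.holeCentre k j) / (((‖z - Literature.Topology.FourManifolds.MMSW.holeCentre k j‖ : ℝ)) : ℂ)) ^ (ε j)) ∘ K₀), 0 < w.sMinus ∨ w.sPlus < 0) →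
    Summit.SmoothPoincare4.SmoothPoincare4.Theses.DottedCircleRasmussen.DcrRasmussenWitness := by
  intro hA hB hC hD hG
  obtain ⟨k, hk, K₀, K₁, f₁, T, hK₀, hN₀, hw₀, hK₁, hN₁, hw₁, hf₁, hneat, hT, L₀, L₁, hL₀, hL₁, Y,
    _, _, _, _, _, jA₀, jB₀, jA₁, jB₁, μ₀, μ₁, hP₀, hP₁, hμ₀, hμ₁, hKC, hCert⟩ := hG
  obtain ⟨X, _, _, _, _, _, _, U, i, f₀, g₀, E, j, q, c, m, ℓ, hGerm, hDisc, hExt, hMer, hPush,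
    hcμ₀, hcμ₁⟩ :=
    hA k K₀ K₁ f₁ T hK₀ hw₀ hK₁ hN₁ hw₁ hf₁ hneat hT L₀ L₁ hL₀ hL₁ Y jA₀ jB₀ jA₁ jB₁ μ₀ μ₁ hP₀ hP₁
      hμ₀ hμ₁
  -- (KC) with `Z := X`, `g := c`: the pushed meridian of `Δ₁` is null-homotopic in `X`
  have hℓ : ∃ x₀ : X, ℓ.Homotopic (ContinuousMap.const (𝕊 1) x₀) := hcμ₁ (hKC X c hcμ₀)
  -- π₁ = 1, H₂ = 0, recognition
  have hπ : SimplyConnectedSpace X :=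
    hB k K₀ K₁ f₁ T hK₀ hK₁ hf₁ hT X U i f₀ g₀ E j q m ℓ hGerm hDisc hExt hMer hPush hℓ
  have hH : CategoryTheory.Limits.IsZero (singularHomologyZ X 2) :=
    hC k K₀ K₁ f₁ hK₀ hN₀ hK₁ hN₁ hf₁ X U i f₀ g₀ E j q hGerm hDisc hExt hπ
  have hhe : Nonempty (ContinuousMap.HomotopyEquiv X (𝕊 4)) :=
    (nonempty_homotopyEquiv_sphere_four_iff_holds X).2 ⟨hπ, hH⟩
  -- global chart up to a sector twist
  obtain ⟨ε, e, he, heq⟩ := hD k X hπ U i hGerm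
  have heqH : ∀ x ∈ modelHandlebody k, e (fibreRot (handleMult k ε) x) = i x := fun x hx => heq x hx
  have himg : e '' modelHandlebody k = i '' modelHandlebody k := by
    refine Subset.antisymm ?_ ?_
    · rintro _ ⟨y, hy, rfl⟩
      have h := heqH _ (twist_mem_modelHandlebody (fun j => -ε j) hy)
      rw [twist_twist_neg ε hy] at h
      exact ⟨_, twist_mem_modelHandlebody (fun j => -ε j) hy, h.symm⟩
    · rintro _ ⟨x, hx, rfl⟩
      exact ⟨_, twist_mem_modelHandlebody ε hx, heqH x hx⟩
  obtain ⟨hf₀s, hf₀inj, hf₀imm, hf₀out, hf₀bd, -⟩ := hDisc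
  have hdat : IsSliceDiscInComplement k (fibreRot (handleMult k ε) ∘ K₀) X e f₀ := by
    refine ⟨he, hf₀s, hf₀inj, hf₀imm, fun x hx hmem => hf₀out x hx (himg ▸ hmem), fun t => ?_⟩
    have ht : K₀ t ∈ modelHandlebody k := modelBoundary_subset_modelHandlebody (hK₀.mem t)
    rw [hf₀bd t, Function.comp_apply, heqH (K₀ t) ht]
  -- the certificate is SECTOR-SATURATED (v5): read it in the sector `ε` produced by stub D
  obtain ⟨w, hw⟩ := hCert ε
  exact ⟨k, hk, fibreRot (handleMult k ε) ∘ K₀, w.isModelKnot, w.isNullHomologous,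
    ⟨X, _, ‹_›, ‹_›, _, ‹_›, hhe, e, f₀, hdat⟩, w, hw⟩

/-- **THE SKELETON'S COMPOSITION — `DcrGap` BY NAME from the registered stubs (v7: stubs V_k, Data, L8.19, G)** (closed modulo
their `sorry`s only): the witness assembled by `dcrRasmussenWitness_of_parts` from stubs A–E and G,
fed with the GFGMW window (stub F, the body of the route's `DcrGfgmw`) into the route's LANDED engine
glue `Theorems.DcrEngineGlue_proof : DcrRasmussenWitness → DcrGfgmw → DcrGap` (transport along
`N ≃ₘ S⁴`, honouring `dcrGap_false_without_diffeo`); stubs A B C D and G feed the witness, F the window. [cite: ManolescuPiccirillo2023, Lemma 3.3]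
[cite: ManolescuMarengonSarkarWillis2023, Lemma 8.19 and Thm. 2.8] -/
theorem DcrGap_of : Summit.SmoothPoincare4.SmoothPoincare4.Theses.DottedCircleRasmussen.DcrGap :=
  Summit.SmoothPoincare4.SmoothPoincare4.Theorems.DcrEngineGlue_proof
    (dcrRasmussenWitness_of_parts friendsCarrier_of_parts friendsPi1 friendsH2 handlebodyChart_of_parts
      stub_friendsDatum)
    gfgmwWindow_of_mmsw819

/-! ## Conditional closure of the ENGINE from the explicit debt list (sorry-free) -/

/-- **The route's ENGINE `DcrRasmussenWitness` from the v7 debts of line `mk_friends`** (sorry-free; uses no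
stub): hypotheses `hV` = V_k (registered stub `helper_friendsCarrier_Vk`, stated fully qualified), `hD` = the
model handle data (registered stub `helper_handlebodyChart_modelHandles_data`), `hG` = the friends datum with
sector-saturated certificate (stub G).  Everything else the line needs is LANDED or DISCHARGED: P_k
(`pictureSurgeryPresentation_holds`), T_k (`helper_friendsCarrier_Tk`), the gluing reduction
(`stub_friendsCarrier_of_collars`), B (`stub_friendsPi1`), C (`stub_friendsH2`), M1/M2
(`oneHandle_ambientIsotopic_upToTwist_holds`, `arcs_ambientIsotopic_rel_of_homotopicRel_holds`), M3-from-data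
(`helper_handlebodyChart_modelHandles_of_data`), the D-reduction (`helper_handlebodyChart_of_facts2`) and the
recognition theorem.  The crux itself is then `DcrEngineGlue_proof (this hV hD hG) (DcrGfgmw_of_mmsw819 h19)`.
[cite: ManolescuPiccirillo2023, Lemma 3.3] [cite: ManolescuMarengonSarkarWillis2023, Thm. 2.8 and Thm. 3.3] -/
theorem dcrRasmussenWitness_of_debts
    (hV : ∀ (k : ℕ) (K₁ : (Metric.sphere (0 : EuclideanSpace ℝ (Fin 2)) 1) → EuclideanSpace ℝ (Fin 4)) (f₁ : EuclideanSpace ℝ (Fin 2) → EuclideanSpace ℝ (Fin 4)) (T : EuclideanSpace ℝ (Fin 2) × EuclideanSpace ℝ (Fin 2) → EuclideanSpace ℝ (Fin 4)), Literature.Topology.FourManifolds.MMSW.IsModelKnot k K₁ → Literature.Topology.FourManifolds.MMSW.IsNullHomologous k K₁ → (∀ t, Literature.AlgebraicTopology.Homotopy.HopfFibration.wC (K₁ t) ≠ 0) → Literature.Topology.FourManifolds.MMSW.IsModelSliceDisc k K₁ f₁ → (∀ t : (Metric.sphere (0 : EuclideanSpace ℝ (Fin 2)) 1), deriv (fun ρ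 : ℝ => Literature.Topology.FourManifolds.MMSW.levelFun k (f₁ (ρ • (t : EuclideanSpace ℝ (Fin 2))))) 1 < 0) → (ContDiffOn ℝ ((⊤ : ℕ∞) : WithTop ℕ∞) T (Metric.ball (0 : EuclideanSpace ℝ (Fin 2)) 1 ×ˢ Metric.ball (0 : EuclideanSpace ℝ (Fin 2)) 2) ∧ Set.InjOn T (Metric.ball (0 : EuclideanSpace ℝ (Fin 2)) 1 ×ˢ Metric.ball (0 : EuclideanSpace ℝ (Fin 2)) 2) ∧ (∀ q ∈ Metric.ball (0 : EuclideanSpace ℝ (Fin 2)) 1 ×ˢ Metric.ball (0 : EuclideanSpace ℝ (Fin 2)) 2, Function.Injective (fderiv ℝ T q)) ∧ (∀ q ∈ Metric.ball (0 : EuclideanSpace ℝ (Fin 2)) 1 ×ˢ Metric.ball (0 : EuclideanSpace ℝ (Fin 2)) 2, T q ∉ Literature.Topology.FourManifolds.MMSW.modelHandlebody k) ∧ (∀ x ∈ Metric.ball (0 : EuclideanSpace ℝ (Fin 2)) 1, T (x, 0) = f₁ x)) → ∀ (Y : Type) [TopologicalSpace Y] [T2Space Y] [SecondCountableTopology Y]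 [ChartedSpace (EuclideanSpace ℝ (Fin 3)) Y] [IsManifold (𝓡 3) ((⊤ : ℕ∞) : WithTop ℕ∞) Y] (jB : Literature.Topology.FourManifolds.solidTorus → Y) (μ₁ : C((Metric.sphere (0 : EuclideanSpace ℝ (Fin 2)) 1), Y)) (νK : (Metric.sphere (0 : EuclideanSpace ℝ (Fin 2)) 1) × EuclideanSpace ℝ (Fin 2) → EuclideanSpace ℝ (Fin 4)) (jM : EuclideanSpace ℝ (Fin 4) → Y) (W : Set (EuclideanSpace ℝ (Fin 4))) (ψ : Y → EuclideanSpace ℝ (Fin 4)), (Manifold.IsSmoothEmbedding (𝓘(ℝ, EuclideanSpace ℝ (Fin 2)).prod (𝓡 1)) (𝓡 3) ((⊤ : ℕ∞) : WithTop ℕ∞) jB ∧ IsOpen (Set.range jB) ∧ ContMDiff ((𝓡 1).prod 𝓘(ℝ, EuclideanSpace ℝ (Fin 2))) 𝓘(ℝ, EuclideanSpace ℝ (Fin 4)) ((⊤ : ℕ∞) : WithTop ℕ∞) νK ∧ Function.Injective νK ∧ (∀ p, Function.Injective (mfderiv ((𝓡 1).prod 𝓘(ℝ, EuclideanSpace ℝ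 (Fin 2))) 𝓘(ℝ, EuclideanSpace ℝ (Fin 4)) νK p)) ∧ (∀ p, νK p ∈ Literature.Topology.FourManifolds.MMSW.modelBoundary k) ∧ (∀ u : (Metric.sphere (0 : EuclideanSpace ℝ (Fin 2)) 1), νK (u, 0) = K₁ u) ∧ IsOpen W ∧ (∀ x ∈ Literature.Topology.FourManifolds.MMSW.modelBoundary k, x ∉ Set.range K₁ → x ∈ W) ∧ ContMDiffOn 𝓘(ℝ, EuclideanSpace ℝ (Fin 4)) (𝓡 3) ((⊤ : ℕ∞) : WithTop ℕ∞) jM W ∧ IsOpen (jM '' {x : EuclideanSpace ℝ (Fin 4) | x ∈ Literature.Topology.FourManifolds.MMSW.modelBoundary k ∧ x ∉ Set.range K₁}) ∧ ContMDiffOn (𝓡 3) 𝓘(ℝ, EuclideanSpace ℝ (Fin 4)) ((⊤ : ℕ∞) : WithTop ℕ∞) ψ (jM '' {x : EuclideanSpace ℝ (Fin 4) | x ∈ Literature.Topology.FourManifolds.MMSW.modelBoundary k ∧ x ∉ Set.range K₁}) ∧ (∀ x ∈ Literature.Topology.FourManifolds.MMSW.modelBoundary k, x ∉ Set.range K₁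 → ψ (jM x) = x) ∧ jM '' {x : EuclideanSpace ℝ (Fin 4) | x ∈ Literature.Topology.FourManifolds.MMSW.modelBoundary k ∧ x ∉ Set.range K₁} ∪ Set.range jB = Set.univ ∧ (∀ x ∈ Literature.Topology.FourManifolds.MMSW.modelBoundary k, x ∉ Set.range K₁ → ∀ b : Literature.Topology.FourManifolds.solidTorus, jM x = jB b ↔ ∃ (u : (Metric.sphere (0 : EuclideanSpace ℝ (Fin 2)) 1)) (t : ℝ), t ∈ Set.Ioo (0 : ℝ) 1 ∧ (b : EuclideanSpace ℝ (Fin 2) × (Metric.sphere (0 : EuclideanSpace ℝ (Fin 2)) 1)).1 = t • (u : EuclideanSpace ℝ (Fin 2)) ∧ x = νK (u, t • ((b : EuclideanSpace ℝ (Fin 2) × (Metric.sphere (0 : EuclideanSpace ℝ (Fin 2)) 1)).2 : EuclideanSpace ℝ (Fin 2))))) → (∀ (v : (Metric.sphere (0 : EuclideanSpace ℝ (Fin 2)) 1)) (b : Literature.Topology.FourManifolds.solidTorus), (b : EuclideanSpace ℝ (Fin 2) × (Metric.sphere (0 : EuclideanSpace ℝ (Fin 2)) 1)) = ((0 : EuclideanSpace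 ℝ (Fin 2)), v) → μ₁ v = jB b) → ∀ (J : Literature.Topology.FourManifolds.Knot) (ν' : Literature.Topology.FourManifolds.Knot.TubularNbhd J) (r : ℝ), (∀ p, Literature.AlgebraicTopology.Homotopy.HopfFibration.wC (νK p) ≠ 0) ∧ ν'.HasFraming 0 ∧ 0 < r ∧ (∀ (u : (Metric.sphere (0 : EuclideanSpace ℝ (Fin 2)) 1)) (w : EuclideanSpace ℝ (Fin 2)), ‖w‖ < 1 → Literature.Topology.FourManifolds.MMSW.toSphereThree (Literature.Topology.FourManifolds.MMSW.draw k (νK (u, w))).1 (Literature.Topology.FourManifolds.MMSW.draw k (νK (u, w))).2 = ν' (u, r • w)) → ∀ (E F : TopologicalSpace.Opens (EuclideanSpace ℝ (Fin 4))), (E : Set (EuclideanSpace ℝ (Fin 4))) = {x | x ∉ Literature.Topology.FourManifolds.MMSW.modelHandlebody k ∧ x ∉ f₁ '' Metric.closedBall (0 : EuclideanSpace ℝ (Fin 2)) 1} → (F : Set (EuclideanSpace ℝ (Fin 4))) = {0} ∪ {y : EuclideanSpace ℝ (Fin 4) | y ≠ 0 ∧ (‖y‖ ^ 2)⁻¹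 • y ∉ Literature.Topology.FourManifolds.MMSW.modelHandlebody k ∧ (‖y‖ ^ 2)⁻¹ • y ∉ f₁ '' Metric.closedBall (0 : EuclideanSpace ℝ (Fin 2)) 1} → ∃ c : OpenPartialHomeomorph (Y × ℝ) F, c.source = Set.univ ∧ ContMDiffOn ((𝓡 3).prod 𝓘(ℝ, ℝ)) (𝓡 4) ((⊤ : ℕ∞) : WithTop ℕ∞) c c.source ∧ ContMDiffOn (𝓡 4) ((𝓡 3).prod 𝓘(ℝ, ℝ)) ((⊤ : ℕ∞) : WithTop ℕ∞) c.symm c.target ∧ (∀ a : ℝ, IsClosed (c '' {q | q.2 ≤ a})) ∧ (∀ a : ℝ, IsCompact (c.targetᶜ ∪ c '' {q | a ≤ q.2})) ∧ ∀ (L₁ L₂ : C((Metric.sphere (0 : EuclideanSpace ℝ (Fin 2)) 1), F)), (∀ v, L₁ v = c (μ₁ v, 0)) → (∀ v : (Metric.sphere (0 : EuclideanSpace ℝ (Fin 2)) 1), ((L₂ v : F) : EuclideanSpace ℝ (Fin 4)) = (‖T ((0 : EuclideanSpace ℝ (Fin 2)), (1 / 2 : ℝ) • (v : EuclideanSpace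 ℝ (Fin 2)))‖ ^ 2)⁻¹ • T ((0 : EuclideanSpace ℝ (Fin 2)), (1 / 2 : ℝ) • (v : EuclideanSpace ℝ (Fin 2)))) → ∀ (Z : Type) [TopologicalSpace Z] (g : C(F, Z)), (∃ z : Z, (g.comp L₁).Homotopic (ContinuousMap.const (Metric.sphere (0 : EuclideanSpace ℝ (Fin 2)) 1) z)) → ∃ z : Z, (g.comp L₂).Homotopic (ContinuousMap.const (Metric.sphere (0 : EuclideanSpace ℝ (Fin 2)) 1) z))
    (hD : ∀ (k : ℕ), ∃ (c : EuclideanSpace ℝ (Fin 4)) (a : ℝ) (W : Set (EuclideanSpace ℝ (Fin 4))) (h : Fin k → EuclideanSpace ℝ (Fin 4) → EuclideanSpace ℝ (Fin 4)), (0 < a ∧ Metric.closedBall c (3 * a / 2) ⊆ Literature.Topology.FourManifolds.MMSW.modelHandlebody k ∧ IsOpen W ∧ {p : EuclideanSpace ℝ (Fin 4) | |p 0| ≤ 1 ∧ (p 1) ^ 2 + (p 2) ^ 2 + (p 3) ^ 2 ≤ 1} ⊆ W ∧ (∀ j, ContDiffOn ℝ ((⊤ : ℕ∞) : WithTop ℕ∞)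 (h j) W ∧ Set.InjOn (h j) W ∧ (∀ p ∈ W, Function.Injective (fderiv ℝ (h j) p)) ∧ Set.MapsTo (h j) W (Literature.Topology.FourManifolds.MMSW.modelHandlebody k)) ∧ (∀ j l, j ≠ l → ∀ p ∈ W, ∀ q ∈ W, h j p ≠ h l q) ∧ (∀ j, ∀ p ∈ W, 1 / 2 ≤ |p 0| → dist (h j p) c = a * (2 - |p 0|)) ∧ (∀ j, ∀ p ∈ W, |p 0| ≤ 1 / 2 → 3 * a / 2 ≤ dist (h j p) c)) ∧ (∀ j (β : ℝ), ∀ p ∈ W, h j (!₂[p 0, p 1, Real.cos β * p 2 - Real.sin β * p 3, Real.sin β * p 2 + Real.cos β * p 3]) = Literature.Topology.FourManifolds.MMSW.fibreRot (fun _ => Complex.exp ((β : ℂ) * Complex.I)) (h j p)) ∧ (∀ (m : Fin k → ℤ) (ρ : ℝ), ρ < 3 * a / 2 → ∃ (ε : Fin k → ℤ) (N' : Set (EuclideanSpace ℝ (Fin 4))) (Θ : EuclideanSpace ℝ (Fin 4) → ℝ), IsOpen N' ∧ Metric.closedBall c ρ ⊆ N' ∧ (∀ j, h j '' {p : EuclideanSpace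 ℝ (Fin 4) | |p 0| ≤ 1 ∧ (p 1) ^ 2 + (p 2) ^ 2 + (p 3) ^ 2 ≤ 1} ⊆ N') ∧ ContDiffOn ℝ ((⊤ : ℕ∞) : WithTop ℕ∞) Θ N' ∧ (∀ v : ℂ, ‖v‖ = 1 → ∀ y ∈ N', Θ (Literature.Topology.FourManifolds.MMSW.fibreRot (fun _ => v) y) = Θ y) ∧ (∀ y ∈ N', dist y c ≤ ρ → Complex.exp ((Θ y : ℂ) * Complex.I) * ∏ l : Fin k, ((Literature.AlgebraicTopology.Homotopy.HopfFibration.zC y - Literature.Topology.FourManifolds.MMSW.holeCentre k l) / (((‖Literature.AlgebraicTopology.Homotopy.HopfFibration.zC y - Literature.Topology.FourManifolds.MMSW.holeCentre k l‖ : ℝ)) : ℂ)) ^ (ε l) = 1) ∧ (∀ j, ∀ p ∈ W, h j p ∈ N' → Complex.exp ((Θ (h j p) : ℂ) * Complex.I) * ∏ l : Fin k, ((Literature.AlgebraicTopology.Homotopy.HopfFibration.zC (h j p) - Literature.Topology.FourManifolds.MMSW.holeCentre k l) / (((‖Literature.AlgebraicTopology.Homotopy.HopfFibration.zC (h j p)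 - Literature.Topology.FourManifolds.MMSW.holeCentre k l‖ : ℝ)) : ℂ)) ^ (ε l) = Complex.exp (((2 * Real.pi * (m j : ℝ) * Real.smoothTransition (p 0 + 1 / 2) : ℝ) : ℂ) * Complex.I))) ∧ (∀ (U : Set (EuclideanSpace ℝ (Fin 4))) (ρ : ℝ), IsOpen U → Literature.Topology.FourManifolds.MMSW.modelHandlebody k ⊆ U → a < ρ → ρ < 3 * a / 2 → ∃ (κ : EuclideanSpace ℝ (Fin 4) ≃ₘ⟮𝓡 4, 𝓡 4⟯ EuclideanSpace ℝ (Fin 4)) (K N₀ : Set (EuclideanSpace ℝ (Fin 4))) (SW : Fin k → EuclideanSpace ℝ (Fin 4) → ℝ), IsCompact K ∧ K ⊆ U ∧ (∀ x, x ∉ K → κ x = x) ∧ (∀ v : ℂ, ‖v‖ = 1 → ∀ x, κ (Literature.Topology.FourManifolds.MMSW.fibreRot (fun _ => v) x) = Literature.Topology.FourManifolds.MMSW.fibreRot (fun _ => v) (κ x)) ∧ (∀ x ∈ Literature.Topology.FourManifolds.MMSW.modelHandlebody k, κ x ∈ Metric.closedBall c ρ ∨ ∃ j, ∃ p ∈ {p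 : EuclideanSpace ℝ (Fin 4) | |p 0| ≤ 1 ∧ (p 1) ^ 2 + (p 2) ^ 2 + (p 3) ^ 2 ≤ 1}, κ x = h j p) ∧ IsOpen N₀ ∧ Literature.Topology.FourManifolds.MMSW.modelHandlebody k ⊆ N₀ ∧ (∀ l, ContDiffOn ℝ ((⊤ : ℕ∞) : WithTop ℕ∞) (SW l) N₀) ∧ (∀ l (v : ℂ), ‖v‖ = 1 → ∀ x, SW l (Literature.Topology.FourManifolds.MMSW.fibreRot (fun _ => v) x) = SW l x) ∧ ∀ l, ∀ x ∈ Literature.Topology.FourManifolds.MMSW.modelHandlebody k, (Literature.AlgebraicTopology.Homotopy.HopfFibration.zC (κ x) - Literature.Topology.FourManifolds.MMSW.holeCentre k l) / ((‖Literature.AlgebraicTopology.Homotopy.HopfFibration.zC (κ x) - Literature.Topology.FourManifolds.MMSW.holeCentre k l‖ : ℝ) : ℂ) = Complex.exp ((SW l x : ℂ) * Complex.I) * ((Literature.AlgebraicTopology.Homotopy.HopfFibration.zC x - Literature.Topology.FourManifolds.MMSW.holeCentre k l) / ((‖Literature.AlgebraicTopology.Homotopy.HopfFibration.zC x - Literature.Topology.FourManifolds.MMSW.holeCentre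 k l‖ : ℝ) : ℂ))))
    (hG : ∃ k : ℕ, 1 ≤ k ∧ ∃ (K₀ K₁ : (Metric.sphere (0 : EuclideanSpace ℝ (Fin 2)) 1) → EuclideanSpace ℝ (Fin 4)) (f₁ : EuclideanSpace ℝ (Fin 2) → EuclideanSpace ℝ (Fin 4)) (T : EuclideanSpace ℝ (Fin 2) × EuclideanSpace ℝ (Fin 2) → EuclideanSpace ℝ (Fin 4)), Literature.Topology.FourManifolds.MMSW.IsModelKnot k K₀ ∧ Literature.Topology.FourManifolds.MMSW.IsNullHomologous k K₀ ∧ (∀ t, Literature.AlgebraicTopology.Homotopy.HopfFibration.wC (K₀ t) ≠ 0) ∧ Literature.Topology.FourManifolds.MMSW.IsModelKnot k K₁ ∧ Literature.Topology.FourManifolds.MMSW.IsNullHomologous k K₁ ∧ (∀ t, Literature.AlgebraicTopology.Homotopy.HopfFibration.wC (K₁ t) ≠ 0) ∧ Literature.Topology.FourManifolds.MMSW.IsModelSliceDisc k K₁ f₁ ∧ (∀ t : (Metric.sphere (0 : EuclideanSpace ℝ (Fin 2)) 1), deriv (fun ρ : ℝ => Literature.Topology.FourManifolds.MMSW.levelFun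 k (f₁ (ρ • (t : EuclideanSpace ℝ (Fin 2))))) 1 < 0) ∧ (ContDiffOn ℝ ((⊤ : ℕ∞) : WithTop ℕ∞) T (Metric.ball (0 : EuclideanSpace ℝ (Fin 2)) 1 ×ˢ Metric.ball (0 : EuclideanSpace ℝ (Fin 2)) 2) ∧ Set.InjOn T (Metric.ball (0 : EuclideanSpace ℝ (Fin 2)) 1 ×ˢ Metric.ball (0 : EuclideanSpace ℝ (Fin 2)) 2) ∧ (∀ q ∈ Metric.ball (0 : EuclideanSpace ℝ (Fin 2)) 1 ×ˢ Metric.ball (0 : EuclideanSpace ℝ (Fin 2)) 2, Function.Injective (fderiv ℝ T q)) ∧ (∀ q ∈ Metric.ball (0 : EuclideanSpace ℝ (Fin 2)) 1 ×ˢ Metric.ball (0 : EuclideanSpace ℝ (Fin 2)) 2, T q ∉ Literature.Topology.FourManifolds.MMSW.modelHandlebody k) ∧ (∀ x ∈ Metric.ball (0 : EuclideanSpace ℝ (Fin 2)) 1, T (x, 0) = f₁ x)) ∧ ∃ (L₀ L₁ : Literature.Topology.FourManifolds.FramedLink (Fin (k + 1))), ((∀ j : Fin k, ⇑(L₀.component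 j.castSucc) = fun θ : (Metric.sphere (0 : EuclideanSpace ℝ (Fin 2)) 1) => Literature.Topology.FourManifolds.MMSW.toSphereThree ((4 * (((j : ℕ) : ℝ) + 1) + Literature.Topology.FourManifolds.MMSW.drawRadius k) * (θ : EuclideanSpace ℝ (Fin 2)) 0, (4 * (((j : ℕ) : ℝ) + 1) + Literature.Topology.FourManifolds.MMSW.drawRadius k) * (θ : EuclideanSpace ℝ (Fin 2)) 1) 0) ∧ ⇑(L₀.component (Fin.last k)) = Literature.Topology.FourManifolds.MMSW.finiteApprox k 0 K₀ ∧ (∀ i, L₀.framing i = 0)) ∧ ((∀ j : Fin k, ⇑(L₁.component j.castSucc) = fun θ : (Metric.sphere (0 : EuclideanSpace ℝ (Fin 2)) 1) => Literature.Topology.FourManifolds.MMSW.toSphereThree ((4 * (((j : ℕ) : ℝ) + 1) + Literature.Topology.FourManifolds.MMSW.drawRadius k) * (θ : EuclideanSpace ℝ (Fin 2)) 0, (4 * (((j : ℕ) : ℝ) + 1) + Literature.Topology.FourManifolds.MMSW.drawRadius k) * (θ : EuclideanSpace ℝ (Fin 2)) 1) 0) ∧ ⇑(L₁.component (Fin.last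 k)) = Literature.Topology.FourManifolds.MMSW.finiteApprox k 0 K₁ ∧ (∀ i, L₁.framing i = 0)) ∧ ∃ (Y : Type) (_ : TopologicalSpace Y) (_ : T2Space Y) (_ : SecondCountableTopology Y) (_ : ChartedSpace (EuclideanSpace ℝ (Fin 3)) Y) (_ : IsManifold (𝓡 3) ((⊤ : ℕ∞) : WithTop ℕ∞) Y) (jA₀ : L₀.toLink.complement → Y) (jB₀ : Fin (k + 1) → Literature.Topology.FourManifolds.solidTorus → Y) (jA₁ : L₁.toLink.complement → Y) (jB₁ : Fin (k + 1) → Literature.Topology.FourManifolds.solidTorus → Y) (μ₀ μ₁ : C((Metric.sphere (0 : EuclideanSpace ℝ (Fin 2)) 1), Y)), (∃ ν : ∀ i, Literature.Topology.FourManifolds.Knot.TubularNbhd (L₀.component i), (∀ i, (ν i).HasFraming (L₀.framing i)) ∧ (Pairwise fun i i' => Disjoint (Set.range (ν i)) (Set.range (ν i'))) ∧ Manifold.IsSmoothEmbedding (𝓡 3) (𝓡 3) ((⊤ : ℕ∞) : WithTop ℕ∞) jA₀ ∧ IsOpen (Set.range jA₀) ∧ (∀ i, Manifold.IsSmoothEmbedding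 (𝓘(ℝ, EuclideanSpace ℝ (Fin 2)).prod (𝓡 1)) (𝓡 3) ((⊤ : ℕ∞) : WithTop ℕ∞) (jB₀ i) ∧ IsOpen (Set.range (jB₀ i))) ∧ Set.range jA₀ ∪ (⋃ i, Set.range (jB₀ i)) = Set.univ ∧ (Pairwise fun i i' => Disjoint (Set.range (jB₀ i)) (Set.range (jB₀ i'))) ∧ ∀ i a b, jA₀ a = jB₀ i b ↔ Literature.Topology.FourManifolds.Link.surgeryRel ν i a b) ∧ (∃ ν : ∀ i, Literature.Topology.FourManifolds.Knot.TubularNbhd (L₁.component i), (∀ i, (ν i).HasFraming (L₁.framing i)) ∧ (Pairwise fun i i' => Disjoint (Set.range (ν i)) (Set.range (ν i'))) ∧ Manifold.IsSmoothEmbedding (𝓡 3) (𝓡 3) ((⊤ : ℕ∞) : WithTop ℕ∞) jA₁ ∧ IsOpen (Set.range jA₁) ∧ (∀ i, Manifold.IsSmoothEmbedding (𝓘(ℝ, EuclideanSpace ℝ (Fin 2)).prod (𝓡 1)) (𝓡 3) ((⊤ : ℕ∞) : WithTop ℕ∞) (jB₁ i) ∧ IsOpen (Set.range (jB₁ i)))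 ∧ Set.range jA₁ ∪ (⋃ i, Set.range (jB₁ i)) = Set.univ ∧ (Pairwise fun i i' => Disjoint (Set.range (jB₁ i)) (Set.range (jB₁ i'))) ∧ ∀ i a b, jA₁ a = jB₁ i b ↔ Literature.Topology.FourManifolds.Link.surgeryRel ν i a b) ∧ (∀ (v : (Metric.sphere (0 : EuclideanSpace ℝ (Fin 2)) 1)) (b : Literature.Topology.FourManifolds.solidTorus), (b : EuclideanSpace ℝ (Fin 2) × (Metric.sphere (0 : EuclideanSpace ℝ (Fin 2)) 1)) = ((0 : EuclideanSpace ℝ (Fin 2)), v) → μ₀ v = jB₀ (Fin.last k) b) ∧ (∀ (v : (Metric.sphere (0 : EuclideanSpace ℝ (Fin 2)) 1)) (b : Literature.Topology.FourManifolds.solidTorus), (b : EuclideanSpace ℝ (Fin 2) × (Metric.sphere (0 : EuclideanSpace ℝ (Fin 2)) 1)) = ((0 : EuclideanSpace ℝ (Fin 2)), v) → μ₁ v = jB₁ (Fin.last k) b) ∧ (∀ (Z : Type) [TopologicalSpace Z] (g : C(Y, Z)), (∃ z : Z, (g.comp μ₀).Homotopic (ContinuousMap.const (Metric.sphere (0 :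 EuclideanSpace ℝ (Fin 2)) 1) z)) → ∃ z : Z, (g.comp μ₁).Homotopic (ContinuousMap.const (Metric.sphere (0 : EuclideanSpace ℝ (Fin 2)) 1) z)) ∧ ∀ ε : Fin k → ℤ, ∃ w : Literature.Topology.FourManifolds.MMSWRasmussen k (Literature.Topology.FourManifolds.MMSW.fibreRot (fun z : ℂ => ∏ j : Fin k, ((z - Literature.Topology.FourManifolds.MMSW.holeCentre k j) / (((‖z - Literature.Topology.FourManifolds.MMSW.holeCentre k j‖ : ℝ)) : ℂ)) ^ (ε j)) ∘ K₀), 0 < w.sMinus ∨ w.sPlus < 0) :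
    Summit.SmoothPoincare4.SmoothPoincare4.Theses.DottedCircleRasmussen.DcrRasmussenWitness :=
  dcrRasmussenWitness_of_parts
    (Summit.SmoothPoincare4.SmoothPoincare4.Theorems.DcrGap.MkFriends.stub_friendsCarrier_of_collars
      Literature.Topology.FourManifolds.pictureSurgeryPresentation_holds
      Summit.SmoothPoincare4.SmoothPoincare4.Theorems.DcrGap.MkFriends.helper_friendsCarrier_Tk hV)
    Summit.SmoothPoincare4.SmoothPoincare4.Theorems.DcrGap.MkFriends.stub_friendsPi1
    Summit.SmoothPoincare4.SmoothPoincare4.Theorems.DcrGap.MkFriends.stub_friendsH2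
    (Summit.SmoothPoincare4.SmoothPoincare4.Theorems.DcrGap.MkFriends.helper_handlebodyChart_of_facts2
      Literature.Topology.FourManifolds.oneHandle_ambientIsotopic_upToTwist_holds
      Literature.Topology.FourManifolds.arcs_ambientIsotopic_rel_of_homotopicRel_holds
      (Summit.SmoothPoincare4.SmoothPoincare4.Theorems.DcrGap.MkFriends.helper_handlebodyChart_modelHandles_of_data hD))
    hG

/-! ## Cross-check against the landed Negative lemmas (scratch import; not registered)

The three `Theorems/DcrGap/Negative/*` files are imported above so that this skeleton elaborates
together with them.  `KZeroIsFgmw` (p130570) pins the `k = 0` layer to the FGMW waypoint — stub G has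
`k ≥ 1`; `NoEmbedding` (p130705) says no carrier of a witness datum embeds in `S⁴` — a filter on the
`X` of stub A, asserted nowhere; `NoDiscNormalForm` (p130342) is the normal form the line's output
satisfies, as the next theorem records. -/

/-- **The line's witness in the disprover's normal form** (landed `Negative.dcrGap_iff_modelForm`,
p130342): from the stubs, some model knot — here the sector-twisted `τ^ε ∘ K₀` — is dotted-slice in a
homotopy `4`-sphere and bounds NO smooth proper disc in `ℝ⁴ ∖ D_k`. [cite: Palais1960, Thm. B] -/
theorem modelForm_of_stubs :
    ∃ (k : ℕ) (K : 𝕊 1 → 𝔼 4), IsModelKnot k K ∧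
      (∃ (M : Type) (_ : TopologicalSpace M) (_ : T2Space M) (_ : SecondCountableTopology M)
          (_ : ChartedSpace (𝔼 4) M) (_ : IsManifold (𝓡 4) ∞ M),
          Nonempty (ContinuousMap.HomotopyEquiv M (𝕊 4)) ∧
            ∃ (e : 𝔼 4 → M) (f : 𝔼 2 → M), IsSliceDiscInComplement k K M e f) ∧
      ∀ g, ¬ IsModelSliceDisc k K g :=
  Summit.SmoothPoincare4.SmoothPoincare4.Theorems.DcrGap.Negative.dcrGap_iff_modelForm.1 DcrGap_of

end Summit.SmoothPoincare4.SmoothPoincare4.Cruxes.DcrGap.MkFriends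

end
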